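import Literature.Analysis.ValidatedNumerics.ParametricLyapunovAffineCertificate
import Literature.LinearAlgebra.Matrix.LyapunovConnectedFamily
import HarnessLib

/-!
# Taylor–Lyapunov certificates of ANY ORDER: `Re μ ≤ −r` on a box with a leaf-wise polynomial `P(δ)`

Topic `Literature/Analysis/ValidatedNumerics`. Third file of the S3 («Lyapunov shape») line of the
certnum eigen-margin call (design note `run/shared/lean/pub/certnum/sdp/DESIGN-eigopt.md` §1 S3),
after `ParametricLyapunovCertificate.lean` (one constant `P` per kd-leaf) and
`ParametricLyapunovAffineCertificate.lean` (an affine `P(δ)` per leaf, second-order remainder).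

THE LEVER. For the real affine family `J(x) = J₀ + Σ_k x_k J^{(k)}` and a leaf with centre `c` and
half-widths `w` (centred coordinates `δ = x − c`, `|δ_k| ≤ w_k`), the leaf carries a matrix
POLYNOMIAL `P(δ) = Σ_i δ^{α_i} P_i` (any finite list of multi-indices `α_i`; in practice all
`|α| ≤ d`, the `P_α` proposed by `d` nested float Lyapunov solves at the centre so that the Taylor
coefficients of `Q(δ) := −(J(c+δ)ᵀP(δ) + P(δ)J(c+δ))` of order `1 … d` (nearly) cancel). The checker
REGROUPS the exact products by monomial — `Q(δ) = Σ_j δ^{β_j} Q_j` with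
`Q_j = Σ_{α_i = β_j} −(J_cᵀP_i + P_iJ_c) + Σ_{α_i + e_k = β_j} −(J^{(k)ᵀ}P_i + P_iJ^{(k)})` — and certifies,
with ONE `LDLCert` each, (a) `P(0) ⪰ κ·1`, `κ > 0` (exact), (b) `−P(δ) ⪰ −π·1` on the leaf through the
centred interval family `[−P(0) ± Σ_{α_i ≠ 0} w^{α_i}|P_i|]`, (c) `Q(δ) ⪰ m·1`, `m > 0`, on the leaf
through `[Σ_{β_j = 0} Q_j ± Σ_{β_j ≠ 0} w^{β_j}|Q_j|]`, and `2·π·r ≤ m`. The remainder radius is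
`O(w^{d+1})`, so leaves can be MUCH larger than with `d ≤ 1`, and a leaf costs three certificates
instead of `3·2^K` corner certificates.

THE MATHEMATICAL POINT (why no certificate for `P(δ) ≻ 0` on the leaf is needed, only at its centre):
`Literature.LinearAlgebra.Matrix.posDef_on_of_lyapunov_pos` (file `LyapunovConnectedFamily.lean`) — if
`P` is continuous and symmetric on a preconnected parameter set `S`,
the Lyapunov form `−(J(x)ᵀP(x) + P(x)J(x))` is positive definite at every `x ∈ S`, and `P(x₀) ≻ 0` at
ONE point `x₀ ∈ S`, then `P(x) ≻ 0` on all of `S`. (The set where `P ≻ 0` is relatively open; the set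
where `P ⪰ 0` is relatively closed and, because a singular `P ⪰ 0` with `Pv = 0`, `v ≠ 0`, would give
`vᵀQv = 0`, coincides with it; a clopen non-empty subset of a preconnected set is everything.) This is
the continuity half of the classical boundary-crossing argument of parametric robust stability; with
it, Lyapunov's theorem (`LyapunovDecayRate.lean`) applies pointwise on the leaf and gives
`Re μ ≤ −m/(2π) ≤ −r`.

SOUNDNESS (`re_le_neg_of_kdCheck_lyapTay`, `_shifted`, `_conj_shifted`): if
`KdCert.check (lyapTayLeafOK n K J0 Js r) B t = true` then for every point `x` of `B` and every complex
eigenvalue `μ` of `J(x)`: `Re μ ≤ −r`; the shifted / balanced versions conclude `Re μ ≤ −(s + r)` for the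
ORIGINAL family from a certificate for `D(J + s·1)D⁻¹`, exactly as in the two earlier files. Nothing
here is new mathematics; it is certificate plumbing plus the connectedness lemma.

## What is NOT certified

Anything off the box; common-Lyapunov / LDI / time-varying statements (the conclusion is pointwise in
`x`); instability where the tree fails; that the proposed `P_α` are Taylor coefficients of anything
(they are arbitrary data — only the three inequalities are checked); any relation between `J(x)` and a
device it linearises (client's rider).

## References

* [GahinetApkarianChilali1996] P. Gahinet, P. Apkarian, M. Chilali, IEEE TAC 41 (1996) 436–442, §III
  — parameter-dependent Lyapunov functions `P(θ)` for affine families (the `d = 1` case).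
  [cite: GahinetApkarianChilali1996, §III]
* [CarlsonSchneider1962] D. Carlson, H. Schneider, J. Math. Anal. Appl. 6 (1963) 430–446, § 1 — the
  identity at an eigenvector and Lyapunov's theorem, as packaged in `LyapunovDecayRate.lean`.
  [cite: CarlsonSchneider1962, § 1]
* [Hladik2017] M. Hladík, arXiv:1704.05782 (2017), §3 — interval enclosures of parametric coefficients
  (the centred-form radius). [cite: Hladik2017, §3]
-/

open Finset Matrix

namespace Literature.Analysis.ValidatedNumerics

open ParametricIntervalPosSemidef ParametricEigenMargin Literature.LinearAlgebra.Matrix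

/-! ### Part B. Data and checker -/

/-- `Π_{k<n} f k` by structural recursion on `n` (reduces well in the kernel). [folklore] -/
def rprod (n : ℕ) (f : ℕ → ℚ) : ℚ :=
  Nat.rec 1 (fun k acc ↦ acc * f k) n

/-- `rprod n f = Π_{k<n} f k`. [folklore] -/
private theorem rprod_eq_prod (n : ℕ) (f : ℕ → ℚ) : rprod n f = ∏ k ∈ range n, f k := by
  induction n with
  | zero => rfl
  | succ n ih =>
    show rprod n f * f n = _
    rw [ih, prod_range_succ]

/-- Entry `k` of a multi-index stored as a list (`0` beyond the end). [folklore] -/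
def midx (a : List ℕ) (k : ℕ) : ℕ := a.getD k 0

/-- The rational weight `w^a = Π_{k<K} w_k^{a_k}` of a multi-index on half-widths `w`. [folklore] -/
def wpowQ (K : ℕ) (w : List ℚ) (a : List ℕ) : ℚ := rprod K fun k ↦ vget w k ^ midx a k

/-- `a = 0` on the first `K` coordinates. [folklore] -/
def isZeroIdx (K : ℕ) (a : List ℕ) : Bool := rall K fun k ↦ decide (midx a k = 0)

/-- `a = b` on the first `K` coordinates. [folklore] -/
def eqIdx (K : ℕ) (a b : List ℕ) : Bool := rall K fun k ↦ decide (midx a k = midx b k)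

/-- The multi-index `a + e_k` (tabulated on the first `K` coordinates). [folklore] -/
def bumpIdx (K : ℕ) (a : List ℕ) (k : ℕ) : List ℕ := vtab K fun t ↦ midx a t + if t = k then 1 else 0

/-- Position of (a copy of) the multi-index `a` in the list `betas` (`betas.length` if absent). [folklore] -/
def posOf (K : ℕ) (betas : List (List ℕ)) (a : List ℕ) : ℕ := betas.findIdx fun b ↦ eqIdx K b a

/-- The REGROUPED tables of the Lyapunov form: with `A_i = −(J_cᵀP_i + P_iJ_c)` and
`B_{k,i} = −(J^{(k)ᵀ}P_i + P_iJ^{(k)})`, `Q_j = Σ_{i : posA i = j} A_i + Σ_k Σ_{i : posB k i = j} B_{k,i}`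
(`A_i`, `B_{k,i}` tabulated once). [cite: GahinetApkarianChilali1996, §III (the Lyapunov derivative of a
parameter-dependent `P`)] -/
def lyapTayQTabs (n K L M : ℕ) (Jc : List (List ℚ)) (Js Ps : List (List (List ℚ)))
    (posA : ℕ → ℕ) (posB : ℕ → ℕ → ℕ) : List (List (List ℚ)) :=
  let As := vtab L fun i ↦ lyapTab n Jc (Ps.getD i [])
  let Bs := vtab K fun k ↦ vtab L fun i ↦ lyapTab n (Js.getD k []) (Ps.getD i [])
  vtab M fun j ↦ mtab n n fun a b ↦
    (rsum L fun i ↦ if posA i = j then mget (As.getD i []) a b else 0)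
      + rsum K fun k ↦ rsum L fun i ↦ if posB k i = j then mget ((Bs.getD k []).getD i []) a b else 0

/-- The CENTRE table of a tabulated matrix polynomial `Σ_j δ^{idx_j} T_j`: `Σ_{idx_j = 0} T_j`.
[cite: Hladik2017, §3 (centred form)] -/
def centreTab (n N K : ℕ) (idx : List (List ℕ)) (Ts : List (List (List ℚ))) : List (List ℚ) :=
  mtab n n fun a b ↦ rsum N fun j ↦ if isZeroIdx K (idx.getD j []) then mget (Ts.getD j []) a b else 0

/-- The RADIUS table of a tabulated matrix polynomial on `|δ_k| ≤ w_k`: `Σ_{idx_j ≠ 0} w^{idx_j} |T_j|`.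
[cite: Hladik2017, §3 (interval enclosure of the coefficients)] -/
def radTab (n N K : ℕ) (idx : List (List ℕ)) (Ts : List (List (List ℚ))) (w : List ℚ) :
    List (List ℚ) :=
  mtab n n fun a b ↦ rsum N fun j ↦
    if isZeroIdx K (idx.getD j []) then 0 else wpowQ K w (idx.getD j []) * |mget (Ts.getD j []) a b|

/-- A Taylor–Lyapunov leaf: multi-indices `α_i` and symmetric tables `P_i` of `P(δ) = Σ_i δ^{α_i} P_i`,
the output multi-indices `β_j` used to regroup `Q(δ)`, a bound `π`, and three `LDLCert`s: `cP` for
`P(0) ⪰ κ·1`, `cN` for the centred interval family of `−P(δ)`, `cQ` for that of `Q(δ)`.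
[cite: GahinetApkarianChilali1996, §III] -/
structure LyapTayLeaf where
  /-- the multi-indices `α_i` (lists of length `K`) -/
  alphas : List (List ℕ)
  /-- the tables `P_i` (rational, symmetric), same length -/
  Ps : List (List (List ℚ))
  /-- the output multi-indices `β_j` (must contain every `α_i` and every `α_i + e_k`) -/
  betas : List (List ℕ)
  /-- claimed upper bound of `λ_max(P(δ))` on the leaf -/
  π : ℚ
  /-- certificate `P(0) ⪰ cP.lam·1` (need `cP.lam > 0`) -/
  cP : LDLCert
  /-- certificate `−P(δ) ⪰ cN.lam·1` on the leaf (need `cN.lam ≥ −π`) -/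
  cN : LDLCert
  /-- certificate `Q(δ) ⪰ cQ.lam·1` on the leaf (need `cQ.lam > 0`, `2·π·r ≤ cQ.lam`) -/
  cQ : LDLCert
  deriving Inhabited

/-- Coverage check: every `α_i` and every `α_i + e_k` has a copy among the `β_j`. [folklore] -/
def coverIdx (K L M : ℕ) (alphas betas : List (List ℕ)) : Bool :=
  rall L (fun i ↦ decide (posOf K betas (alphas.getD i []) < M)) &&
    rall K fun k ↦ rall L fun i ↦ decide (posOf K betas (bumpIdx K (alphas.getD i []) k) < M)

/-- **The Taylor–Lyapunov leaf check** for the rate claim `r` on the leaf box `B` (centre `c`,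
half-widths `w`, `J_c = J₀ + Σ c_k J^{(k)}` exact): all `P_i` symmetric; coverage; `0 < cP.lam` and
`checkLower n P(0) 0 cP`; `0 < π`, `−π ≤ cN.lam` and `checkLower n (−P(0)) R_P cN`; `0 < cQ.lam`,
`2·π·r ≤ cQ.lam` and `checkLower n C R_Q cQ` with `C`/`R_Q` the centre/radius tables of the regrouped
`Q_j`. [cite: GahinetApkarianChilali1996, §III; Hladik2017, §3] -/
def lyapTayLeafOK (n K : ℕ) (J0 : List (List ℚ)) (Js : List (List (List ℚ))) (r : ℚ) (B : Box)
    (l : LyapTayLeaf) : Bool :=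
  let L := l.Ps.length
  let M := l.betas.length
  let w := boxHalfList K B
  let Qs := lyapTayQTabs n K L M (affineAtQ n K J0 Js (boxCentreList K B)) Js l.Ps
    (fun i ↦ posOf K l.betas (l.alphas.getD i []))
    (fun k i ↦ posOf K l.betas (bumpIdx K (l.alphas.getD i []) k))
  let P0 := centreTab n L K l.alphas l.Ps
  rall L (fun i ↦ symmQ n (l.Ps.getD i [])) && coverIdx K L M l.alphas l.betas &&
    decide (0 < l.cP.lam) && checkLower n P0 (zeroTab n) l.cP &&
    decide (0 < l.π) && decide (-l.π ≤ l.cN.lam) &&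
    checkLower n (negTab n P0) (radTab n L K l.alphas l.Ps w) l.cN &&
    decide (0 < l.cQ.lam) && decide (2 * l.π * r ≤ l.cQ.lam) &&
    checkLower n (centreTab n M K l.betas Qs) (radTab n M K l.betas Qs w) l.cQ

/-! ### Part C. Plumbing: multi-indices and monomials over `ℝ` -/

/-- `0 ≤ vᵀv`. [folklore] -/
private theorem dotProduct_self_nonneg₆ {n : ℕ} (v : Fin n → ℝ) : 0 ≤ v ⬝ᵥ v :=
  Finset.sum_nonneg fun i _ ↦ mul_self_nonneg (v i)

/-- `v ≠ 0 ⇒ 0 < vᵀv`. [folklore] -/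
private theorem dotProduct_self_pos_of_ne_zero₆ {n : ℕ} {v : Fin n → ℝ} (hv : v ≠ 0) :
    0 < v ⬝ᵥ v := by
  obtain ⟨i, hi⟩ : ∃ i, v i ≠ 0 := by
    by_contra h; push Not at h; exact hv (funext h)
  exact lt_of_lt_of_le (mul_self_pos.2 hi) (Finset.single_le_sum (f := fun j ↦ v j * v j)
    (fun j _ ↦ mul_self_nonneg (v j)) (Finset.mem_univ i))

/-- The real monomial `δ^a = Π_{k<K} δ_k^{a_k}`. [folklore] -/
def monoR (K : ℕ) (δ : Fin K → ℝ) (a : List ℕ) : ℝ := ∏ k : Fin K, δ k ^ midx a k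

/-- `vtab` read back (plumbing). [folklore] -/
private theorem vtab_getD₆ {β : Type*} {K : ℕ} (f : ℕ → β) (d : β) {k : ℕ} (hk : k < K) :
    (vtab K f).getD k d = f k := by
  unfold vtab
  rw [List.getD_eq_getElem?_getD, List.getElem?_map, List.getElem?_range hk]
  rfl

/-- `vreal (vtab K f) k = f k` (plumbing). [folklore] -/
private theorem vreal_vtab₆ {K : ℕ} (f : ℕ → ℚ) {k : ℕ} (hk : k < K) :
    vreal (vtab K f) k = ((f k : ℚ) : ℝ) := by
  unfold vreal vget; rw [vtab_getD₆ f 0 hk]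

/-- Entries of a bumped multi-index. [folklore] -/
private theorem midx_bumpIdx {K : ℕ} (a : List ℕ) (k : ℕ) (t : Fin K) :
    midx (bumpIdx K a k) t = midx a t + if (t : ℕ) = k then 1 else 0 := by
  unfold bumpIdx midx
  exact vtab_getD₆ _ 0 t.isLt

/-- Equal multi-indices have equal monomials. [folklore] -/
private theorem monoR_congr {K : ℕ} {a b : List ℕ} (h : eqIdx K a b = true) (δ : Fin K → ℝ) :
    monoR K δ a = monoR K δ b := by
  unfold monoR
  refine Finset.prod_congr rfl fun k _ ↦ ?_
  have := of_rall h k.isLt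
  rw [decide_eq_true_eq] at this
  rw [this]

/-- The monomial of `a + e_k` is `δ_k · δ^a`. [folklore] -/
private theorem monoR_bumpIdx {K : ℕ} (a : List ℕ) (k : Fin K) (δ : Fin K → ℝ) :
    monoR K δ (bumpIdx K a k) = δ k * monoR K δ a := by
  unfold monoR
  have h1 : ∀ t : Fin K, δ t ^ midx (bumpIdx K a k) t
      = δ t ^ midx a t * (if t = k then δ t else 1) := fun t ↦ by
    rw [midx_bumpIdx, pow_add]
    by_cases ht : t = k
    · subst ht; simp
    · have : (t : ℕ) ≠ (k : ℕ) := fun e ↦ ht (Fin.ext e)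
      simp [ht, this]
  simp only [h1, Finset.prod_mul_distrib, Finset.prod_ite_eq', Finset.mem_univ, if_true]
  ring

/-- A zero multi-index has monomial `1`. [folklore] -/
private theorem monoR_of_isZeroIdx {K : ℕ} {a : List ℕ} (h : isZeroIdx K a = true) (δ : Fin K → ℝ) :
    monoR K δ a = 1 := by
  unfold monoR
  refine Finset.prod_eq_one fun k _ ↦ ?_
  have := of_rall h k.isLt
  rw [decide_eq_true_eq] at this
  rw [this, pow_zero]

/-- At `δ = 0` a non-zero multi-index has monomial `0`. [folklore] -/
private theorem monoR_zero_of_not_isZeroIdx {K : ℕ} {a : List ℕ} (h : ¬ isZeroIdx K a = true) :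
    monoR K (fun _ ↦ 0) a = 0 := by
  unfold isZeroIdx at h
  rw [rall_eq_true_iff] at h
  push Not at h
  obtain ⟨k, hk, hne⟩ := h
  have hne' : midx a k ≠ 0 := fun e ↦ hne (by rw [e]; rfl)
  unfold monoR
  exact Finset.prod_eq_zero (Finset.mem_univ ⟨k, hk⟩) (zero_pow hne')

/-- The rational weight read in `ℝ`: `w^a = Π_{k<K} w_k^{a_k}`. [folklore] -/
private theorem cast_wpowQ {K : ℕ} (w : List ℚ) (a : List ℕ) :
    ((wpowQ K w a : ℚ) : ℝ) = ∏ k : Fin K, vreal w k ^ midx a k := by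
  unfold wpowQ
  rw [rprod_eq_prod]
  push_cast
  rw [← Fin.prod_univ_eq_prod_range (fun k ↦ ((vget w k : ℚ) : ℝ) ^ midx a k) K]
  rfl

/-- **Monomial bound on the centred box**: `|δ_k| ≤ w_k ⇒ |δ^a| ≤ w^a`. [cite: Hladik2017, §3] -/
private theorem abs_monoR_le {K : ℕ} {δ : Fin K → ℝ} {w : List ℚ} (hδ : ∀ k : Fin K, |δ k| ≤ vreal w k)
    (a : List ℕ) : |monoR K δ a| ≤ ((wpowQ K w a : ℚ) : ℝ) := by
  rw [cast_wpowQ]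
  unfold monoR
  rw [Finset.abs_prod]
  refine Finset.prod_le_prod (fun k _ ↦ abs_nonneg _) fun k _ ↦ ?_
  rw [abs_pow]
  exact pow_le_pow_left₀ (abs_nonneg _) (hδ k) _

/-- Continuity of monomials. [folklore] -/
private theorem continuous_monoR {K : ℕ} (a : List ℕ) : Continuous fun δ : Fin K → ℝ ↦ monoR K δ a :=
  continuous_finsetProd _ fun k _ ↦ (continuous_apply k).pow _

/-! ### Part C (cont.). Tabulated matrix polynomials over `ℝ` -/

/-- Entries of `finMat` (plumbing). [folklore] -/
private theorem finMat_apply₆ (n : ℕ) (A : List (List ℚ)) (i j : Fin n) :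
    finMat n A i j = mreal A i j := rfl

/-- The real matrix polynomial `Σ_{j<N} δ^{idx_j} T_j` of tabulated coefficients. [folklore] -/
def polyTabR (n N K : ℕ) (idx : List (List ℕ)) (Ts : List (List (List ℚ))) (δ : Fin K → ℝ) :
    Matrix (Fin n) (Fin n) ℝ :=
  ∑ j : Fin N, monoR K δ (idx.getD j []) • finMat n (Ts.getD j [])

/-- Continuity of a tabulated matrix polynomial. [folklore] -/
private theorem continuous_polyTabR (n N K : ℕ) (idx : List (List ℕ)) (Ts : List (List (List ℚ))) :
    Continuous (polyTabR n N K idx Ts) :=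
  continuous_finsetSum _ fun _ _ ↦ (continuous_monoR _).smul continuous_const

/-- **At the centre** the polynomial is the centre table: `Σ_j 0^{idx_j} T_j = Σ_{idx_j = 0} T_j`. [folklore] -/
private theorem polyTabR_zero (n N K : ℕ) (idx : List (List ℕ)) (Ts : List (List (List ℚ))) :
    polyTabR n N K idx Ts (fun _ ↦ 0) = finMat n (centreTab n N K idx Ts) := by
  ext a b
  unfold polyTabR
  rw [Matrix.sum_apply, finMat_apply₆]
  unfold centreTab mreal
  rw [mget_mtab _ a.isLt b.isLt, rsum_eq_sum]
  push_cast
  rw [← Fin.sum_univ_eq_sum_range (fun j ↦ ((if isZeroIdx K (idx.getD j []) = true then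
    mget (Ts.getD j []) a b else 0 : ℚ) : ℝ)) N]
  refine Finset.sum_congr rfl fun j _ ↦ ?_
  rw [Matrix.smul_apply, smul_eq_mul, finMat_apply₆]
  unfold mreal
  by_cases hz : isZeroIdx K (idx.getD j []) = true
  · rw [monoR_of_isZeroIdx hz, one_mul, if_pos hz]
  · rw [monoR_zero_of_not_isZeroIdx hz, zero_mul, if_neg hz]; push_cast; rfl

/-- **Centred-form enclosure**: on `|δ_k| ≤ w_k`, every entry of `Σ_j δ^{idx_j} T_j` is within the radius
table of the centre table. [cite: Hladik2017, §3 (interval enclosure of parametric coefficients)] -/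
private theorem abs_polyTabR_sub_centre_le (n N K : ℕ) (idx : List (List ℕ)) (Ts : List (List (List ℚ)))
    {δ : Fin K → ℝ} {w : List ℚ} (hδ : ∀ k : Fin K, |δ k| ≤ vreal w k) (a b : Fin n) :
    |polyTabR n N K idx Ts δ a b - mreal (centreTab n N K idx Ts) a b|
      ≤ mreal (radTab n N K idx Ts w) a b := by
  -- the difference, entrywise, is Σ_{idx_j ≠ 0} δ^{idx_j} (T_j)_{ab}
  have hdiff : polyTabR n N K idx Ts δ a b - mreal (centreTab n N K idx Ts) a b
      = ∑ j : Fin N, (if isZeroIdx K (idx.getD j []) = true then 0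
          else monoR K δ (idx.getD j []) * mreal (Ts.getD j []) a b) := by
    unfold polyTabR
    rw [Matrix.sum_apply]
    unfold centreTab
    unfold mreal
    rw [mget_mtab _ a.isLt b.isLt, rsum_eq_sum]
    push_cast
    rw [← Fin.sum_univ_eq_sum_range (fun j ↦ ((if isZeroIdx K (idx.getD j []) = true then
      mget (Ts.getD j []) a b else 0 : ℚ) : ℝ)) N, ← Finset.sum_sub_distrib]
    refine Finset.sum_congr rfl fun j _ ↦ ?_
    rw [Matrix.smul_apply, smul_eq_mul, finMat_apply₆]
    unfold mreal
    by_cases hz : isZeroIdx K (idx.getD j []) = true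
    · rw [monoR_of_isZeroIdx hz, one_mul, if_pos hz, if_pos hz, sub_self]
    · rw [if_neg hz, if_neg hz]; push_cast; ring
  have hrad : mreal (radTab n N K idx Ts w) a b
      = ∑ j : Fin N, (if isZeroIdx K (idx.getD j []) = true then 0
          else ((wpowQ K w (idx.getD j []) : ℚ) : ℝ) * |mreal (Ts.getD j []) a b|) := by
    unfold radTab mreal
    rw [mget_mtab _ a.isLt b.isLt, rsum_eq_sum]
    push_cast
    rw [← Fin.sum_univ_eq_sum_range (fun j ↦ ((if isZeroIdx K (idx.getD j []) = true then (0 : ℚ)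
      else wpowQ K w (idx.getD j []) * |mget (Ts.getD j []) a b| : ℚ) : ℝ)) N]
    refine Finset.sum_congr rfl fun j _ ↦ ?_
    by_cases hz : isZeroIdx K (idx.getD j []) = true
    · rw [if_pos hz, if_pos hz]; push_cast; rfl
    · rw [if_neg hz, if_neg hz]; push_cast; rfl
  rw [hdiff, hrad]
  refine (Finset.abs_sum_le_sum_abs _ _).trans (Finset.sum_le_sum fun j _ ↦ ?_)
  by_cases hz : isZeroIdx K (idx.getD j []) = true
  · rw [if_pos hz, if_pos hz, abs_zero]
  · rw [if_neg hz, if_neg hz, abs_mul]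
    exact mul_le_mul_of_nonneg_right (abs_monoR_le hδ _) (abs_nonneg _)


/-! ### Part C (cont.). The regrouping identity `Q(δ) = Σ_j δ^{β_j} Q_j` -/

/-- The real Lyapunov form matrix `−(JᵀP + PJ)`. [cite: CarlsonSchneider1962, § 1] -/
private def lyapRm₆ {n : ℕ} (J P : Matrix (Fin n) (Fin n) ℝ) : Matrix (Fin n) (Fin n) ℝ := -(Jᵀ * P + P * J)

/-- `finMat (lyapTab J P) = −((finMat J)ᵀ · finMat P + finMat P · finMat J)`. [folklore] -/
private theorem finMat_lyapTab₆ {n : ℕ} (J P : List (List ℚ)) :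
    finMat n (lyapTab n J P) = lyapRm₆ (finMat n J) (finMat n P) := by
  ext i j
  unfold lyapRm₆
  rw [Matrix.neg_apply, Matrix.add_apply, Matrix.mul_apply, Matrix.mul_apply, finMat_apply₆]
  unfold lyapTab mreal
  rw [mget_mtab _ i.isLt j.isLt, rsum_eq_sum]
  push_cast
  rw [← Fin.sum_univ_eq_sum_range (fun l ↦ ((mget J l i : ℚ) : ℝ) * ((mget P l j : ℚ) : ℝ)
    + ((mget P i l : ℚ) : ℝ) * ((mget J l j : ℚ) : ℝ)) n, Finset.sum_add_distrib]
  rfl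

/-- `lyapRm₆` is linear in `P` over finite sums of scalar multiples. [folklore] -/
private theorem lyapRm₆_sum_smul_right {n : ℕ} {ι : Type*} (s : Finset ι) (J : Matrix (Fin n) (Fin n) ℝ)
    (c : ι → ℝ) (P : ι → Matrix (Fin n) (Fin n) ℝ) :
    lyapRm₆ J (∑ i ∈ s, c i • P i) = ∑ i ∈ s, c i • lyapRm₆ J (P i) := by
  unfold lyapRm₆
  rw [Matrix.mul_sum, Matrix.sum_mul, ← Finset.sum_add_distrib, ← Finset.sum_neg_distrib]
  refine Finset.sum_congr rfl fun i _ ↦ ?_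
  rw [Matrix.mul_smul, Matrix.smul_mul, smul_neg, smul_add]

/-- `lyapRm₆` is linear in `J` over finite sums of scalar multiples. [folklore] -/
private theorem lyapRm₆_sum_smul_left {n : ℕ} {ι : Type*} (s : Finset ι) (P : Matrix (Fin n) (Fin n) ℝ)
    (c : ι → ℝ) (J : ι → Matrix (Fin n) (Fin n) ℝ) :
    lyapRm₆ (∑ i ∈ s, c i • J i) P = ∑ i ∈ s, c i • lyapRm₆ (J i) P := by
  unfold lyapRm₆
  rw [Matrix.transpose_sum, Matrix.sum_mul, Matrix.mul_sum, ← Finset.sum_add_distrib,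
    ← Finset.sum_neg_distrib]
  refine Finset.sum_congr rfl fun i _ ↦ ?_
  rw [Matrix.transpose_smul, Matrix.smul_mul, Matrix.mul_smul, smul_neg, smul_add]

/-- `lyapRm₆` is additive in `J`. [folklore] -/
private theorem lyapRm₆_add_left {n : ℕ} (J E P : Matrix (Fin n) (Fin n) ℝ) :
    lyapRm₆ (J + E) P = lyapRm₆ J P + lyapRm₆ E P := by
  unfold lyapRm₆
  rw [Matrix.transpose_add, Matrix.add_mul, Matrix.mul_add]
  abel

/-- A sum over `Fin M` of an indicator of a natural index picks one term. [folklore] -/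
private theorem sum_ite_val_eq {α : Type*} [AddCommMonoid α] {M p : ℕ} (hp : p < M) (f : Fin M → α) :
    ∑ j : Fin M, (if p = (j : ℕ) then f j else 0) = f ⟨p, hp⟩ := by
  rw [Finset.sum_eq_single ⟨p, hp⟩]
  · simp
  · intro j _ hj
    rw [if_neg]
    intro e
    exact hj (Fin.ext e.symm)
  · intro h; exact absurd (Finset.mem_univ _) h

/-- The found position carries a copy of the multi-index. [folklore] -/
private theorem eqIdx_posOf {K : ℕ} {betas : List (List ℕ)} {a : List ℕ}
    (h : posOf K betas a < betas.length) : eqIdx K (betas.getD (posOf K betas a) []) a = true := by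
  have h1 := List.findIdx_getElem (xs := betas) (p := fun b ↦ eqIdx K b a) (w := h)
  rw [List.getD_eq_getElem?_getD, List.getElem?_eq_getElem h, Option.getD_some]
  exact h1

/-- **The regrouped tables, read as real matrices**: `Q_j = Σ_{posA i = j} A_i + Σ_k Σ_{posB k i = j} B_{k,i}`.
[cite: GahinetApkarianChilali1996, §III] -/
private theorem finMat_lyapTayQTabs {n K L M : ℕ} (Jc : List (List ℚ)) (Js Ps : List (List (List ℚ)))
    (posA : ℕ → ℕ) (posB : ℕ → ℕ → ℕ) (j : Fin M) :
    finMat n ((lyapTayQTabs n K L M Jc Js Ps posA posB).getD j [])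
      = ∑ i : Fin L, (if posA i = (j : ℕ) then lyapRm₆ (finMat n Jc) (finMat n (Ps.getD i [])) else 0)
        + ∑ k : Fin K, ∑ i : Fin L, (if posB k i = (j : ℕ) then
            lyapRm₆ (finMat n (Js.getD k [])) (finMat n (Ps.getD i [])) else 0) := by
  ext a b
  unfold lyapTayQTabs
  rw [vtab_getD₆ _ _ j.isLt, finMat_apply₆, Matrix.add_apply, Matrix.sum_apply, Matrix.sum_apply]
  unfold mreal
  rw [mget_mtab _ a.isLt b.isLt]
  push_cast
  rw [rsum_eq_sum, rsum_eq_sum]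
  push_cast
  congr 1
  · rw [← Fin.sum_univ_eq_sum_range (fun i ↦ ((if posA i = (j : ℕ) then
      mget ((vtab L fun i ↦ lyapTab n Jc (Ps.getD i [])).getD i []) a b else 0 : ℚ) : ℝ)) L]
    refine Finset.sum_congr rfl fun i _ ↦ ?_
    by_cases h : posA i = (j : ℕ)
    · rw [if_pos h, if_pos h, vtab_getD₆ _ _ i.isLt]
      show mreal (lyapTab n Jc (Ps.getD i [])) a b = _
      rw [← finMat_apply₆, finMat_lyapTab₆]
    · rw [if_neg h, if_neg h, Matrix.zero_apply]; push_cast; rfl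
  · rw [← Fin.sum_univ_eq_sum_range (fun k ↦ ((rsum L fun i ↦ if posB k i = (j : ℕ) then
      mget (((vtab K fun k ↦ vtab L fun i ↦ lyapTab n (Js.getD k []) (Ps.getD i [])).getD k []).getD i [])
        a b else 0 : ℚ) : ℝ)) K]
    refine Finset.sum_congr rfl fun k _ ↦ ?_
    rw [Matrix.sum_apply, rsum_eq_sum]
    push_cast
    rw [← Fin.sum_univ_eq_sum_range (fun i ↦ ((if posB k i = (j : ℕ) then
      mget (((vtab K fun k ↦ vtab L fun i ↦ lyapTab n (Js.getD k []) (Ps.getD i [])).getD k []).getD i [])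
        a b else 0 : ℚ) : ℝ)) L]
    refine Finset.sum_congr rfl fun i _ ↦ ?_
    by_cases h : posB k i = (j : ℕ)
    · rw [if_pos h, if_pos h, vtab_getD₆ _ _ k.isLt, vtab_getD₆ _ _ i.isLt]
      show mreal (lyapTab n (Js.getD k []) (Ps.getD i [])) a b = _
      rw [← finMat_apply₆, finMat_lyapTab₆]
    · rw [if_neg h, if_neg h, Matrix.zero_apply]; push_cast; rfl

/-- **The regrouping identity.** Under coverage, the tabulated polynomial of the regrouped tables IS the
Lyapunov form of the leaf's `P(δ)` against `J(c + δ) = J_c + Σ δ_k J^{(k)}`: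
`Σ_j δ^{β_j} Q_j = −(J(c+δ)ᵀP(δ) + P(δ)J(c+δ))`. [cite: GahinetApkarianChilali1996, §III] -/
private theorem polyTabR_Q_eq {n K L M : ℕ} (Jc : List (List ℚ)) (Js Ps : List (List (List ℚ)))
    (alphas betas : List (List ℕ))
    (hA : ∀ i : Fin L, posOf K betas (alphas.getD i []) < M)
    (hB : ∀ (k : Fin K) (i : Fin L), posOf K betas (bumpIdx K (alphas.getD i []) k) < M)
    (hM : M = betas.length) (δ : Fin K → ℝ) :
    polyTabR n M K betas (lyapTayQTabs n K L M Jc Js Ps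
        (fun i ↦ posOf K betas (alphas.getD i []))
        (fun k i ↦ posOf K betas (bumpIdx K (alphas.getD i []) k))) δ
      = lyapRm₆ (finMat n Jc + paramMatrix (fun k : Fin K ↦ finMat n (Js.getD k [])) δ)
          (polyTabR n L K alphas Ps δ) := by
  -- right-hand side: bilinear expansion
  rw [lyapRm₆_add_left]
  unfold polyTabR
  rw [lyapRm₆_sum_smul_right]
  unfold paramMatrix
  rw [lyapRm₆_sum_smul_left]
  simp only [lyapRm₆_sum_smul_right, Finset.smul_sum, smul_smul]
  -- left-hand side: expand the tables and swap sums
  simp only [finMat_lyapTayQTabs, smul_add, Finset.smul_sum, smul_ite, smul_zero,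
    Finset.sum_add_distrib]
  congr 1
  · rw [Finset.sum_comm]
    refine Finset.sum_congr rfl fun i _ ↦ ?_
    rw [sum_ite_val_eq (hA i)]
    have he := eqIdx_posOf (hM ▸ hA i)
    rw [monoR_congr he]
  · rw [Finset.sum_comm]
    refine Finset.sum_congr rfl fun k _ ↦ ?_
    rw [Finset.sum_comm]
    refine Finset.sum_congr rfl fun i _ ↦ ?_
    rw [sum_ite_val_eq (hB k i)]
    have he := eqIdx_posOf (hM ▸ hB k i)
    rw [monoR_congr he, monoR_bumpIdx]


/-! ### Part D. Soundness -/

/-- A symmetric table is a Hermitian real matrix. [folklore] -/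
private theorem isHermitian_finMat_of_symmQ₆ {n : ℕ} {A : List (List ℚ)} (h : symmQ n A = true) :
    (finMat n A).IsHermitian := by
  refine Matrix.IsHermitian.ext fun i j ↦ ?_
  have h1 := of_rall (of_rall h j.isLt) i.isLt
  rw [decide_eq_true_eq] at h1
  rw [star_trivial, finMat_apply₆, finMat_apply₆]
  unfold mreal; rw [h1]

/-- A tabulated matrix polynomial with symmetric coefficient tables is Hermitian at every point. [folklore] -/
private theorem isHermitian_polyTabR {n N K : ℕ} {idx : List (List ℕ)} {Ts : List (List (List ℚ))}
    (h : rall N (fun i ↦ symmQ n (Ts.getD i [])) = true) (δ : Fin K → ℝ) :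
    (polyTabR n N K idx Ts δ).IsHermitian := by
  refine Matrix.IsHermitian.ext fun a b ↦ ?_
  unfold polyTabR
  rw [star_trivial, Matrix.sum_apply, Matrix.sum_apply]
  refine Finset.sum_congr rfl fun j _ ↦ ?_
  rw [Matrix.smul_apply, Matrix.smul_apply]
  congr 1
  have := (isHermitian_finMat_of_symmQ₆ (of_rall h j.isLt)).apply a b
  rw [star_trivial] at this
  exact this

/-- Exact data: `|A i j − A i j| ≤ 0 = zeroTab i j`. [folklore] -/
private theorem abs_sub_self_le_zeroTab₆ {n : ℕ} (C : List (List ℚ)) (i j : Fin n) :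
    |finMat n C i j - mreal C i j| ≤ mreal (zeroTab n) i j := by
  rw [finMat_apply₆, sub_self, abs_zero]
  unfold zeroTab mreal; rw [mget_mtab _ i.isLt j.isLt]; push_cast; exact le_rfl

/-- `mreal (negTab A) = −mreal A` on the block. [folklore] -/
private theorem mreal_negTab₆ {n : ℕ} (A : List (List ℚ)) (i j : Fin n) :
    mreal (negTab n A) i j = -mreal A i j := by
  unfold negTab mreal; rw [mget_mtab _ i.isLt j.isLt]; push_cast; rfl

/-- `paramMatrix` is additive in the parameter. [folklore] -/
private theorem paramMatrix_add_param₆ {n K : ℕ} (A : Fin K → Matrix (Fin n) (Fin n) ℝ)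
    (p q : Fin K → ℝ) : paramMatrix A (fun k ↦ p k + q k) = paramMatrix A p + paramMatrix A q := by
  unfold paramMatrix
  simp only [add_smul, Finset.sum_add_distrib]

/-- The exact point table `affineAtQ` is the real affine family at the cast point. [folklore] -/
private theorem finMat_affineAtQ₆ {n K : ℕ} (A0 : List (List ℚ)) (As : List (List (List ℚ)))
    (v : List ℚ) :
    finMat n (affineAtQ n K A0 As v)
      = finMat n A0 + paramMatrix (fun k : Fin K ↦ finMat n (As.getD k [])) (fun k : Fin K ↦ vreal v k) := by
  ext i j
  rw [Matrix.add_apply, paramMatrix_apply, finMat_apply₆, finMat_apply₆]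
  unfold affineAtQ mreal
  rw [mget_mtab _ i.isLt j.isLt, rsum_eq_sum]
  push_cast
  rw [← Fin.sum_univ_eq_sum_range (fun k ↦ ((vget v k : ℚ) : ℝ) * ((mget (As.getD k []) i j : ℚ) : ℝ)) K]
  rfl

/-- **Per leaf**: an accepted Taylor–Lyapunov leaf proves `Re μ ≤ −r` for every eigenvalue of `J(x)`
at every point `x` of the leaf box. [cite: GahinetApkarianChilali1996, §III; CarlsonSchneider1962, § 1;
Hladik2017, §3] -/
theorem re_le_neg_of_lyapTayLeafOK {n K : ℕ} {J0 : List (List ℚ)} {Js : List (List (List ℚ))} {r : ℚ}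
    {B : Box} {l : LyapTayLeaf} (h : lyapTayLeafOK n K J0 Js r B l = true) (x : ℕ → ℝ) (hx : B.mem x)
    {μ : ℂ} (hμ : μ ∈ spectrum ℂ ((finMat n J0
      + paramMatrix (fun k : Fin K ↦ finMat n (Js.getD k [])) (fun k : Fin K ↦ x k)).map (algebraMap ℝ ℂ))) :
    μ.re ≤ -(r : ℝ) := by
  unfold lyapTayLeafOK coverIdx at h
  simp only [Bool.and_eq_true, decide_eq_true_eq] at h
  obtain ⟨⟨⟨⟨⟨⟨⟨⟨⟨hsym, hcovA, hcovB⟩, hκ⟩, hcP⟩, hπ⟩, hNπ⟩, hcN⟩, hm⟩, hrate⟩, hcQ⟩ := h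
  -- abbreviations
  set L : ℕ := l.Ps.length with hL
  set M : ℕ := l.betas.length with hM
  set cL : List ℚ := boxCentreList K B with hcL
  set wL : List ℚ := boxHalfList K B with hwL
  -- centred coordinates
  let δ : Fin K → ℝ := fun k ↦ x k - vreal cL k
  have hc : ∀ k : Fin K, vreal cL k = ((((B.ivl k).1 + (B.ivl k).2) / 2 : ℚ) : ℝ) :=
    fun k ↦ vreal_vtab₆ _ k.isLt
  have hw : ∀ k : Fin K, vreal wL k = ((((B.ivl k).2 - (B.ivl k).1) / 2 : ℚ) : ℝ) :=
    fun k ↦ vreal_vtab₆ _ k.isLt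
  have hδabs : ∀ k : Fin K, |δ k| ≤ vreal wL k := fun k ↦ by
    show |x k - vreal cL k| ≤ vreal wL k
    rw [hw k, hc k]; push_cast
    have := (hx k).1; have := (hx k).2
    exact abs_le.2 ⟨by linarith, by linarith⟩
  have hw0 : ∀ k : Fin K, 0 ≤ vreal wL k := fun k ↦ (abs_nonneg _).trans (hδabs k)
  have hxsplit : (fun k : Fin K ↦ x k) = fun k : Fin K ↦ vreal cL k + δ k :=
    funext fun k ↦ by show x k = vreal cL k + (x k - vreal cL k); ring
  -- the objects
  set Jf : Fin K → Matrix (Fin n) (Fin n) ℝ := fun k ↦ finMat n (Js.getD k []) with hJf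
  set J : Matrix (Fin n) (Fin n) ℝ := finMat n J0 + paramMatrix Jf (fun k : Fin K ↦ x k) with hJ
  set Jc : Matrix (Fin n) (Fin n) ℝ := finMat n (affineAtQ n K J0 Js cL) with hJc
  have hJsplit : J = Jc + paramMatrix Jf δ := by
    rw [hJ, hJc, finMat_affineAtQ₆, add_assoc, ← paramMatrix_add_param₆, ← hxsplit]
  let Pf : (Fin K → ℝ) → Matrix (Fin n) (Fin n) ℝ := polyTabR n L K l.alphas l.Ps
  set Qs := lyapTayQTabs n K L M (affineAtQ n K J0 Js cL) Js l.Ps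
    (fun i ↦ posOf K l.betas (l.alphas.getD i []))
    (fun k i ↦ posOf K l.betas (bumpIdx K (l.alphas.getD i []) k)) with hQs
  -- coverage
  have hcovA' : ∀ i : Fin L, posOf K l.betas (l.alphas.getD i []) < M := fun i ↦ by
    have := of_rall hcovA i.isLt; rwa [decide_eq_true_eq] at this
  have hcovB' : ∀ (k : Fin K) (i : Fin L), posOf K l.betas (bumpIdx K (l.alphas.getD i []) k) < M :=
    fun k i ↦ by
      have := of_rall (of_rall hcovB k.isLt) i.isLt; rwa [decide_eq_true_eq] at this
  have hQeq : ∀ δ' : Fin K → ℝ,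
      polyTabR n M K l.betas Qs δ' = lyapRm₆ (Jc + paramMatrix Jf δ') (Pf δ') := fun δ' ↦ by
    rw [hQs, hJc]
    exact polyTabR_Q_eq _ _ _ _ _ hcovA' hcovB' hM δ'
  -- the Lyapunov form margin, uniformly on the centred leaf box
  have hQform : ∀ δ' : Fin K → ℝ, (∀ k : Fin K, |δ' k| ≤ vreal wL k) → ∀ y : Fin n → ℝ,
      (l.cQ.lam : ℝ) * (y ⬝ᵥ y)
        ≤ -(y ⬝ᵥ (((Jc + paramMatrix Jf δ')ᵀ * Pf δ' + Pf δ' * (Jc + paramMatrix Jf δ')) *ᵥ y)) := by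
    intro δ' hδ' y
    have h1 := mul_dotProduct_le_of_checkLower hcQ (A := polyTabR n M K l.betas Qs δ')
      (abs_polyTabR_sub_centre_le n M K l.betas Qs hδ') y
    rw [hQeq δ'] at h1
    unfold lyapRm₆ at h1
    rw [Matrix.neg_mulVec, dotProduct_neg] at h1
    exact h1
  -- P is Hermitian everywhere and positive definite at the centre
  have hPherm : ∀ δ' : Fin K → ℝ, (Pf δ').IsHermitian := fun δ' ↦ isHermitian_polyTabR hsym δ'
  have hP0 : (Pf fun _ ↦ 0).PosDef := by
    have hH : (finMat n (centreTab n L K l.alphas l.Ps)).IsHermitian := by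
      rw [← polyTabR_zero]; exact hPherm _
    show (polyTabR n L K l.alphas l.Ps fun _ ↦ 0).PosDef
    rw [polyTabR_zero]
    exact posDef_of_checkLower hcP hκ hH (abs_sub_self_le_zeroTab₆ _)
  -- connectedness on the centred leaf box ⇒ P(δ) ≻ 0 (no certificate needed off the centre)
  let S : Set (Fin K → ℝ) := Set.Icc (fun k ↦ -vreal wL k) (fun k ↦ vreal wL k)
  have hS : IsPreconnected S := (convex_Icc _ _).isPreconnected
  have hmemS : ∀ δ' ∈ S, ∀ k : Fin K, |δ' k| ≤ vreal wL k := fun δ' hδ' k ↦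
    abs_le.2 ⟨hδ'.1 k, hδ'.2 k⟩
  have hδS : δ ∈ S := ⟨fun k ↦ (abs_le.1 (hδabs k)).1, fun k ↦ (abs_le.1 (hδabs k)).2⟩
  have h0S : (fun _ : Fin K ↦ (0 : ℝ)) ∈ S := ⟨fun k ↦ by simpa using hw0 k, fun k ↦ hw0 k⟩
  have hmpos : (0 : ℝ) < l.cQ.lam := by exact_mod_cast hm
  have hPD : (Pf δ).PosDef :=
    posDef_on_of_lyapunov_pos hS (continuous_polyTabR n L K l.alphas l.Ps) hPherm
      (J := fun δ' ↦ Jc + paramMatrix Jf δ')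
      (fun δ' hδ' y hy ↦ lt_of_lt_of_le (mul_pos hmpos (dotProduct_self_pos_of_ne_zero₆ hy))
        (hQform δ' (hmemS δ' hδ') y)) h0S hP0 δ hδS
  -- yᵀP(δ)y ≤ π·yᵀy from the centred interval family of −P
  have hPπ : ∀ y : Fin n → ℝ, y ⬝ᵥ (Pf δ *ᵥ y) ≤ (l.π : ℝ) * (y ⬝ᵥ y) := by
    intro y
    have hencl : ∀ a b : Fin n, |(-Pf δ) a b - mreal (negTab n (centreTab n L K l.alphas l.Ps)) a b|
        ≤ mreal (radTab n L K l.alphas l.Ps wL) a b := fun a b ↦ by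
      rw [Matrix.neg_apply, mreal_negTab₆, ← abs_neg]
      have := abs_polyTabR_sub_centre_le n L K l.alphas l.Ps hδabs a b
      convert this using 2; ring
    have h1 := mul_dotProduct_le_of_checkLower hcN hencl y
    rw [Matrix.neg_mulVec, dotProduct_neg] at h1
    have hyy : 0 ≤ y ⬝ᵥ y := dotProduct_self_nonneg₆ y
    have h2 : (-(l.π : ℝ)) * (y ⬝ᵥ y) ≤ (l.cN.lam : ℝ) * (y ⬝ᵥ y) :=
      mul_le_mul_of_nonneg_right (by exact_mod_cast hNπ) hyy
    linarith
  -- the form margin at δ for J itself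
  have hQ : ∀ y : Fin n → ℝ, (l.cQ.lam : ℝ) * (y ⬝ᵥ y) ≤ -(y ⬝ᵥ ((Jᵀ * Pf δ + Pf δ * J) *ᵥ y)) := by
    rw [hJsplit]; exact hQform δ hδabs
  have hrate' : (r : ℝ) ≤ (l.cQ.lam : ℝ) / (2 * (l.π : ℝ)) := by
    rw [le_div_iff₀ (by positivity)]
    have : ((2 * l.π * r : ℚ) : ℝ) ≤ (l.cQ.lam : ℝ) := by exact_mod_cast hrate
    push_cast at this; linarith
  have hmain := Literature.LinearAlgebra.Matrix.re_le_neg_div_of_real_lyapunov_form_bounds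
    (J := J) (P := Pf δ) hmpos.le (by exact_mod_cast hπ) hPD hPπ hQ hμ
  rw [neg_div] at hmain
  linarith

/-- **Taylor–Lyapunov certificate, box level (END-TO-END).** If a kd-tree of Taylor–Lyapunov leaves
passes `KdCert.check (lyapTayLeafOK n K J0 Js r)` on the box `B`, then for EVERY point `x` of `B` every
complex eigenvalue `μ` of `J(x) = J₀ + Σ_k x_k J^{(k)}` satisfies `Re μ ≤ −r`.
[cite: GahinetApkarianChilali1996, §III; CarlsonSchneider1962, § 1; Hladik2017, §3] -/
theorem re_le_neg_of_kdCheck_lyapTay {n K : ℕ} {J0 : List (List ℚ)} {Js : List (List (List ℚ))}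
    {r : ℚ} {B : Box} {t : KdCert LyapTayLeaf} (h : t.check (lyapTayLeafOK n K J0 Js r) B = true)
    (x : ℕ → ℝ) (hx : B.mem x) {μ : ℂ}
    (hμ : μ ∈ spectrum ℂ ((finMat n J0
      + paramMatrix (fun k : Fin K ↦ finMat n (Js.getD k [])) (fun k : Fin K ↦ x k)).map (algebraMap ℝ ℂ))) :
    μ.re ≤ -(r : ℝ) :=
  KdCert.sound (P := fun x ↦ ∀ μ : ℂ, μ ∈ spectrum ℂ ((finMat n J0
      + paramMatrix (fun k : Fin K ↦ finMat n (Js.getD k [])) (fun k : Fin K ↦ x k)).map (algebraMap ℝ ℂ)) →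
      μ.re ≤ -(r : ℝ))
    (fun _ _ hl x hx _ hμ ↦ re_le_neg_of_lyapTayLeafOK hl x hx hμ) t B h x hx μ hμ

/-- **Hurwitz on the whole box** from a Taylor–Lyapunov certificate with a positive rate.
[cite: GahinetApkarianChilali1996, §III; CarlsonSchneider1962, § 1] -/
theorem forall_re_neg_of_kdCheck_lyapTay {n K : ℕ} {J0 : List (List ℚ)} {Js : List (List (List ℚ))}
    {r : ℚ} (hr : 0 < r) {B : Box} {t : KdCert LyapTayLeaf}
    (h : t.check (lyapTayLeafOK n K J0 Js r) B = true) (x : ℕ → ℝ) (hx : B.mem x) {μ : ℂ}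
    (hμ : μ ∈ spectrum ℂ ((finMat n J0
      + paramMatrix (fun k : Fin K ↦ finMat n (Js.getD k [])) (fun k : Fin K ↦ x k)).map (algebraMap ℝ ℂ))) :
    μ.re < 0 :=
  (re_le_neg_of_kdCheck_lyapTay h x hx hμ).trans_lt (by exact_mod_cast neg_neg_of_pos hr)

/-! ### Part E. Shifted and balanced tables (as in the two earlier files) -/

/-- `finMat (J + s·1) = finMat J + s • 1`. [folklore] -/
private theorem finMat_addDiagTab₆ (n : ℕ) (s : ℚ) (J : List (List ℚ)) :
    finMat n (addDiagTab n s J) = finMat n J + (s : ℝ) • (1 : Matrix (Fin n) (Fin n) ℝ) := by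
  ext i j
  rw [Matrix.add_apply, Matrix.smul_apply, finMat_apply₆, finMat_apply₆, Matrix.one_apply, smul_eq_mul]
  unfold addDiagTab mreal
  rw [mget_mtab _ i.isLt j.isLt]
  by_cases h : i = j
  · subst h; simp
  · have h' : (i : ℕ) ≠ (j : ℕ) := fun e ↦ h (Fin.ext e)
    simp [h, h']

/-- **Spectral shift**: if every eigenvalue of `M + s·1` has `Re ≤ −r` then every eigenvalue of `M` has
`Re ≤ −(s + r)`. [folklore] -/
private theorem re_le_neg_of_forall_shift₆ {n : ℕ} {M : Matrix (Fin n) (Fin n) ℝ} {s r : ℚ}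
    (h : ∀ ν : ℂ, ν ∈ spectrum ℂ ((M + (s : ℝ) • (1 : Matrix (Fin n) (Fin n) ℝ)).map (algebraMap ℝ ℂ)) →
      ν.re ≤ -(r : ℝ))
    {μ : ℂ} (hμ : μ ∈ spectrum ℂ (M.map (algebraMap ℝ ℂ))) : μ.re ≤ -((s + r : ℚ) : ℝ) := by
  have hmap : (M + (s : ℝ) • (1 : Matrix (Fin n) (Fin n) ℝ)).map (algebraMap ℝ ℂ)
      = algebraMap ℂ (Matrix (Fin n) (Fin n) ℂ) (s : ℂ) + M.map (algebraMap ℝ ℂ) := by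
    rw [Matrix.map_add (algebraMap ℝ ℂ) (map_add _), Algebra.algebraMap_eq_smul_one, add_comm]
    congr 1
    ext i j
    simp only [Matrix.map_apply, Matrix.smul_apply, Matrix.one_apply, smul_eq_mul, mul_ite, mul_one,
      mul_zero]
    split_ifs <;> simp [Complex.coe_algebraMap]
  have hμ' : (s : ℂ) + μ ∈ spectrum ℂ ((M + (s : ℝ) • (1 : Matrix (Fin n) (Fin n) ℝ)).map (algebraMap ℝ ℂ)) := by
    rw [hmap, ← spectrum.singleton_add_eq]
    exact Set.add_mem_add (Set.mem_singleton _) hμ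
  have h1 := h _ hμ'
  simp only [Complex.add_re, Complex.ratCast_re] at h1
  push_cast
  linarith

/-- **Shifted Taylor–Lyapunov certificate**: the kd-tree checks for the SHIFTED tables
`(J₀ + s·1, J^{(k)})` with rate `r` ⇒ every eigenvalue `μ` of the UNSHIFTED `J(x)`, `x` in the box,
has `Re μ ≤ −(s + r)`. [cite: GahinetApkarianChilali1996, §III; CarlsonSchneider1962, § 1] -/
theorem re_le_neg_of_kdCheck_lyapTay_shifted {n K : ℕ} {J0 : List (List ℚ)}
    {Js : List (List (List ℚ))} {s r : ℚ} {B : Box} {t : KdCert LyapTayLeaf}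
    (h : t.check (lyapTayLeafOK n K (addDiagTab n s J0) Js r) B = true) (x : ℕ → ℝ) (hx : B.mem x)
    {μ : ℂ} (hμ : μ ∈ spectrum ℂ ((finMat n J0
      + paramMatrix (fun k : Fin K ↦ finMat n (Js.getD k [])) (fun k : Fin K ↦ x k)).map (algebraMap ℝ ℂ))) :
    μ.re ≤ -((s + r : ℚ) : ℝ) := by
  refine re_le_neg_of_forall_shift₆ (fun ν hν ↦ re_le_neg_of_kdCheck_lyapTay h x hx ?_) hμ
  rw [finMat_addDiagTab₆]
  convert hν using 3
  abel

/-- `finMat (D·J·D⁻¹) = diag(d) · finMat J · diag(d⁻¹)` (real matrices). [folklore] -/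
private theorem finMat_conjDiagTab₆ {n : ℕ} (d : List ℚ) (J : List (List ℚ)) :
    finMat n (conjDiagTab n d J)
      = Matrix.diagonal (fun i : Fin n ↦ (vreal d i)) * finMat n J
          * Matrix.diagonal (fun i : Fin n ↦ (vreal d i)⁻¹) := by
  ext i j
  rw [Matrix.mul_diagonal, Matrix.diagonal_mul, finMat_apply₆, finMat_apply₆]
  unfold conjDiagTab mreal vreal
  rw [mget_mtab _ i.isLt j.isLt]; push_cast; ring

/-- The balanced affine family is the conjugate of the original one. [folklore] -/
private theorem affine_conjDiagTab_eq₆ {n K : ℕ} (d : List ℚ) (J0 : List (List ℚ))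
    (Js : List (List (List ℚ))) (x : ℕ → ℝ) :
    finMat n (conjDiagTab n d J0)
        + paramMatrix (fun k : Fin K ↦ finMat n ((vtab K fun k ↦ conjDiagTab n d (Js.getD k [])).getD k []))
            (fun k : Fin K ↦ x k)
      = Matrix.diagonal (fun i : Fin n ↦ (vreal d i))
          * (finMat n J0 + paramMatrix (fun k : Fin K ↦ finMat n (Js.getD k [])) (fun k : Fin K ↦ x k))
          * Matrix.diagonal (fun i : Fin n ↦ (vreal d i)⁻¹) := by
  have h2 : ∀ k : Fin K, (vtab K fun k ↦ conjDiagTab n d (Js.getD k [])).getD k []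
      = conjDiagTab n d (Js.getD k []) := fun k ↦ vtab_getD₆ _ _ k.isLt
  simp only [h2, finMat_conjDiagTab₆]
  unfold paramMatrix
  rw [Matrix.mul_add, Matrix.add_mul, Matrix.mul_sum, Matrix.sum_mul]
  congr 1
  refine Finset.sum_congr rfl fun k _ ↦ ?_
  rw [Matrix.mul_smul, Matrix.smul_mul]

/-- **Positive diagonal similarity preserves the spectrum** (complexified real matrices). [folklore] -/
private theorem mem_spectrum_conjDiag₆ {n : ℕ} {d : List ℚ} (hd : posListQ n d = true)
    {M : Matrix (Fin n) (Fin n) ℝ} {μ : ℂ} (hμ : μ ∈ spectrum ℂ (M.map (algebraMap ℝ ℂ))) :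
    μ ∈ spectrum ℂ ((Matrix.diagonal (fun i : Fin n ↦ (vreal d i)) * M
      * Matrix.diagonal (fun i : Fin n ↦ (vreal d i)⁻¹)).map (algebraMap ℝ ℂ)) := by
  have hdpos : ∀ i : Fin n, (0 : ℝ) < vreal d i := fun i ↦ by
    have := of_rall hd i.isLt; rw [decide_eq_true_eq] at this
    unfold vreal; exact_mod_cast this
  let dc : Fin n → ℂ := fun i ↦ ((vreal d i : ℝ) : ℂ)
  have hdc : ∀ i, dc i ≠ 0 := fun i ↦ by
    simp only [dc, ne_eq, Complex.ofReal_eq_zero]; exact (hdpos i).ne'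
  let u : (Matrix (Fin n) (Fin n) ℂ)ˣ :=
    ⟨Matrix.diagonal dc, Matrix.diagonal fun i ↦ (dc i)⁻¹,
      by rw [Matrix.diagonal_mul_diagonal]; convert Matrix.diagonal_one with i; exact mul_inv_cancel₀ (hdc i),
      by rw [Matrix.diagonal_mul_diagonal]; convert Matrix.diagonal_one with i; exact inv_mul_cancel₀ (hdc i)⟩
  have hconj : (Matrix.diagonal (fun i : Fin n ↦ (vreal d i)) * M
        * Matrix.diagonal (fun i : Fin n ↦ (vreal d i)⁻¹)).map (algebraMap ℝ ℂ)
      = (u : Matrix (Fin n) (Fin n) ℂ) * M.map (algebraMap ℝ ℂ) * (u⁻¹ : (Matrix (Fin n) (Fin n) ℂ)ˣ) := by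
    rw [Matrix.map_mul, Matrix.map_mul]
    have e1 : (Matrix.diagonal fun i : Fin n ↦ vreal d i).map (algebraMap ℝ ℂ) = Matrix.diagonal dc :=
      Matrix.diagonal_map (map_zero _)
    have e2 : (Matrix.diagonal fun i : Fin n ↦ (vreal d i)⁻¹).map (algebraMap ℝ ℂ)
        = Matrix.diagonal fun i ↦ (dc i)⁻¹ := by
      rw [Matrix.diagonal_map (map_zero _)]
      congr 1; funext i; simp [dc, Complex.coe_algebraMap]
    rw [e1, e2]; rfl
  rw [hconj, spectrum.units_conjugate]; exact hμ

/-- **Balanced + shifted Taylor–Lyapunov certificate ⇒ rate bound for the ORIGINAL family.** If all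
scaling factors are positive and the kd-tree checks for the tables `(D J₀ D⁻¹ + s·1, D J^{(k)} D⁻¹)`
with rate `r`, then every eigenvalue `μ` of `J(x)`, `x` in the box, has `Re μ ≤ −(s + r)`.
[cite: GahinetApkarianChilali1996, §III; CarlsonSchneider1962, § 1] -/
theorem re_le_neg_of_kdCheck_lyapTay_conj_shifted {n K : ℕ} {J0 : List (List ℚ)}
    {Js : List (List (List ℚ))} {d : List ℚ} {s r : ℚ} {B : Box} {t : KdCert LyapTayLeaf}
    (hd : posListQ n d = true)
    (h : t.check (lyapTayLeafOK n K (addDiagTab n s (conjDiagTab n d J0))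
      (vtab K fun k ↦ conjDiagTab n d (Js.getD k [])) r) B = true)
    (x : ℕ → ℝ) (hx : B.mem x) {μ : ℂ}
    (hμ : μ ∈ spectrum ℂ ((finMat n J0
      + paramMatrix (fun k : Fin K ↦ finMat n (Js.getD k [])) (fun k : Fin K ↦ x k)).map (algebraMap ℝ ℂ))) :
    μ.re ≤ -((s + r : ℚ) : ℝ) := by
  have hμ' := mem_spectrum_conjDiag₆ hd hμ
  rw [← affine_conjDiagTab_eq₆ d J0 Js x] at hμ'
  exact re_le_neg_of_kdCheck_lyapTay_shifted h x hx hμ'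

/-! ### Part F. Kernel example -/

/-- `J(p) = [[−1, p], [0, −1]]`, `p ∈ [−1, 1]`, ONE order-1 leaf: `α = [0], [1]`, `P_0 = I`, `P_1 = 0`,
`β = [0], [1], [2]`; the checker regroups `Q_0 = 2·I`, `Q_1 = −(J_1ᵀ + J_1) = [[0, −1], [−1, 0]]`,
`Q_2 = 0`, so `C = 2·I`, `R_Q = |Q_1|`, and Gershgorin (empty `LDL` factors) certifies `m = 1`,
`κ = 1`, `π = 1`, rate `1/2` (the true spectrum is `{−1}`). -/
example : KdCert.check (lyapTayLeafOK 2 1 [[-1, 0], [0, -1]] [[[0, 1], [0, 0]]] (1/2)) [((-1 : ℚ), 1)]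
    (KdCert.leaf ⟨[[0], [1]], [[[1, 0], [0, 1]], [[0, 0], [0, 0]]], [[0], [1], [2]], 1,
      ⟨1, 0, [], []⟩, ⟨-1, 0, [], []⟩, ⟨1, 0, [], []⟩⟩) = true := by
  decide +kernel


/-! ### Appended 2026-08-27 (session 5): a FAST leaf check — tabulated positions, mask-selected table sums

The checker `lyapTayLeafOK` above re-evaluates the position look-ups `posOf` inside the entry loops of
`lyapTayQTabs` (`M·n²·(L + K·L)` evaluations of a `findIdx`); measured in the kernel: ≈ 130 s per leaf at
`n = 5`, `K = 4`, `d = 3` (WSCC9 box B, ten leaves, 1 374 s). The variant below tabulates the positions ONCE,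
turns them into Boolean masks per output index `j`, and adds the SELECTED tables as whole tables
(`selSumTab`), so the work per leaf is `O(M·(L + K·L) + (L + K·L)·n³)`. It computes THE SAME tables entry
by entry on the `n × n` block (`mget_lyapTayQTabsF`), hence `lyapTayLeafOKF ⇒ lyapTayLeafOK`
(`lyapTayLeafOK_of_F`) and every soundness theorem transfers verbatim. -/

/-- Sum of the tables selected by a Boolean mask (structural on both lists; whole-table additions). [folklore] -/
def selSumTab (n : ℕ) : List Bool → List (List (List ℚ)) → List (List ℚ)
  | m :: ms, T :: Ts => if m then addTab n T (selSumTab n ms Ts) else selSumTab n ms Ts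
  | _, _ => zeroTab n

/-- `Σ_k selSumTab (masks_k) (tables_k)` (structural on both lists). [folklore] -/
def selSumTab2 (n : ℕ) : List (List Bool) → List (List (List (List ℚ))) → List (List ℚ)
  | m :: ms, T :: Ts => addTab n (selSumTab n m T) (selSumTab2 n ms Ts)
  | _, _ => zeroTab n

/-- The regrouped tables `Q_j` computed FAST: positions tabulated once, Boolean masks per `j`, selected
whole-table sums. Same values as `lyapTayQTabs` on the block (`mget_lyapTayQTabsF`).
[cite: GahinetApkarianChilali1996, §III (the Lyapunov derivative of a parameter-dependent `P`)] -/
def lyapTayQTabsF (n K L M : ℕ) (Jc : List (List ℚ)) (Js Ps : List (List (List ℚ)))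
    (alphas betas : List (List ℕ)) : List (List (List ℚ)) :=
  let As := vtab L fun i ↦ lyapTab n Jc (Ps.getD i [])
  let Bs := vtab K fun k ↦ vtab L fun i ↦ lyapTab n (Js.getD k []) (Ps.getD i [])
  let pA := vtab L fun i ↦ posOf K betas (alphas.getD i [])
  let pB := vtab K fun k ↦ vtab L fun i ↦ posOf K betas (bumpIdx K (alphas.getD i []) k)
  vtab M fun j ↦ addTab n (selSumTab n (pA.map fun q ↦ q == j) As)
    (selSumTab2 n (pB.map fun row ↦ row.map fun q ↦ q == j) Bs)

/-- **The FAST Taylor–Lyapunov leaf check**: `lyapTayLeafOK` with `lyapTayQTabsF` in place of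
`lyapTayQTabs` (everything else identical). [cite: GahinetApkarianChilali1996, §III; Hladik2017, §3] -/
def lyapTayLeafOKF (n K : ℕ) (J0 : List (List ℚ)) (Js : List (List (List ℚ))) (r : ℚ) (B : Box)
    (l : LyapTayLeaf) : Bool :=
  let L := l.Ps.length
  let M := l.betas.length
  let w := boxHalfList K B
  let Qs := lyapTayQTabsF n K L M (affineAtQ n K J0 Js (boxCentreList K B)) Js l.Ps l.alphas l.betas
  let P0 := centreTab n L K l.alphas l.Ps
  rall L (fun i ↦ symmQ n (l.Ps.getD i [])) && coverIdx K L M l.alphas l.betas &&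
    decide (0 < l.cP.lam) && checkLower n P0 (zeroTab n) l.cP &&
    decide (0 < l.π) && decide (-l.π ≤ l.cN.lam) &&
    checkLower n (negTab n P0) (radTab n L K l.alphas l.Ps w) l.cN &&
    decide (0 < l.cQ.lam) && decide (2 * l.π * r ≤ l.cQ.lam) &&
    checkLower n (centreTab n M K l.betas Qs) (radTab n M K l.betas Qs w) l.cQ

/-! #### Plumbing: the fast tables equal the plain ones on the block -/

/-- `mget (zeroTab n) a b = 0` on the block. [folklore] -/
private theorem mget_zeroTab₆ {n a b : ℕ} (ha : a < n) (hb : b < n) : mget (zeroTab n) a b = 0 := by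
  unfold zeroTab; rw [mget_mtab _ ha hb]

/-- `mget (addTab n A B) a b = mget A a b + mget B a b` on the block. [folklore] -/
private theorem mget_addTab₆ {n a b : ℕ} (ha : a < n) (hb : b < n) (A B : List (List ℚ)) :
    mget (addTab n A B) a b = mget A a b + mget B a b := by
  unfold addTab; rw [mget_mtab _ ha hb]

/-- `mget [] a b = 0`. [folklore] -/
private theorem mget_nil₆ (a b : ℕ) : mget ([] : List (List ℚ)) a b = 0 := by
  simp [mget]

/-- **Mask-selected sum = indicator sum.** [folklore] -/
private theorem mget_selSumTab {n a b : ℕ} (ha : a < n) (hb : b < n) (j : ℕ) :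
    ∀ (ps : List ℕ) (Ts : List (List (List ℚ))),
      mget (selSumTab n (ps.map fun q ↦ q == j) Ts) a b
        = ∑ i ∈ range ps.length, (if ps.getD i 0 = j then mget (Ts.getD i []) a b else 0)
  | [], Ts => by
    cases Ts <;> simp [selSumTab, mget_zeroTab₆ ha hb]
  | p :: ps, [] => by
    rw [List.map_cons]
    show mget (zeroTab n) a b = _
    rw [mget_zeroTab₆ ha hb]
    symm
    refine Finset.sum_eq_zero fun i _ ↦ ?_
    simp [mget_nil₆]
  | p :: ps, T :: Ts => by
    rw [List.map_cons, List.length_cons, Finset.sum_range_succ']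
    simp only [List.getD_cons_succ, List.getD_cons_zero]
    rw [← mget_selSumTab ha hb j ps Ts]
    show mget (if (p == j) = true then addTab n T (selSumTab n (ps.map fun q ↦ q == j) Ts)
      else selSumTab n (ps.map fun q ↦ q == j) Ts) a b = _
    by_cases hp : p = j
    · subst hp
      rw [if_pos (beq_self_eq_true p), if_pos rfl, mget_addTab₆ ha hb, add_comm]
    · have h1 : (p == j) = false := beq_false_of_ne hp
      rw [h1, if_neg (by decide), if_neg hp, add_zero]

/-- Two-level mask-selected sum. [folklore] -/
private theorem mget_selSumTab2 {n a b : ℕ} (ha : a < n) (hb : b < n) (j : ℕ) :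
    ∀ (qs : List (List ℕ)) (Us : List (List (List (List ℚ)))),
      mget (selSumTab2 n (qs.map fun row ↦ row.map fun q ↦ q == j) Us) a b
        = ∑ k ∈ range qs.length, mget (selSumTab n ((qs.getD k []).map fun q ↦ q == j) (Us.getD k [])) a b
  | [], Us => by
    cases Us <;> simp [selSumTab2, mget_zeroTab₆ ha hb]
  | q :: qs, [] => by
    rw [List.map_cons]
    show mget (zeroTab n) a b = _
    rw [mget_zeroTab₆ ha hb]
    symm
    refine Finset.sum_eq_zero fun k _ ↦ ?_
    rw [List.getD_eq_default ([] : List (List (List (List ℚ)))) _ (by simp)]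
    cases (((q :: qs).getD k []).map fun q ↦ q == j) <;> simp [selSumTab, mget_zeroTab₆ ha hb]
  | q :: qs, U :: Us => by
    rw [List.map_cons, List.length_cons, Finset.sum_range_succ']
    simp only [List.getD_cons_succ, List.getD_cons_zero]
    rw [← mget_selSumTab2 ha hb j qs Us]
    show mget (addTab n (selSumTab n (q.map fun q ↦ q == j) U)
      (selSumTab2 n (qs.map fun row ↦ row.map fun q ↦ q == j) Us)) a b = _
    rw [mget_addTab₆ ha hb, add_comm]

/-- `rsum` congruence below the bound. [folklore] -/
private theorem rsum_congr₆ {N : ℕ} {f g : ℕ → ℚ} (h : ∀ j < N, f j = g j) : rsum N f = rsum N g := by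
  rw [rsum_eq_sum, rsum_eq_sum]
  exact Finset.sum_congr rfl fun j hj ↦ h j (Finset.mem_range.1 hj)

/-- `mtab` congruence on the block. [folklore] -/
private theorem mtab_congr₆ {r c : ℕ} {f g : ℕ → ℕ → ℚ} (h : ∀ a < r, ∀ b < c, f a b = g a b) :
    mtab r c f = mtab r c g := by
  unfold mtab
  refine List.map_congr_left fun a ha ↦ List.map_congr_left fun b hb ↦ ?_
  exact h a (List.mem_range.1 ha) b (List.mem_range.1 hb)

/-- **The fast tables are the plain tables, entry by entry on the block.**
[cite: GahinetApkarianChilali1996, §III] -/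
private theorem mget_lyapTayQTabsF {n K L M : ℕ} (Jc : List (List ℚ)) (Js Ps : List (List (List ℚ)))
    (alphas betas : List (List ℕ)) {j a b : ℕ} (hj : j < M) (ha : a < n) (hb : b < n) :
    mget ((lyapTayQTabsF n K L M Jc Js Ps alphas betas).getD j []) a b
      = mget ((lyapTayQTabs n K L M Jc Js Ps
          (fun i ↦ posOf K betas (alphas.getD i []))
          (fun k i ↦ posOf K betas (bumpIdx K (alphas.getD i []) k))).getD j []) a b := by
  unfold lyapTayQTabsF lyapTayQTabs
  rw [vtab_getD₆ _ _ hj, vtab_getD₆ _ _ hj, mget_addTab₆ ha hb, mget_mtab _ ha hb, mget_selSumTab ha hb,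
    mget_selSumTab2 ha hb, length_vtab, length_vtab, rsum_eq_sum, rsum_eq_sum]
  congr 1
  · refine Finset.sum_congr rfl fun i hi ↦ ?_
    have hi' := Finset.mem_range.1 hi
    rw [vtab_getD₆ _ _ hi']
  · refine Finset.sum_congr rfl fun k hk ↦ ?_
    have hk' := Finset.mem_range.1 hk
    rw [vtab_getD₆ _ _ hk', vtab_getD₆ _ _ hk', mget_selSumTab ha hb, length_vtab, rsum_eq_sum]
    refine Finset.sum_congr rfl fun i hi ↦ ?_
    have hi' := Finset.mem_range.1 hi
    rw [vtab_getD₆ _ _ hi']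

/-- Centre-table congruence in the coefficient tables (block entries). [folklore] -/
private theorem centreTab_congr₆ {n N K : ℕ} (idx : List (List ℕ)) {Ts Ts' : List (List (List ℚ))}
    (h : ∀ j < N, ∀ a < n, ∀ b < n, mget (Ts.getD j []) a b = mget (Ts'.getD j []) a b) :
    centreTab n N K idx Ts = centreTab n N K idx Ts' := by
  unfold centreTab
  refine mtab_congr₆ fun a ha b hb ↦ rsum_congr₆ fun j hj ↦ ?_
  rw [h j hj a ha b hb]

/-- Radius-table congruence in the coefficient tables (block entries). [folklore] -/
private theorem radTab_congr₆ {n N K : ℕ} (idx : List (List ℕ)) {Ts Ts' : List (List (List ℚ))}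
    (w : List ℚ) (h : ∀ j < N, ∀ a < n, ∀ b < n, mget (Ts.getD j []) a b = mget (Ts'.getD j []) a b) :
    radTab n N K idx Ts w = radTab n N K idx Ts' w := by
  unfold radTab
  refine mtab_congr₆ fun a ha b hb ↦ rsum_congr₆ fun j hj ↦ ?_
  rw [h j hj a ha b hb]

/-- **Fast check ⇒ plain check** (same certificates, same tables).
[cite: GahinetApkarianChilali1996, §III; Hladik2017, §3] -/
theorem lyapTayLeafOK_of_F {n K : ℕ} {J0 : List (List ℚ)} {Js : List (List (List ℚ))} {r : ℚ} {B : Box}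
    {l : LyapTayLeaf} (h : lyapTayLeafOKF n K J0 Js r B l = true) : lyapTayLeafOK n K J0 Js r B l = true := by
  unfold lyapTayLeafOKF at h
  unfold lyapTayLeafOK
  simp only [Bool.and_eq_true] at h ⊢
  obtain ⟨hrest, hQ⟩ := h
  refine ⟨hrest, ?_⟩
  have hc := centreTab_congr₆ (n := n) (N := l.betas.length) (K := K) l.betas
    (fun j hj a ha b hb ↦ mget_lyapTayQTabsF (K := K) (L := l.Ps.length) (M := l.betas.length)
      (affineAtQ n K J0 Js (boxCentreList K B)) Js l.Ps l.alphas l.betas hj ha hb)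
  have hr := radTab_congr₆ (n := n) (N := l.betas.length) (K := K) l.betas (boxHalfList K B)
    (fun j hj a ha b hb ↦ mget_lyapTayQTabsF (K := K) (L := l.Ps.length) (M := l.betas.length)
      (affineAtQ n K J0 Js (boxCentreList K B)) Js l.Ps l.alphas l.betas hj ha hb)
  rw [hc, hr] at hQ
  exact hQ

/-! #### Soundness of the fast check (transferred) -/

/-- **Fast Taylor–Lyapunov certificate, box level (END-TO-END).**
[cite: GahinetApkarianChilali1996, §III; CarlsonSchneider1962, § 1; Hladik2017, §3] -/
theorem re_le_neg_of_kdCheck_lyapTayF {n K : ℕ} {J0 : List (List ℚ)} {Js : List (List (List ℚ))}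
    {r : ℚ} {B : Box} {t : KdCert LyapTayLeaf} (h : t.check (lyapTayLeafOKF n K J0 Js r) B = true)
    (x : ℕ → ℝ) (hx : B.mem x) {μ : ℂ}
    (hμ : μ ∈ spectrum ℂ ((finMat n J0
      + paramMatrix (fun k : Fin K ↦ finMat n (Js.getD k [])) (fun k : Fin K ↦ x k)).map (algebraMap ℝ ℂ))) :
    μ.re ≤ -(r : ℝ) :=
  KdCert.sound (P := fun x ↦ ∀ μ : ℂ, μ ∈ spectrum ℂ ((finMat n J0
      + paramMatrix (fun k : Fin K ↦ finMat n (Js.getD k [])) (fun k : Fin K ↦ x k)).map (algebraMap ℝ ℂ)) →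
      μ.re ≤ -(r : ℝ))
    (fun _ _ hl x hx _ hμ ↦ re_le_neg_of_lyapTayLeafOK (lyapTayLeafOK_of_F hl) x hx hμ) t B h x hx μ hμ

/-- **Shifted fast certificate** ⇒ `Re μ ≤ −(s + r)` for the unshifted family.
[cite: GahinetApkarianChilali1996, §III; CarlsonSchneider1962, § 1] -/
theorem re_le_neg_of_kdCheck_lyapTayF_shifted {n K : ℕ} {J0 : List (List ℚ)}
    {Js : List (List (List ℚ))} {s r : ℚ} {B : Box} {t : KdCert LyapTayLeaf}
    (h : t.check (lyapTayLeafOKF n K (addDiagTab n s J0) Js r) B = true) (x : ℕ → ℝ) (hx : B.mem x)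
    {μ : ℂ} (hμ : μ ∈ spectrum ℂ ((finMat n J0
      + paramMatrix (fun k : Fin K ↦ finMat n (Js.getD k [])) (fun k : Fin K ↦ x k)).map (algebraMap ℝ ℂ))) :
    μ.re ≤ -((s + r : ℚ) : ℝ) := by
  refine re_le_neg_of_forall_shift₆ (fun ν hν ↦ re_le_neg_of_kdCheck_lyapTayF h x hx ?_) hμ
  rw [finMat_addDiagTab₆]
  convert hν using 3
  abel

/-- **Balanced + shifted fast certificate ⇒ rate bound for the ORIGINAL family.**
[cite: GahinetApkarianChilali1996, §III; CarlsonSchneider1962, § 1] -/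
theorem re_le_neg_of_kdCheck_lyapTayF_conj_shifted {n K : ℕ} {J0 : List (List ℚ)}
    {Js : List (List (List ℚ))} {d : List ℚ} {s r : ℚ} {B : Box} {t : KdCert LyapTayLeaf}
    (hd : posListQ n d = true)
    (h : t.check (lyapTayLeafOKF n K (addDiagTab n s (conjDiagTab n d J0))
      (vtab K fun k ↦ conjDiagTab n d (Js.getD k [])) r) B = true)
    (x : ℕ → ℝ) (hx : B.mem x) {μ : ℂ}
    (hμ : μ ∈ spectrum ℂ ((finMat n J0
      + paramMatrix (fun k : Fin K ↦ finMat n (Js.getD k [])) (fun k : Fin K ↦ x k)).map (algebraMap ℝ ℂ))) :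
    μ.re ≤ -((s + r : ℚ) : ℝ) := by
  have hμ' := mem_spectrum_conjDiag₆ hd hμ
  rw [← affine_conjDiagTab_eq₆ d J0 Js x] at hμ'
  exact re_le_neg_of_kdCheck_lyapTayF_shifted h x hx hμ'

/-- The kernel example above, through the fast check. -/
example : KdCert.check (lyapTayLeafOKF 2 1 [[-1, 0], [0, -1]] [[[0, 1], [0, 0]]] (1/2)) [((-1 : ℚ), 1)]
    (KdCert.leaf ⟨[[0], [1]], [[[1, 0], [0, 1]], [[0, 0], [0, 0]]], [[0], [1], [2]], 1,
      ⟨1, 0, [], []⟩, ⟨-1, 0, [], []⟩, ⟨1, 0, [], []⟩⟩) = true := by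
  decide +kernel


/-! ### Appended 2026-08-27 (session 5, third part): CHUNKED kernel verification — supplied tables, verified piecewise

One `decide +kernel` reduces a bounded amount of work (measured ≈ 150 s on the farm); a leaf with many
tables (`C(K′+d, d)·(K+1)·n³ ≳ 9·10⁴`) cannot be ONE reduction. Here the certificate SUPPLIES the position
tables `pA`, `pB` and the regrouped coefficient tables `Q_j` as literals; the kernel verifies (i) the
positions once, (ii) each `Q_j` separately against the lazily computed `j`-th table (`lyapTayChunkOK`;
only the products mapped to `j` are evaluated), (iii) the three-certificate check on the supplied tables
(`lyapTayLeafOKS`); `lyapTayLeafOKF_of_supplied` assembles these into the fast check, so every soundness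
theorem above applies unchanged. Nothing mathematical is added. -/

/-- Block equality of two tables on `n × n`. [folklore] -/
def eqTabBlock (n : ℕ) (A B : List (List ℚ)) : Bool :=
  rall n fun a ↦ rall n fun b ↦ decide (mget A a b = mget B a b)

/-- The fast regrouped tables with the position tables SUPPLIED (`pA`, `pB`) instead of computed.
[cite: GahinetApkarianChilali1996, §III] -/
def lyapTayQTabsG (n K L M : ℕ) (Jc : List (List ℚ)) (Js Ps : List (List (List ℚ)))
    (pA : List ℕ) (pB : List (List ℕ)) : List (List (List ℚ)) :=
  let As := vtab L fun i ↦ lyapTab n Jc (Ps.getD i [])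
  let Bs := vtab K fun k ↦ vtab L fun i ↦ lyapTab n (Js.getD k []) (Ps.getD i [])
  vtab M fun j ↦ addTab n (selSumTab n (pA.map fun q ↦ q == j) As)
    (selSumTab2 n (pB.map fun row ↦ row.map fun q ↦ q == j) Bs)

/-- Supplied positions of the `α_i` are the computed ones. [folklore] -/
def lyapTayPosAOK (K L : ℕ) (alphas betas : List (List ℕ)) (pA : List ℕ) : Bool :=
  decide (pA = vtab L fun i ↦ posOf K betas (alphas.getD i []))

/-- Supplied positions of the `α_i + e_k` are the computed ones. [folklore] -/
def lyapTayPosBOK (K L : ℕ) (alphas betas : List (List ℕ)) (pB : List (List ℕ)) : Bool :=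
  decide (pB = vtab K fun k ↦ vtab L fun i ↦ posOf K betas (bumpIdx K (alphas.getD i []) k))

/-- Chunk `j`: the supplied table `Q_j` equals the `j`-th regrouped table on the block (computed lazily
from the supplied positions). [cite: GahinetApkarianChilali1996, §III] -/
def lyapTayChunkOK (n K : ℕ) (J0 : List (List ℚ)) (Js : List (List (List ℚ))) (B : Box) (l : LyapTayLeaf)
    (pA : List ℕ) (pB : List (List ℕ)) (Qs : List (List (List ℚ))) (j : ℕ) : Bool :=
  eqTabBlock n (Qs.getD j [])
    ((lyapTayQTabsG n K l.Ps.length l.betas.length (affineAtQ n K J0 Js (boxCentreList K B)) Js l.Ps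
      pA pB).getD j [])

/-- The three-certificate leaf check on SUPPLIED regrouped tables `Qs` (everything else as in
`lyapTayLeafOKF`; the family enters only through the chunk checks of `Qs`).
[cite: GahinetApkarianChilali1996, §III; Hladik2017, §3] -/
def lyapTayLeafOKS (n K : ℕ) (r : ℚ) (B : Box) (l : LyapTayLeaf) (Qs : List (List (List ℚ))) : Bool :=
  let L := l.Ps.length
  let M := l.betas.length
  let w := boxHalfList K B
  let P0 := centreTab n L K l.alphas l.Ps
  rall L (fun i ↦ symmQ n (l.Ps.getD i [])) && coverIdx K L M l.alphas l.betas &&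
    decide (0 < l.cP.lam) && checkLower n P0 (zeroTab n) l.cP &&
    decide (0 < l.π) && decide (-l.π ≤ l.cN.lam) &&
    checkLower n (negTab n P0) (radTab n L K l.alphas l.Ps w) l.cN &&
    decide (0 < l.cQ.lam) && decide (2 * l.π * r ≤ l.cQ.lam) &&
    checkLower n (centreTab n M K l.betas Qs) (radTab n M K l.betas Qs w) l.cQ

/-- With the computed positions supplied, `lyapTayQTabsG` is `lyapTayQTabsF`. [folklore] -/
private theorem lyapTayQTabsG_eq_F {n K L M : ℕ} (Jc : List (List ℚ)) (Js Ps : List (List (List ℚ)))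
    (alphas betas : List (List ℕ)) :
    lyapTayQTabsG n K L M Jc Js Ps (vtab L fun i ↦ posOf K betas (alphas.getD i []))
        (vtab K fun k ↦ vtab L fun i ↦ posOf K betas (bumpIdx K (alphas.getD i []) k))
      = lyapTayQTabsF n K L M Jc Js Ps alphas betas := rfl

/-- **Chunked verification ⇒ fast check.** Supplied positions verified, every supplied `Q_j` verified,
and the supplied-table leaf check passing, together give `lyapTayLeafOKF`.
[cite: GahinetApkarianChilali1996, §III; Hladik2017, §3] -/
theorem lyapTayLeafOKF_of_supplied {n K : ℕ} {J0 : List (List ℚ)} {Js : List (List (List ℚ))} {r : ℚ}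
    {B : Box} {l : LyapTayLeaf} {pA : List ℕ} {pB : List (List ℕ)} {Qs : List (List (List ℚ))}
    (hA : lyapTayPosAOK K l.Ps.length l.alphas l.betas pA = true)
    (hB : lyapTayPosBOK K l.Ps.length l.alphas l.betas pB = true)
    (hQ : ∀ j, j < l.betas.length → lyapTayChunkOK n K J0 Js B l pA pB Qs j = true)
    (hS : lyapTayLeafOKS n K r B l Qs = true) : lyapTayLeafOKF n K J0 Js r B l = true := by
  unfold lyapTayPosAOK at hA; unfold lyapTayPosBOK at hB
  rw [decide_eq_true_eq] at hA hB
  subst hA; subst hB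
  have hEq : ∀ j < l.betas.length, ∀ a < n, ∀ b < n,
      mget (Qs.getD j []) a b
        = mget ((lyapTayQTabsF n K l.Ps.length l.betas.length
            (affineAtQ n K J0 Js (boxCentreList K B)) Js l.Ps l.alphas l.betas).getD j []) a b := by
    intro j hj a ha b hb
    have h1 := hQ j hj
    unfold lyapTayChunkOK eqTabBlock at h1
    rw [lyapTayQTabsG_eq_F] at h1
    have h2 := of_rall (of_rall h1 ha) hb
    rwa [decide_eq_true_eq] at h2
  unfold lyapTayLeafOKS at hS
  unfold lyapTayLeafOKF
  simp only [Bool.and_eq_true] at hS ⊢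
  obtain ⟨hrest, hC⟩ := hS
  refine ⟨hrest, ?_⟩
  rw [centreTab_congr₆ (n := n) (N := l.betas.length) (K := K) l.betas hEq,
    radTab_congr₆ (n := n) (N := l.betas.length) (K := K) l.betas (boxHalfList K B) hEq] at hC
  exact hC

/-- The kernel example once more, through the supplied-data route: positions `pA = [0, 1]`,
`pB = [[1, 2]]`, tables `Q_0 = 2·I`, `Q_1 = [[0, −1], [−1, 0]]`, `Q_2 = 0`. -/
example : lyapTayLeafOKF 2 1 [[-1, 0], [0, -1]] [[[0, 1], [0, 0]]] (1/2) [((-1 : ℚ), 1)]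
    ⟨[[0], [1]], [[[1, 0], [0, 1]], [[0, 0], [0, 0]]], [[0], [1], [2]], 1,
      ⟨1, 0, [], []⟩, ⟨-1, 0, [], []⟩, ⟨1, 0, [], []⟩⟩ = true :=
  lyapTayLeafOKF_of_supplied (pA := [0, 1]) (pB := [[1, 2]])
    (Qs := [[[2, 0], [0, 2]], [[0, -1], [-1, 0]], [[0, 0], [0, 0]]])
    (by decide +kernel) (by decide +kernel)
    (fun j hj ↦ by
      have hj' : j < 3 := hj
      interval_cases j <;> decide +kernel)
    (by decide +kernel)


/-! ### Appended 2026-08-27 (session 5, fourth part): assembling the chunk facts one by one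

An emitted file proves the `M` chunk facts of a leaf as `M` small theorems; collecting them into
`∀ j < M` by one literal pattern match does not scale in the ELABORATOR (a 462-arm match crashed the
farm node), so the facts are chained: `lyapTayChunksUpTo … m` = «chunks `0 … m−1` hold». -/

/-- Chunks `0, …, m−1` of the supplied tables are verified (assembly predicate of the chunked
certificate check). [cite: GahinetApkarianChilali1996, §III; Hladik2017, §3] -/
def lyapTayChunksUpTo (n K : ℕ) (J0 : List (List ℚ)) (Js : List (List (List ℚ))) (B : Box) (l : LyapTayLeaf)
    (pA : List ℕ) (pB : List (List ℕ)) (Qs : List (List (List ℚ))) (m : ℕ) : Prop :=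
  ∀ j, j < m → lyapTayChunkOK n K J0 Js B l pA pB Qs j = true

/-- No chunk to verify below `0`. [cite: GahinetApkarianChilali1996, §III; Hladik2017, §3] -/
theorem lyapTayChunksUpTo_zero {n K : ℕ} {J0 : List (List ℚ)} {Js : List (List (List ℚ))} {B : Box}
    {l : LyapTayLeaf} {pA : List ℕ} {pB : List (List ℕ)} {Qs : List (List (List ℚ))} :
    lyapTayChunksUpTo n K J0 Js B l pA pB Qs 0 := fun _ hj ↦ absurd hj (Nat.not_lt_zero _)

/-- One more chunk. [cite: GahinetApkarianChilali1996, §III; Hladik2017, §3] -/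
theorem lyapTayChunksUpTo_succ {n K : ℕ} {J0 : List (List ℚ)} {Js : List (List (List ℚ))} {B : Box}
    {l : LyapTayLeaf} {pA : List ℕ} {pB : List (List ℕ)} {Qs : List (List (List ℚ))} {m : ℕ}
    (h : lyapTayChunksUpTo n K J0 Js B l pA pB Qs m) (hm : lyapTayChunkOK n K J0 Js B l pA pB Qs m = true) :
    lyapTayChunksUpTo n K J0 Js B l pA pB Qs (m + 1) := fun j hj ↦ by
  rcases Nat.lt_succ_iff_lt_or_eq.1 hj with hj' | rfl
  · exact h j hj'
  · exact hm

/-- **Chunked verification ⇒ fast check**, chained form.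
[cite: GahinetApkarianChilali1996, §III; Hladik2017, §3] -/
theorem lyapTayLeafOKF_of_chunksUpTo {n K : ℕ} {J0 : List (List ℚ)} {Js : List (List (List ℚ))} {r : ℚ}
    {B : Box} {l : LyapTayLeaf} {pA : List ℕ} {pB : List (List ℕ)} {Qs : List (List (List ℚ))}
    (hA : lyapTayPosAOK K l.Ps.length l.alphas l.betas pA = true)
    (hB : lyapTayPosBOK K l.Ps.length l.alphas l.betas pB = true)
    (hQ : lyapTayChunksUpTo n K J0 Js B l pA pB Qs l.betas.length)
    (hS : lyapTayLeafOKS n K r B l Qs = true) : lyapTayLeafOKF n K J0 Js r B l = true :=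
  lyapTayLeafOKF_of_supplied hA hB hQ hS


/-! ### Appended 2026-08-27 (session 6): INERTIA leaves — certified eigenvalue COUNTS in the open
half-planes for the same real affine families (instability regions; the UPPER side of the spectral abscissa)

THE MATHEMATICS is the Carlson–Schneider MAIN INERTIA THEOREM, a tree theorem
(`Literature.LinearAlgebra.Matrix.card_eigenvalues_eq_of_lyapunov_posDef`, file `LyapunovEquation.lean`): if
`G` is Hermitian and `AᴴG + GA ≻ O` then `A` has exactly `ν₊(G)` characteristic roots (with multiplicity) in
the open right half-plane, `ν₋(G)` in the open left half-plane, and none on the imaginary axis. For the real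
affine family `J(x)` and a leaf polynomial `P(δ)` as above take `G = −P(δ)`: the Lyapunov-form certificate of
a Taylor leaf (`Q(δ) = −(JᵀP + PJ) = J(x)ᵀG + GJ(x) ⪰ m·1`, `m > 0`, on the leaf) needs NO sign condition on
`P`. The counts `ν₋(P(δ)) ≥ q` and `ν₊(P(δ)) ≥ n − q` are certified UNIFORMLY on the leaf by rational TEST
TABLES `V` (`n × q`) and `U` (`n × (n − q)`): `VᵀP(δ)V ≺ O` and `UᵀP(δ)U ≻ O` on the leaf, each through ONE
`LDLCert` for the centred interval family of the small congruent tables `VᵀP_iV` (`UᵀP_iU`). A definite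
compression on the range of `V` forces `q` eigenvalues of that sign (Courant–Fischer counting, tree lemma
`Literature.MathematicalPhysics.QuantumLattice.finrank_le_card_lt_eigenvalues`; the compression being
definite, `V` is injective, so the range has dimension `q`), and since `ν₊ + ν₋ + ν₀ = n` with `ν₀(G) = 0`
the two lower bounds are equalities.

SOUNDNESS. `countP_re_of_lyapInertiaLeafOK` / `countP_re_of_kdCheck_lyapInertia` (exact counts `q`,
`n − q`, `0` of the roots of the characteristic polynomial of `J(x)` over `ℂ` with `Re > 0`, `Re < 0`,
`Re = 0`, for every `x` of the box); `le_countP_re_pos_of_lyapInertiaLeafLB` / `…_of_kdCheck_lyapInertiaLB`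
(the `V`-only check: at least `q` roots with `Re > 0`, none on the axis) and
`exists_re_pos_of_kdCheck_lyapInertiaLB` (`0 < q`: an eigenvalue with `Re μ > 0` at every point of the box —
CERTIFIED INSTABILITY); the shifted / balanced versions read the counts for `D(J(x) + s·1)D⁻¹`, i.e. to the
right / left of the line `Re = −s`, in particular `∃ μ ∈ σ(J(x)), Re μ > −s` — the UPPER side which, with the
rate certificates above, makes a spectral-abscissa enclosure `−s < max Re σ(J(x)) ≤ −r` two-sided.

## What is NOT certified (inertia leaves)

Anything off the box; WHICH eigenvalues lie where (only counts, with algebraic multiplicity); counts on a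
box meeting `{x : J(x) + s·1 has an imaginary-axis eigenvalue}` (there `Q ≻ O` is impossible and the tree
fails — a strip around the crossing stays undecided); any dynamical statement beyond the linearisation.

## References (inertia leaves)

* [CarlsonSchneider1962] D. Carlson, H. Schneider, *Inertia theorems for matrices: the semi-definite case*,
  Bull. Amer. Math. Soc. 68 (1962) 479–484, § 1 (Main Inertia Theorem) — the count identity.
  [cite: CarlsonSchneider1962, § 1]
* [GolubVanLoan2013] G. H. Golub, C. F. Van Loan, *Matrix Computations*, 4th ed., §8.1.1 Thm 8.1.2 (Courant–Fischer
  Minimax Theorem) — the minimax count behind the test tables.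
  [cite: GolubVanLoan2013, §8.1.1 Thm 8.1.2 (Courant–Fischer Minimax Theorem)]
* [GahinetApkarianChilali1996] §III (parameter-dependent `P`); [Hladik2017] §3 (centred forms) — as above.
-/

/-! #### Part H. Data and checkers (inertia leaves) -/

/-- The congruent `q × q` table `VᵀPV` of an `n × q` table `V` and an `n × n` table `P`
(entry `(a,b)` is `Σ_m (Σ_l V_{la} P_{lm}) V_{mb}`). [folklore] -/
def congTab (n q : ℕ) (V P : List (List ℚ)) : List (List ℚ) :=
  mtab q q fun a b ↦ rsum n fun m ↦ (rsum n fun l ↦ mget V l a * mget P l m) * mget V m b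

/-- An INERTIA leaf: the data `α_i`, `P_i`, `β_j` of a Taylor–Lyapunov leaf WITHOUT sign conditions on
`P(δ) = Σ_i δ^{α_i} P_i`, a certificate `cQ` for `Q(δ) ⪰ m·1` (`m > 0`) on the leaf, an `n × q` test
table `V` with a certificate `cV` for `−VᵀP(δ)V ⪰ κ_V·1` (`κ_V > 0`) on the leaf and, for exact counts,
an `n × (n − q)` test table `U` with a certificate `cU` for `UᵀP(δ)U ⪰ κ_U·1` (`κ_U > 0`) on the leaf.
[cite: CarlsonSchneider1962, § 1; GahinetApkarianChilali1996, §III] -/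
structure LyapInertiaLeaf where
  /-- the multi-indices `α_i` (lists of length `K`) -/
  alphas : List (List ℕ)
  /-- the tables `P_i` (rational, symmetric), same length -/
  Ps : List (List (List ℚ))
  /-- the output multi-indices `β_j` (must contain every `α_i` and every `α_i + e_k`) -/
  betas : List (List ℕ)
  /-- certificate `Q(δ) ⪰ cQ.lam·1` on the leaf (need `cQ.lam > 0`) -/
  cQ : LDLCert
  /-- the `n × q` test table for the negative directions of `P(δ)` -/
  V : List (List ℚ)
  /-- certificate `−VᵀP(δ)V ⪰ cV.lam·1` on the leaf (need `cV.lam > 0`) -/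
  cV : LDLCert
  /-- the `n × (n − q)` test table for the positive directions of `P(δ)` (exact counts only) -/
  U : List (List ℚ)
  /-- certificate `UᵀP(δ)U ⪰ cU.lam·1` on the leaf (need `cU.lam > 0`; exact counts only) -/
  cU : LDLCert
  deriving Inhabited

/-- **Inertia leaf check, lower-bound form** for the claim «at least `q` characteristic roots of `J(x)`
with `Re > 0`, none with `Re = 0`, at every `x` of the leaf»: all `P_i` symmetric; coverage; `0 < cQ.lam`
and `checkLower` of the centred interval family of the regrouped `Q_j` (fast tables); `0 < cV.lam` and
`checkLower` of the centred interval family of `−VᵀP(δ)V`.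
[cite: CarlsonSchneider1962, § 1; Hladik2017, §3] -/
def lyapInertiaLeafLB (n K : ℕ) (J0 : List (List ℚ)) (Js : List (List (List ℚ))) (q : ℕ) (B : Box)
    (l : LyapInertiaLeaf) : Bool :=
  let L := l.Ps.length
  let M := l.betas.length
  let w := boxHalfList K B
  let Qs := lyapTayQTabsF n K L M (affineAtQ n K J0 Js (boxCentreList K B)) Js l.Ps l.alphas l.betas
  let Vs := vtab L fun i ↦ congTab n q l.V (l.Ps.getD i [])
  rall L (fun i ↦ symmQ n (l.Ps.getD i [])) && coverIdx K L M l.alphas l.betas &&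
    decide (0 < l.cQ.lam) &&
    checkLower n (centreTab n M K l.betas Qs) (radTab n M K l.betas Qs w) l.cQ &&
    decide (0 < l.cV.lam) &&
    checkLower q (negTab q (centreTab q L K l.alphas Vs)) (radTab q L K l.alphas Vs w) l.cV

/-- **Inertia leaf check, exact form** for the claim «exactly `q` characteristic roots of `J(x)` with
`Re > 0`, exactly `n − q` with `Re < 0`, none with `Re = 0`, at every `x` of the leaf»: the lower-bound
check and, in addition, `0 < cU.lam` and `checkLower` of the centred interval family of `UᵀP(δ)U`.
[cite: CarlsonSchneider1962, § 1; Hladik2017, §3] -/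
def lyapInertiaLeafOK (n K : ℕ) (J0 : List (List ℚ)) (Js : List (List (List ℚ))) (q : ℕ) (B : Box)
    (l : LyapInertiaLeaf) : Bool :=
  let L := l.Ps.length
  let w := boxHalfList K B
  let Us := vtab L fun i ↦ congTab n (n - q) l.U (l.Ps.getD i [])
  lyapInertiaLeafLB n K J0 Js q B l && decide (0 < l.cU.lam) &&
    checkLower (n - q) (centreTab (n - q) L K l.alphas Us) (radTab (n - q) L K l.alphas Us w) l.cU

/-! #### Part I. Plumbing: congruent tables, complexified real forms, test subspaces -/

open scoped ComplexOrder
open WithLp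

/-- Real reading of an `n × q` rational table. [folklore] -/
def finMatRect (n q : ℕ) (V : List (List ℚ)) : Matrix (Fin n) (Fin q) ℝ := fun i a ↦ mreal V i a

/-- `finMat (VᵀPV) = (finMatRect V)ᵀ · finMat P · finMatRect V`. [folklore] -/
private theorem finMat_congTab₆ {n q : ℕ} (V P : List (List ℚ)) :
    finMat q (congTab n q V P) = (finMatRect n q V)ᵀ * finMat n P * finMatRect n q V := by
  ext a b
  rw [finMat_apply₆, Matrix.mul_apply]
  unfold congTab mreal
  rw [mget_mtab _ a.isLt b.isLt, rsum_eq_sum]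
  simp only [rsum_eq_sum]
  push_cast
  rw [← Fin.sum_univ_eq_sum_range (fun m ↦ (∑ l ∈ range n, ((mget V l a : ℚ) : ℝ) * ((mget P l m : ℚ) : ℝ))
    * ((mget V m b : ℚ) : ℝ)) n]
  refine Finset.sum_congr rfl fun m _ ↦ ?_
  rw [Matrix.mul_apply, ← Fin.sum_univ_eq_sum_range (fun l ↦ ((mget V l a : ℚ) : ℝ) * ((mget P l m : ℚ) : ℝ)) n]
  rfl

/-- The congruent polynomial: `Σ_i δ^{α_i} (VᵀP_iV) = Vᵀ (Σ_i δ^{α_i} P_i) V`. [folklore] -/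
private theorem polyTabR_congTabs₆ {n q L K : ℕ} (alphas : List (List ℕ)) (Ps : List (List (List ℚ)))
    (V : List (List ℚ)) (δ : Fin K → ℝ) :
    polyTabR q L K alphas (vtab L fun i ↦ congTab n q V (Ps.getD i [])) δ
      = (finMatRect n q V)ᵀ * polyTabR n L K alphas Ps δ * finMatRect n q V := by
  unfold polyTabR
  rw [Matrix.mul_sum, Matrix.sum_mul]
  refine Finset.sum_congr rfl fun i _ ↦ ?_
  rw [vtab_getD₆ _ _ i.isLt, finMat_congTab₆, Matrix.mul_smul, Matrix.smul_mul]

/-- The conjugate transpose of a complexified real matrix is the complexified transpose. [folklore] -/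
private theorem conjTranspose_map_ofReal₆ {m k : ℕ} (M : Matrix (Fin m) (Fin k) ℝ) :
    (M.map (algebraMap ℝ ℂ))ᴴ = Mᵀ.map (algebraMap ℝ ℂ) := by
  ext i j
  simp only [conjTranspose_apply, map_apply, transpose_apply, Complex.coe_algebraMap, Complex.star_def,
    Complex.conj_ofReal]

/-- A complexified real symmetric matrix is Hermitian. [folklore] -/
private theorem isHermitian_map_ofReal₆ {k : ℕ} {M : Matrix (Fin k) (Fin k) ℝ} (h : M.IsHermitian) :
    (M.map (algebraMap ℝ ℂ)).IsHermitian := by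
  have hT : Mᵀ = M := by
    have := h.eq; rwa [conjTranspose_eq_transpose_of_trivial] at this
  show (M.map (algebraMap ℝ ℂ))ᴴ = M.map (algebraMap ℝ ℂ)
  rw [conjTranspose_map_ofReal₆, hT]

/-- Real and imaginary parts of `Mℂ·y` for a real table `M`: `Re(Mℂ y) = M·Re y`. [folklore] -/
private theorem re_map_mulVec₆ {m k : ℕ} (M : Matrix (Fin m) (Fin k) ℝ) (y : Fin k → ℂ) (a : Fin m) :
    ((M.map (algebraMap ℝ ℂ) *ᵥ y) a).re = (M *ᵥ fun b ↦ (y b).re) a := by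
  simp only [mulVec, dotProduct, map_apply, Complex.coe_algebraMap, Complex.re_sum, Complex.re_ofReal_mul]

/-- `Im(Mℂ y) = M·Im y` for a real table `M`. [folklore] -/
private theorem im_map_mulVec₆ {m k : ℕ} (M : Matrix (Fin m) (Fin k) ℝ) (y : Fin k → ℂ) (a : Fin m) :
    ((M.map (algebraMap ℝ ℂ) *ᵥ y) a).im = (M *ᵥ fun b ↦ (y b).im) a := by
  simp only [mulVec, dotProduct, map_apply, Complex.coe_algebraMap, Complex.im_sum, Complex.im_ofReal_mul]

/-- **The complexified form splits**: `Re(ȳᵀ Mℂ y) = uᵀMu + vᵀMv` with `u = Re y`, `v = Im y`, for any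
real square table `M`. [folklore] -/
private theorem re_star_dotProduct_map_mulVec₆ {k : ℕ} (M : Matrix (Fin k) (Fin k) ℝ) (y : Fin k → ℂ) :
    (star y ⬝ᵥ (M.map (algebraMap ℝ ℂ) *ᵥ y)).re
      = (fun a ↦ (y a).re) ⬝ᵥ (M *ᵥ fun a ↦ (y a).re) + (fun a ↦ (y a).im) ⬝ᵥ (M *ᵥ fun a ↦ (y a).im) := by
  simp only [dotProduct, Complex.re_sum, Pi.star_apply, Complex.mul_re, Complex.star_def, Complex.conj_re,
    Complex.conj_im, re_map_mulVec₆, im_map_mulVec₆, ← Finset.sum_add_distrib]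
  refine Finset.sum_congr rfl fun a _ ↦ ?_
  ring

/-- `Im(ȳᵀ Mℂ y) = uᵀMv − vᵀMu` (which vanishes for symmetric `M`). [folklore] -/
private theorem im_star_dotProduct_map_mulVec₆ {k : ℕ} (M : Matrix (Fin k) (Fin k) ℝ) (y : Fin k → ℂ) :
    (star y ⬝ᵥ (M.map (algebraMap ℝ ℂ) *ᵥ y)).im
      = (fun a ↦ (y a).re) ⬝ᵥ (M *ᵥ fun a ↦ (y a).im) - (fun a ↦ (y a).im) ⬝ᵥ (M *ᵥ fun a ↦ (y a).re) := by
  simp only [dotProduct, Complex.im_sum, Pi.star_apply, Complex.mul_im, Complex.star_def, Complex.conj_re,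
    Complex.conj_im, re_map_mulVec₆, im_map_mulVec₆, ← Finset.sum_sub_distrib]
  refine Finset.sum_congr rfl fun a _ ↦ ?_
  ring

/-- A complex vector vanishes iff its real and imaginary parts do. [folklore] -/
private theorem re_im_ne_zero₆ {k : ℕ} {y : Fin k → ℂ} (hy : y ≠ 0) :
    (fun a ↦ (y a).re) ≠ 0 ∨ (fun a ↦ (y a).im) ≠ 0 := by
  by_contra h
  rw [not_or, not_ne_iff, not_ne_iff] at h
  obtain ⟨hre, him⟩ := h
  exact hy (funext fun a ↦ Complex.ext (congrFun hre a) (congrFun him a))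

/-- **Strict positivity of the complexified form** from strict positivity of the real form on non-zero
real vectors. [folklore] -/
private theorem re_star_dotProduct_map_pos₆ {k : ℕ} {M : Matrix (Fin k) (Fin k) ℝ}
    (hM : ∀ z : Fin k → ℝ, z ≠ 0 → 0 < z ⬝ᵥ (M *ᵥ z)) {y : Fin k → ℂ} (hy : y ≠ 0) :
    0 < (star y ⬝ᵥ (M.map (algebraMap ℝ ℂ) *ᵥ y)).re := by
  have h0 : ∀ z : Fin k → ℝ, 0 ≤ z ⬝ᵥ (M *ᵥ z) := fun z ↦ by
    by_cases hz : z = 0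
    · rw [hz, zero_dotProduct]
    · exact (hM z hz).le
  rw [re_star_dotProduct_map_mulVec₆]
  rcases re_im_ne_zero₆ hy with h | h
  · exact add_pos_of_pos_of_nonneg (hM _ h) (h0 _)
  · exact add_pos_of_nonneg_of_pos (h0 _) (hM _ h)

/-- **Complexified positive definiteness**: a real symmetric matrix whose form is positive on non-zero
real vectors is positive definite over `ℂ`. [folklore] -/
private theorem posDef_map_ofReal₆ {k : ℕ} {M : Matrix (Fin k) (Fin k) ℝ} (hH : M.IsHermitian)
    (hM : ∀ z : Fin k → ℝ, z ≠ 0 → 0 < z ⬝ᵥ (M *ᵥ z)) : (M.map (algebraMap ℝ ℂ)).PosDef := by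
  have hT : Mᵀ = M := by
    have := hH.eq; rwa [conjTranspose_eq_transpose_of_trivial] at this
  refine Matrix.posDef_iff_dotProduct_mulVec.2 ⟨isHermitian_map_ofReal₆ hH, fun y hy ↦ ?_⟩
  rw [Complex.lt_def]
  refine ⟨by simpa using re_star_dotProduct_map_pos₆ hM hy, ?_⟩
  -- `uᵀ M v = (Mᵀ u)·v = (M u)·v = vᵀ M u`
  rw [Complex.zero_im, im_star_dotProduct_map_mulVec₆, dotProduct_mulVec _ M, ← mulVec_transpose, hT,
    dotProduct_comm, sub_self]

/-- The form of a congruent matrix: `zᵀ(VᵀPV)z = (Vz)ᵀP(Vz)`. [folklore] -/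
private theorem dotProduct_cong_mulVec₆ {n q : ℕ} (V : Matrix (Fin n) (Fin q) ℝ) (P : Matrix (Fin n) (Fin n) ℝ)
    (z : Fin q → ℝ) : z ⬝ᵥ ((Vᵀ * P * V) *ᵥ z) = (V *ᵥ z) ⬝ᵥ (P *ᵥ (V *ᵥ z)) := by
  rw [← mulVec_mulVec, ← mulVec_mulVec, dotProduct_mulVec z Vᵀ, vecMul_transpose]

/-- **Test table for the positive count of `G = (−P)ℂ`**: if `zᵀ(VᵀPV)z < 0` for every real `z ≠ 0`
(`V` real `n × q`) then `G` has at least `q` positive eigenvalues — on the (`q`-dimensional, `V` being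
injective) complex range of `V` the form of `G` is positive; Courant–Fischer counting.
[cite: GolubVanLoan2013, §8.1.1 Thm 8.1.2 (Courant–Fischer Minimax Theorem)] -/
private theorem le_card_eigenvalues_pos_of_test₆ {n q : ℕ} {P : Matrix (Fin n) (Fin n) ℝ}
    (hG : ((-P).map (algebraMap ℝ ℂ)).IsHermitian) {V : Matrix (Fin n) (Fin q) ℝ}
    (hV : ∀ z : Fin q → ℝ, z ≠ 0 → z ⬝ᵥ ((Vᵀ * P * V) *ᵥ z) < 0) :
    q ≤ #{i | 0 < hG.eigenvalues i} := by
  classical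
  set G : Matrix (Fin n) (Fin n) ℂ := (-P).map (algebraMap ℝ ℂ) with hGdef
  set Vc : Matrix (Fin n) (Fin q) ℂ := V.map (algebraMap ℝ ℂ) with hVc
  -- the real form of the compression `Vᵀ(−P)V` is positive on non-zero vectors
  have hT : ∀ z : Fin q → ℝ, z ≠ 0 → 0 < z ⬝ᵥ ((Vᵀ * (-P) * V) *ᵥ z) := fun z hz ↦ by
    rw [dotProduct_cong_mulVec₆, neg_mulVec, dotProduct_neg, ← dotProduct_cong_mulVec₆]
    exact neg_pos.2 (hV z hz)
  -- the complex form of `G` at `Vc y` is the complexified compression form at `y`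
  have hform : ∀ y : Fin q → ℂ, star (Vc *ᵥ y) ⬝ᵥ (G *ᵥ (Vc *ᵥ y))
      = star y ⬝ᵥ ((Vᵀ * (-P) * V).map (algebraMap ℝ ℂ) *ᵥ y) := fun y ↦ by
    rw [star_mulVec, ← dotProduct_mulVec, mulVec_mulVec, mulVec_mulVec, hVc, hGdef,
      conjTranspose_map_ofReal₆, ← Matrix.map_mul, ← Matrix.map_mul]
  have hpos : ∀ y : Fin q → ℂ, y ≠ 0 → 0 < (star (Vc *ᵥ y) ⬝ᵥ (G *ᵥ (Vc *ᵥ y))).re := fun y hy ↦ by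
    rw [hform]; exact re_star_dotProduct_map_pos₆ hT hy
  -- the test subspace
  let f : EuclideanSpace ℂ (Fin q) →ₗ[ℂ] EuclideanSpace ℂ (Fin n) := toEuclideanLin Vc
  have hf : ∀ y : EuclideanSpace ℂ (Fin q), ofLp (f y) = Vc *ᵥ ofLp y := fun _ ↦ rfl
  have hinj : Function.Injective f := by
    intro y y' hyy'
    by_contra hne
    have hne' : ofLp (y - y') ≠ 0 := fun h ↦ hne (sub_eq_zero.1 (by
      have : y - y' = 0 := (WithLp.ofLp_eq_zero (p := 2)).1 h
      exact this))
    have h1 := hpos _ hne'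
    have h2 : Vc *ᵥ ofLp (y - y') = 0 := by rw [← hf, map_sub, hyy', sub_self]; rfl
    rw [h2, star_zero, zero_dotProduct, Complex.zero_re] at h1
    exact lt_irrefl _ h1
  have hdim : Module.finrank ℂ (LinearMap.range f) = q := by
    rw [LinearMap.finrank_range_of_inj hinj, finrank_euclideanSpace_fin]
  rw [← hdim]
  refine Literature.MathematicalPhysics.QuantumLattice.finrank_le_card_lt_eigenvalues hG _ fun x hx hx0 ↦ ?_
  obtain ⟨y, rfl⟩ := LinearMap.mem_range.1 hx
  have hy0 : ofLp y ≠ 0 := fun h ↦ hx0 (by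
    have : y = 0 := (WithLp.ofLp_eq_zero (p := 2)).1 h
    rw [this, map_zero])
  rw [zero_mul, EuclideanSpace.inner_eq_star_dotProduct, dotProduct_comm]
  show 0 < RCLike.re (star (ofLp (f y)) ⬝ᵥ (G *ᵥ ofLp (f y)))
  rw [hf, RCLike.re_to_complex]
  exact hpos _ hy0

/-- **Test table for the negative count of `G = (−P)ℂ`**: if `0 < zᵀ(UᵀPU)z` for every real `z ≠ 0`
(`U` real `n × m`) then `G` has at least `m` negative eigenvalues.
[cite: GolubVanLoan2013, §8.1.1 Thm 8.1.2 (Courant–Fischer Minimax Theorem)] -/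
private theorem le_card_eigenvalues_neg_of_test₆ {n m : ℕ} {P : Matrix (Fin n) (Fin n) ℝ}
    (hG : ((-P).map (algebraMap ℝ ℂ)).IsHermitian) {U : Matrix (Fin n) (Fin m) ℝ}
    (hU : ∀ z : Fin m → ℝ, z ≠ 0 → 0 < z ⬝ᵥ ((Uᵀ * P * U) *ᵥ z)) :
    m ≤ #{i | hG.eigenvalues i < 0} := by
  classical
  set G : Matrix (Fin n) (Fin n) ℂ := (-P).map (algebraMap ℝ ℂ) with hGdef
  set Uc : Matrix (Fin n) (Fin m) ℂ := U.map (algebraMap ℝ ℂ) with hUc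
  have hform : ∀ y : Fin m → ℂ, star (Uc *ᵥ y) ⬝ᵥ (G *ᵥ (Uc *ᵥ y))
      = -(star y ⬝ᵥ ((Uᵀ * P * U).map (algebraMap ℝ ℂ) *ᵥ y)) := fun y ↦ by
    rw [star_mulVec, ← dotProduct_mulVec, mulVec_mulVec, mulVec_mulVec, hUc, hGdef,
      conjTranspose_map_ofReal₆, ← Matrix.map_mul, ← Matrix.map_mul, Matrix.mul_neg, Matrix.neg_mul,
      Matrix.map_neg _ (map_neg (algebraMap ℝ ℂ)), neg_mulVec, dotProduct_neg]
  have hneg : ∀ y : Fin m → ℂ, y ≠ 0 → (star (Uc *ᵥ y) ⬝ᵥ (G *ᵥ (Uc *ᵥ y))).re < 0 := fun y hy ↦ by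
    rw [hform, Complex.neg_re, neg_lt_zero]; exact re_star_dotProduct_map_pos₆ hU hy
  let f : EuclideanSpace ℂ (Fin m) →ₗ[ℂ] EuclideanSpace ℂ (Fin n) := toEuclideanLin Uc
  have hf : ∀ y : EuclideanSpace ℂ (Fin m), ofLp (f y) = Uc *ᵥ ofLp y := fun _ ↦ rfl
  have hinj : Function.Injective f := by
    intro y y' hyy'
    by_contra hne
    have hne' : ofLp (y - y') ≠ 0 := fun h ↦ hne (sub_eq_zero.1 (by
      have : y - y' = 0 := (WithLp.ofLp_eq_zero (p := 2)).1 h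
      exact this))
    have h1 := hneg _ hne'
    have h2 : Uc *ᵥ ofLp (y - y') = 0 := by rw [← hf, map_sub, hyy', sub_self]; rfl
    rw [h2, star_zero, zero_dotProduct, Complex.zero_re] at h1
    exact lt_irrefl _ h1
  have hdim : Module.finrank ℂ (LinearMap.range f) = m := by
    rw [LinearMap.finrank_range_of_inj hinj, finrank_euclideanSpace_fin]
  rw [← hdim]
  refine Literature.MathematicalPhysics.QuantumLattice.finrank_le_card_eigenvalues_lt hG _ fun x hx hx0 ↦ ?_
  obtain ⟨y, rfl⟩ := LinearMap.mem_range.1 hx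
  have hy0 : ofLp y ≠ 0 := fun h ↦ hx0 (by
    have : y = 0 := (WithLp.ofLp_eq_zero (p := 2)).1 h
    rw [this, map_zero])
  rw [zero_mul, EuclideanSpace.inner_eq_star_dotProduct, dotProduct_comm]
  show RCLike.re (star (ofLp (f y)) ⬝ᵥ (G *ᵥ ofLp (f y))) < 0
  rw [hf, RCLike.re_to_complex]
  exact hneg _ hy0

/-- Trichotomy count on `Fin n`. [folklore] -/
private theorem card_trichotomy₆ {n : ℕ} (e : Fin n → ℝ) :
    #{i | 0 < e i} + #{i | e i < 0} + #{i | e i = 0} = n := by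
  have h1 : #{i | 0 < e i} + #({i | ¬ 0 < e i} : Finset (Fin n)) = n := by
    rw [Finset.card_filter_add_card_filter_not, Finset.card_univ, Fintype.card_fin]
  have h2 : #({i | ¬ 0 < e i} : Finset (Fin n)) = #{i | e i < 0} + #{i | e i = 0} := by
    rw [← Finset.card_union_of_disjoint]
    · congr 1
      ext i
      simp only [Finset.mem_filter, Finset.mem_univ, true_and, Finset.mem_union, not_lt]
      constructor
      · intro h; exact h.lt_or_eq
      · rintro (h | h); exact h.le; exact h.le
    · rw [Finset.disjoint_filter]
      intro i _ h1 h2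
      rw [h2] at h1; exact lt_irrefl _ h1
  omega

/-! #### Part J. Soundness of the inertia leaves -/

/-- Points of a box are within the half-widths of the centre. [folklore] -/
private theorem abs_sub_centre_le₆ {K : ℕ} {B : Box} {x : ℕ → ℝ} (hx : B.mem x) (k : Fin K) :
    |x k - vreal (boxCentreList K B) k| ≤ vreal (boxHalfList K B) k := by
  rw [show vreal (boxCentreList K B) k = ((((B.ivl k).1 + (B.ivl k).2) / 2 : ℚ) : ℝ) from
      vreal_vtab₆ _ k.isLt,
    show vreal (boxHalfList K B) k = ((((B.ivl k).2 - (B.ivl k).1) / 2 : ℚ) : ℝ) from vreal_vtab₆ _ k.isLt]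
  push_cast
  have := (hx k).1; have := (hx k).2
  exact abs_le.2 ⟨by linarith, by linarith⟩

/-- **Test-table form bound** read from a passing `checkLower` of the centred interval family of the
congruent tables `WᵀP_iW` (`W` an `n × m` table): `κ·zᵀz ≤ zᵀ(WᵀP(δ)W)z` on the leaf.
[cite: Hladik2017, §3] -/
private theorem cong_form_bound₆ {n m L K : ℕ} {alphas : List (List ℕ)} {Ps : List (List (List ℚ))}
    {W : List (List ℚ)} {w : List ℚ} {c : LDLCert}
    (h : checkLower m (centreTab m L K alphas (vtab L fun i ↦ congTab n m W (Ps.getD i [])))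
      (radTab m L K alphas (vtab L fun i ↦ congTab n m W (Ps.getD i [])) w) c = true)
    {δ : Fin K → ℝ} (hδ : ∀ k : Fin K, |δ k| ≤ vreal w k) (z : Fin m → ℝ) :
    (c.lam : ℝ) * (z ⬝ᵥ z)
      ≤ z ⬝ᵥ (((finMatRect n m W)ᵀ * polyTabR n L K alphas Ps δ * finMatRect n m W) *ᵥ z) := by
  rw [← polyTabR_congTabs₆]
  exact mul_dotProduct_le_of_checkLower h (abs_polyTabR_sub_centre_le _ _ _ _ _ hδ) z

/-- The same for the NEGATED family: `κ·zᵀz ≤ −zᵀ(WᵀP(δ)W)z` on the leaf. [cite: Hladik2017, §3] -/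
private theorem cong_form_bound_neg₆ {n m L K : ℕ} {alphas : List (List ℕ)} {Ps : List (List (List ℚ))}
    {W : List (List ℚ)} {w : List ℚ} {c : LDLCert}
    (h : checkLower m (negTab m (centreTab m L K alphas (vtab L fun i ↦ congTab n m W (Ps.getD i []))))
      (radTab m L K alphas (vtab L fun i ↦ congTab n m W (Ps.getD i [])) w) c = true)
    {δ : Fin K → ℝ} (hδ : ∀ k : Fin K, |δ k| ≤ vreal w k) (z : Fin m → ℝ) :
    (c.lam : ℝ) * (z ⬝ᵥ z)
      ≤ -(z ⬝ᵥ (((finMatRect n m W)ᵀ * polyTabR n L K alphas Ps δ * finMatRect n m W) *ᵥ z)) := by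
  set Ts := vtab L fun i ↦ congTab n m W (Ps.getD i []) with hTs
  have hencl : ∀ a b : Fin m, |(-polyTabR m L K alphas Ts δ) a b - mreal (negTab m (centreTab m L K alphas Ts)) a b|
      ≤ mreal (radTab m L K alphas Ts w) a b := fun a b ↦ by
    rw [Matrix.neg_apply, mreal_negTab₆, ← abs_neg]
    have := abs_polyTabR_sub_centre_le m L K alphas Ts hδ a b
    convert this using 2; ring
  have h1 := mul_dotProduct_le_of_checkLower h hencl z
  rw [Matrix.neg_mulVec, dotProduct_neg, hTs, polyTabR_congTabs₆] at h1
  exact h1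

/-- The complexified `−P(δ)` of an inertia leaf is Hermitian (all `P_i` symmetric). [folklore] -/
private theorem isHermitian_negP₆ {n K : ℕ} {J0 : List (List ℚ)} {Js : List (List (List ℚ))} {q : ℕ}
    {B : Box} {l : LyapInertiaLeaf} (h : lyapInertiaLeafLB n K J0 Js q B l = true) (δ : Fin K → ℝ) :
    ((-polyTabR n l.Ps.length K l.alphas l.Ps δ).map (algebraMap ℝ ℂ)).IsHermitian := by
  unfold lyapInertiaLeafLB at h
  simp only [Bool.and_eq_true] at h
  exact isHermitian_map_ofReal₆ (isHermitian_polyTabR h.1.1.1.1.1 δ).neg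

/-- **Per leaf, the common core.** From the lower-bound check at a point `x` of the leaf, with
`A = J(x)ℂ`, `P = P(x − c)` and `G = (−P)ℂ`: `AᴴG + GA ≻ O`, and `G` has at least `q` positive eigenvalues.
[cite: CarlsonSchneider1962, § 1; GolubVanLoan2013, §8.1.1 Thm 8.1.2 (Courant–Fischer Minimax Theorem); Hladik2017, §3] -/
private theorem inertiaCore₆ {n K : ℕ} {J0 : List (List ℚ)} {Js : List (List (List ℚ))} {q : ℕ}
    {B : Box} {l : LyapInertiaLeaf} (h : lyapInertiaLeafLB n K J0 Js q B l = true) (x : ℕ → ℝ)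
    (hx : B.mem x) {δ : Fin K → ℝ} (hδ : δ = fun k : Fin K ↦ x k - vreal (boxCentreList K B) k) :
    (((finMat n J0 + paramMatrix (fun k : Fin K ↦ finMat n (Js.getD k [])) (fun k : Fin K ↦ x k)).map
            (algebraMap ℝ ℂ))ᴴ * (-polyTabR n l.Ps.length K l.alphas l.Ps δ).map (algebraMap ℝ ℂ)
        + (-polyTabR n l.Ps.length K l.alphas l.Ps δ).map (algebraMap ℝ ℂ)
          * (finMat n J0 + paramMatrix (fun k : Fin K ↦ finMat n (Js.getD k [])) (fun k : Fin K ↦ x k)).map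
            (algebraMap ℝ ℂ)).PosDef ∧
      q ≤ #{i | 0 < (isHermitian_negP₆ h δ).eigenvalues i} := by
  have hG := isHermitian_negP₆ h δ
  subst hδ
  have h' := h
  unfold lyapInertiaLeafLB coverIdx at h'
  simp only [Bool.and_eq_true, decide_eq_true_eq] at h'
  obtain ⟨⟨⟨⟨⟨hsym, hcovA, hcovB⟩, hm⟩, hcQ⟩, hκ⟩, hcV⟩ := h'
  -- abbreviations
  set L : ℕ := l.Ps.length with hL
  set M : ℕ := l.betas.length with hM
  set cL : List ℚ := boxCentreList K B with hcL
  set wL : List ℚ := boxHalfList K B with hwL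
  set δ : Fin K → ℝ := fun k ↦ x k - vreal cL k with hδdef
  have hδabs : ∀ k : Fin K, |δ k| ≤ vreal wL k := fun k ↦ abs_sub_centre_le₆ hx k
  have hxsplit : (fun k : Fin K ↦ x k) = fun k : Fin K ↦ vreal cL k + δ k :=
    funext fun k ↦ by show x k = vreal cL k + (x k - vreal cL k); ring
  set Jf : Fin K → Matrix (Fin n) (Fin n) ℝ := fun k ↦ finMat n (Js.getD k []) with hJf
  set J : Matrix (Fin n) (Fin n) ℝ := finMat n J0 + paramMatrix Jf (fun k : Fin K ↦ x k) with hJ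
  set Jc : Matrix (Fin n) (Fin n) ℝ := finMat n (affineAtQ n K J0 Js cL) with hJc
  have hJsplit : J = Jc + paramMatrix Jf δ := by
    rw [hJ, hJc, finMat_affineAtQ₆, add_assoc, ← paramMatrix_add_param₆, ← hxsplit]
  set P : Matrix (Fin n) (Fin n) ℝ := polyTabR n L K l.alphas l.Ps δ with hP
  -- the regrouped tables: fast = plain on the block, and they tabulate the Lyapunov form
  set Qs := lyapTayQTabs n K L M (affineAtQ n K J0 Js cL) Js l.Ps
    (fun i ↦ posOf K l.betas (l.alphas.getD i []))
    (fun k i ↦ posOf K l.betas (bumpIdx K (l.alphas.getD i []) k)) with hQs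
  have hc := centreTab_congr₆ (n := n) (N := M) (K := K) l.betas
    (fun j hj a ha b hb ↦ mget_lyapTayQTabsF (K := K) (L := L) (M := M)
      (affineAtQ n K J0 Js cL) Js l.Ps l.alphas l.betas hj ha hb)
  have hr := radTab_congr₆ (n := n) (N := M) (K := K) l.betas wL
    (fun j hj a ha b hb ↦ mget_lyapTayQTabsF (K := K) (L := L) (M := M)
      (affineAtQ n K J0 Js cL) Js l.Ps l.alphas l.betas hj ha hb)
  rw [hc, hr] at hcQ
  have hcovA' : ∀ i : Fin L, posOf K l.betas (l.alphas.getD i []) < M := fun i ↦ by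
    have := of_rall hcovA i.isLt; rwa [decide_eq_true_eq] at this
  have hcovB' : ∀ (k : Fin K) (i : Fin L), posOf K l.betas (bumpIdx K (l.alphas.getD i []) k) < M :=
    fun k i ↦ by
      have := of_rall (of_rall hcovB k.isLt) i.isLt; rwa [decide_eq_true_eq] at this
  have hQeq : polyTabR n M K l.betas Qs δ = lyapRm₆ J P := by
    rw [hQs, hJsplit, hJc, hP]
    exact polyTabR_Q_eq _ _ _ _ _ hcovA' hcovB' hM δ
  -- the Lyapunov form `W = Jᵀ(−P) + (−P)J = −(JᵀP + PJ)` is positive on non-zero real vectors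
  have hmpos : (0 : ℝ) < l.cQ.lam := by exact_mod_cast hm
  have hWform : ∀ y : Fin n → ℝ, y ≠ 0 → 0 < y ⬝ᵥ ((Jᵀ * (-P) + (-P) * J) *ᵥ y) := by
    intro y hy
    have h1 := mul_dotProduct_le_of_checkLower hcQ (A := polyTabR n M K l.betas Qs δ)
      (abs_polyTabR_sub_centre_le n M K l.betas Qs hδabs) y
    rw [hQeq] at h1
    unfold lyapRm₆ at h1
    have h2 : Jᵀ * (-P) + (-P) * J = -(Jᵀ * P + P * J) := by
      rw [Matrix.mul_neg, Matrix.neg_mul, neg_add]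
    rw [h2]
    exact lt_of_lt_of_le (mul_pos hmpos (dotProduct_self_pos_of_ne_zero₆ hy)) h1
  -- symmetry of `P` and of `W`
  have hPherm : P.IsHermitian := isHermitian_polyTabR hsym δ
  have hPT : Pᵀ = P := by
    have := hPherm.eq; rwa [conjTranspose_eq_transpose_of_trivial] at this
  have hWherm : (Jᵀ * (-P) + (-P) * J).IsHermitian := by
    show (Jᵀ * (-P) + (-P) * J)ᴴ = Jᵀ * (-P) + (-P) * J
    rw [conjTranspose_eq_transpose_of_trivial, transpose_add, transpose_mul, transpose_mul,
      transpose_transpose, transpose_neg, hPT, add_comm]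
  -- complexify
  have hW : ((J.map (algebraMap ℝ ℂ))ᴴ * (-P).map (algebraMap ℝ ℂ)
      + (-P).map (algebraMap ℝ ℂ) * J.map (algebraMap ℝ ℂ)).PosDef := by
    rw [conjTranspose_map_ofReal₆, ← Matrix.map_mul, ← Matrix.map_mul,
      ← Matrix.map_add _ (map_add (algebraMap ℝ ℂ))]
    exact posDef_map_ofReal₆ hWherm hWform
  -- the negative test table
  have hκpos : (0 : ℝ) < l.cV.lam := by exact_mod_cast hκ
  have hV : ∀ z : Fin q → ℝ, z ≠ 0 → z ⬝ᵥ (((finMatRect n q l.V)ᵀ * P * finMatRect n q l.V) *ᵥ z) < 0 :=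
    fun z hz ↦ by
      have h1 := cong_form_bound_neg₆ (n := n) (m := q) (L := L) (K := K) (alphas := l.alphas)
        (Ps := l.Ps) (W := l.V) hcV hδabs z
      have h2 := mul_pos hκpos (dotProduct_self_pos_of_ne_zero₆ hz)
      linarith
  exact ⟨hW, le_card_eigenvalues_pos_of_test₆ hG hV⟩

/-- **Per leaf, lower-bound form**: an accepted `V`-only inertia leaf proves, at every point `x` of the
leaf box, that the characteristic polynomial of `J(x)` over `ℂ` has AT LEAST `q` roots (with multiplicity)
with `Re > 0` and NONE with `Re = 0`.
[cite: CarlsonSchneider1962, § 1; GolubVanLoan2013, §8.1.1 Thm 8.1.2 (Courant–Fischer Minimax Theorem)] -/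
theorem le_countP_re_pos_of_lyapInertiaLeafLB {n K : ℕ} {J0 : List (List ℚ)} {Js : List (List (List ℚ))}
    {q : ℕ} {B : Box} {l : LyapInertiaLeaf} (h : lyapInertiaLeafLB n K J0 Js q B l = true)
    (x : ℕ → ℝ) (hx : B.mem x) :
    q ≤ ((finMat n J0 + paramMatrix (fun k : Fin K ↦ finMat n (Js.getD k [])) (fun k : Fin K ↦ x k)).map
        (algebraMap ℝ ℂ)).charpoly.roots.countP (fun μ ↦ 0 < μ.re) ∧
      ((finMat n J0 + paramMatrix (fun k : Fin K ↦ finMat n (Js.getD k [])) (fun k : Fin K ↦ x k)).map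
        (algebraMap ℝ ℂ)).charpoly.roots.countP (fun μ ↦ μ.re = 0) = 0 := by
  obtain ⟨hW, hq⟩ := inertiaCore₆ h x hx (δ := fun k : Fin K ↦ x k - vreal (boxCentreList K B) k) rfl
  obtain ⟨hpos, -, -⟩ := card_eigenvalues_eq_of_lyapunov_posDef
    (isHermitian_negP₆ h fun k : Fin K ↦ x k - vreal (boxCentreList K B) k) hW
  refine ⟨?_, countP_re_eq_zero_of_lyapunov_posDef hW⟩
  rw [← hpos]; exact hq

/-- **Per leaf, exact form**: an accepted inertia leaf proves, at every point `x` of the leaf box, that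
the characteristic polynomial of `J(x)` over `ℂ` has EXACTLY `q` roots with `Re > 0`, exactly `n − q`
with `Re < 0` and none with `Re = 0` (all with multiplicity).
[cite: CarlsonSchneider1962, § 1; GolubVanLoan2013, §8.1.1 Thm 8.1.2 (Courant–Fischer Minimax Theorem)] -/
theorem countP_re_of_lyapInertiaLeafOK {n K : ℕ} {J0 : List (List ℚ)} {Js : List (List (List ℚ))}
    {q : ℕ} {B : Box} {l : LyapInertiaLeaf} (h : lyapInertiaLeafOK n K J0 Js q B l = true)
    (x : ℕ → ℝ) (hx : B.mem x) :
    ((finMat n J0 + paramMatrix (fun k : Fin K ↦ finMat n (Js.getD k [])) (fun k : Fin K ↦ x k)).map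
        (algebraMap ℝ ℂ)).charpoly.roots.countP (fun μ ↦ 0 < μ.re) = q ∧
      ((finMat n J0 + paramMatrix (fun k : Fin K ↦ finMat n (Js.getD k [])) (fun k : Fin K ↦ x k)).map
        (algebraMap ℝ ℂ)).charpoly.roots.countP (fun μ ↦ μ.re < 0) = n - q ∧
      ((finMat n J0 + paramMatrix (fun k : Fin K ↦ finMat n (Js.getD k [])) (fun k : Fin K ↦ x k)).map
        (algebraMap ℝ ℂ)).charpoly.roots.countP (fun μ ↦ μ.re = 0) = 0 := by
  have h' := h
  unfold lyapInertiaLeafOK at h'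
  simp only [Bool.and_eq_true, decide_eq_true_eq] at h'
  obtain ⟨⟨hLB, hκU⟩, hcU⟩ := h'
  obtain ⟨hW, hq⟩ := inertiaCore₆ hLB x hx (δ := fun k : Fin K ↦ x k - vreal (boxCentreList K B) k) rfl
  have hG := isHermitian_negP₆ hLB (fun k : Fin K ↦ x k - vreal (boxCentreList K B) k)
  -- the positive test table
  have hδabs : ∀ k : Fin K, |x k - vreal (boxCentreList K B) k| ≤ vreal (boxHalfList K B) k :=
    fun k ↦ abs_sub_centre_le₆ hx k
  have hκUpos : (0 : ℝ) < l.cU.lam := by exact_mod_cast hκU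
  have hU : ∀ z : Fin (n - q) → ℝ, z ≠ 0 → 0 < z ⬝ᵥ (((finMatRect n (n - q) l.U)ᵀ
      * polyTabR n l.Ps.length K l.alphas l.Ps (fun k : Fin K ↦ x k - vreal (boxCentreList K B) k)
      * finMatRect n (n - q) l.U) *ᵥ z) := fun z hz ↦
    lt_of_lt_of_le (mul_pos hκUpos (dotProduct_self_pos_of_ne_zero₆ hz))
      (cong_form_bound₆ (n := n) (m := n - q) (K := K) (alphas := l.alphas) (Ps := l.Ps) (W := l.U)
        hcU hδabs z)
  have hnq := le_card_eigenvalues_neg_of_test₆ hG hU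
  obtain ⟨hpos, hneg, hzero⟩ := card_eigenvalues_eq_of_lyapunov_posDef hG hW
  have htri := card_trichotomy₆ hG.eigenvalues
  refine ⟨?_, ?_, countP_re_eq_zero_of_lyapunov_posDef hW⟩
  · rw [← hpos]; omega
  · rw [← hneg]; omega

/-- **Inertia certificate, box level, lower-bound form (END-TO-END).** If a kd-tree of `V`-only
inertia leaves passes on the box `B`, then at EVERY point `x` of `B` the characteristic polynomial of
`J(x) = J₀ + Σ_k x_k J^{(k)}` over `ℂ` has at least `q` roots with `Re > 0` and none with `Re = 0`.
[cite: CarlsonSchneider1962, § 1; GolubVanLoan2013, §8.1.1 Thm 8.1.2 (Courant–Fischer Minimax Theorem)] -/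
theorem le_countP_re_pos_of_kdCheck_lyapInertiaLB {n K : ℕ} {J0 : List (List ℚ)}
    {Js : List (List (List ℚ))} {q : ℕ} {B : Box} {t : KdCert LyapInertiaLeaf}
    (h : t.check (lyapInertiaLeafLB n K J0 Js q) B = true) (x : ℕ → ℝ) (hx : B.mem x) :
    q ≤ ((finMat n J0 + paramMatrix (fun k : Fin K ↦ finMat n (Js.getD k [])) (fun k : Fin K ↦ x k)).map
        (algebraMap ℝ ℂ)).charpoly.roots.countP (fun μ ↦ 0 < μ.re) ∧
      ((finMat n J0 + paramMatrix (fun k : Fin K ↦ finMat n (Js.getD k [])) (fun k : Fin K ↦ x k)).map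
        (algebraMap ℝ ℂ)).charpoly.roots.countP (fun μ ↦ μ.re = 0) = 0 :=
  KdCert.sound (P := fun x ↦
      q ≤ ((finMat n J0 + paramMatrix (fun k : Fin K ↦ finMat n (Js.getD k [])) (fun k : Fin K ↦ x k)).map
        (algebraMap ℝ ℂ)).charpoly.roots.countP (fun μ ↦ 0 < μ.re) ∧
      ((finMat n J0 + paramMatrix (fun k : Fin K ↦ finMat n (Js.getD k [])) (fun k : Fin K ↦ x k)).map
        (algebraMap ℝ ℂ)).charpoly.roots.countP (fun μ ↦ μ.re = 0) = 0)
    (fun _ _ hl x hx ↦ le_countP_re_pos_of_lyapInertiaLeafLB hl x hx) t B h x hx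

/-- **CERTIFIED INSTABILITY on a box**: a passing `V`-only inertia tree with `0 < q` gives, at every
point `x` of `B`, an eigenvalue `μ` of `J(x)` with `Re μ > 0`. [cite: CarlsonSchneider1962, § 1] -/
theorem exists_re_pos_of_kdCheck_lyapInertiaLB {n K : ℕ} {J0 : List (List ℚ)}
    {Js : List (List (List ℚ))} {q : ℕ} (hq : 0 < q) {B : Box} {t : KdCert LyapInertiaLeaf}
    (h : t.check (lyapInertiaLeafLB n K J0 Js q) B = true) (x : ℕ → ℝ) (hx : B.mem x) :
    ∃ μ ∈ spectrum ℂ ((finMat n J0 + paramMatrix (fun k : Fin K ↦ finMat n (Js.getD k []))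
      (fun k : Fin K ↦ x k)).map (algebraMap ℝ ℂ)), 0 < μ.re := by
  obtain ⟨h1, -⟩ := le_countP_re_pos_of_kdCheck_lyapInertiaLB h x hx
  obtain ⟨μ, hμ, hre⟩ := Multiset.countP_pos.1 (lt_of_lt_of_le hq h1)
  exact ⟨μ, (Matrix.mem_spectrum_iff_isRoot_charpoly).2 ((Polynomial.mem_roots (charpoly_monic _).ne_zero).1 hμ), hre⟩

/-- **Inertia certificate, box level, exact form (END-TO-END).** If a kd-tree of inertia leaves passes
on the box `B`, then at EVERY point `x` of `B` the characteristic polynomial of `J(x)` over `ℂ` has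
exactly `q` roots with `Re > 0`, exactly `n − q` with `Re < 0`, and none with `Re = 0`.
[cite: CarlsonSchneider1962, § 1; GolubVanLoan2013, §8.1.1 Thm 8.1.2 (Courant–Fischer Minimax Theorem)] -/
theorem countP_re_of_kdCheck_lyapInertia {n K : ℕ} {J0 : List (List ℚ)}
    {Js : List (List (List ℚ))} {q : ℕ} {B : Box} {t : KdCert LyapInertiaLeaf}
    (h : t.check (lyapInertiaLeafOK n K J0 Js q) B = true) (x : ℕ → ℝ) (hx : B.mem x) :
    ((finMat n J0 + paramMatrix (fun k : Fin K ↦ finMat n (Js.getD k [])) (fun k : Fin K ↦ x k)).map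
        (algebraMap ℝ ℂ)).charpoly.roots.countP (fun μ ↦ 0 < μ.re) = q ∧
      ((finMat n J0 + paramMatrix (fun k : Fin K ↦ finMat n (Js.getD k [])) (fun k : Fin K ↦ x k)).map
        (algebraMap ℝ ℂ)).charpoly.roots.countP (fun μ ↦ μ.re < 0) = n - q ∧
      ((finMat n J0 + paramMatrix (fun k : Fin K ↦ finMat n (Js.getD k [])) (fun k : Fin K ↦ x k)).map
        (algebraMap ℝ ℂ)).charpoly.roots.countP (fun μ ↦ μ.re = 0) = 0 :=
  KdCert.sound (P := fun x ↦
      ((finMat n J0 + paramMatrix (fun k : Fin K ↦ finMat n (Js.getD k [])) (fun k : Fin K ↦ x k)).map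
        (algebraMap ℝ ℂ)).charpoly.roots.countP (fun μ ↦ 0 < μ.re) = q ∧
      ((finMat n J0 + paramMatrix (fun k : Fin K ↦ finMat n (Js.getD k [])) (fun k : Fin K ↦ x k)).map
        (algebraMap ℝ ℂ)).charpoly.roots.countP (fun μ ↦ μ.re < 0) = n - q ∧
      ((finMat n J0 + paramMatrix (fun k : Fin K ↦ finMat n (Js.getD k [])) (fun k : Fin K ↦ x k)).map
        (algebraMap ℝ ℂ)).charpoly.roots.countP (fun μ ↦ μ.re = 0) = 0)
    (fun _ _ hl x hx ↦ countP_re_of_lyapInertiaLeafOK hl x hx) t B h x hx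

/-! #### Part K. Shifted and balanced inertia certificates (counts about the line `Re = −s`) -/

/-- `(M + s·1)ℂ = s + Mℂ` in the algebra `Matrix (Fin n) (Fin n) ℂ`. [folklore] -/
private theorem map_add_smul_one₆ {n : ℕ} (M : Matrix (Fin n) (Fin n) ℝ) (s : ℚ) :
    (M + (s : ℝ) • (1 : Matrix (Fin n) (Fin n) ℝ)).map (algebraMap ℝ ℂ)
      = algebraMap ℂ (Matrix (Fin n) (Fin n) ℂ) (s : ℂ) + M.map (algebraMap ℝ ℂ) := by
  rw [Matrix.map_add (algebraMap ℝ ℂ) (map_add _), Algebra.algebraMap_eq_smul_one, add_comm]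
  congr 1
  ext i j
  simp only [Matrix.map_apply, Matrix.smul_apply, Matrix.one_apply, smul_eq_mul, mul_ite, mul_one,
    mul_zero]
  split_ifs <;> simp [Complex.coe_algebraMap]

/-- **Spectral shift for existence**: a root of the characteristic polynomial of `(M + s·1)ℂ` with
`Re > 0` gives an eigenvalue of `Mℂ` with `Re > −s`. [folklore] -/
private theorem exists_re_gt_neg_of_countP_shift₆ {n : ℕ} {M : Matrix (Fin n) (Fin n) ℝ} {s : ℚ} {q : ℕ}
    (hq : 0 < q)
    (h : q ≤ ((M + (s : ℝ) • (1 : Matrix (Fin n) (Fin n) ℝ)).map (algebraMap ℝ ℂ)).charpoly.roots.countP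
      (fun μ ↦ 0 < μ.re)) :
    ∃ μ ∈ spectrum ℂ (M.map (algebraMap ℝ ℂ)), -(s : ℝ) < μ.re := by
  obtain ⟨ν, hν, hre⟩ := Multiset.countP_pos.1 (lt_of_lt_of_le hq h)
  have hν' : ν ∈ spectrum ℂ ((M + (s : ℝ) • (1 : Matrix (Fin n) (Fin n) ℝ)).map (algebraMap ℝ ℂ)) :=
    (Matrix.mem_spectrum_iff_isRoot_charpoly).2 ((Polynomial.mem_roots (charpoly_monic _).ne_zero).1 hν)
  rw [map_add_smul_one₆, ← spectrum.singleton_add_eq] at hν'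
  obtain ⟨a, ha, μ, hμ, hsum⟩ := Set.mem_add.1 hν'
  rw [Set.mem_singleton_iff] at ha
  refine ⟨μ, hμ, ?_⟩
  have : ν.re = (s : ℝ) + μ.re := by rw [← hsum, ha, Complex.add_re, Complex.ratCast_re]
  linarith

/-- **Positive diagonal similarity preserves the characteristic polynomial** (complexified real
matrices). [folklore] -/
private theorem charpoly_conjDiag₆ {n : ℕ} {d : List ℚ} (hd : posListQ n d = true)
    (M : Matrix (Fin n) (Fin n) ℝ) :
    ((Matrix.diagonal (fun i : Fin n ↦ (vreal d i)) * M
      * Matrix.diagonal (fun i : Fin n ↦ (vreal d i)⁻¹)).map (algebraMap ℝ ℂ)).charpoly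
      = (M.map (algebraMap ℝ ℂ)).charpoly := by
  have hdpos : ∀ i : Fin n, (0 : ℝ) < vreal d i := fun i ↦ by
    have := of_rall hd i.isLt; rw [decide_eq_true_eq] at this
    unfold vreal; exact_mod_cast this
  let dc : Fin n → ℂ := fun i ↦ ((vreal d i : ℝ) : ℂ)
  have hdc : ∀ i, dc i ≠ 0 := fun i ↦ by
    simp only [dc, ne_eq, Complex.ofReal_eq_zero]; exact (hdpos i).ne'
  let u : (Matrix (Fin n) (Fin n) ℂ)ˣ :=
    ⟨Matrix.diagonal dc, Matrix.diagonal fun i ↦ (dc i)⁻¹,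
      by rw [Matrix.diagonal_mul_diagonal]; convert Matrix.diagonal_one with i; exact mul_inv_cancel₀ (hdc i),
      by rw [Matrix.diagonal_mul_diagonal]; convert Matrix.diagonal_one with i; exact inv_mul_cancel₀ (hdc i)⟩
  have hconj : (Matrix.diagonal (fun i : Fin n ↦ (vreal d i)) * M
        * Matrix.diagonal (fun i : Fin n ↦ (vreal d i)⁻¹)).map (algebraMap ℝ ℂ)
      = (u : Matrix (Fin n) (Fin n) ℂ) * M.map (algebraMap ℝ ℂ) * (u⁻¹ : (Matrix (Fin n) (Fin n) ℂ)ˣ) := by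
    rw [Matrix.map_mul, Matrix.map_mul]
    have e1 : (Matrix.diagonal fun i : Fin n ↦ vreal d i).map (algebraMap ℝ ℂ) = Matrix.diagonal dc :=
      Matrix.diagonal_map (map_zero _)
    have e2 : (Matrix.diagonal fun i : Fin n ↦ (vreal d i)⁻¹).map (algebraMap ℝ ℂ)
        = Matrix.diagonal fun i ↦ (dc i)⁻¹ := by
      rw [Matrix.diagonal_map (map_zero _)]
      congr 1; funext i; simp [dc, Complex.coe_algebraMap]
    rw [e1, e2]; rfl
  rw [hconj, Matrix.coe_units_inv]
  exact Matrix.charpoly_units_conj u _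

/-- `D M D⁻¹ + s·1 = D (M + s·1) D⁻¹` for a positive diagonal `D`. [folklore] -/
private theorem conjDiag_add_smul_one₆ {n : ℕ} {d : List ℚ} (hd : posListQ n d = true)
    (M : Matrix (Fin n) (Fin n) ℝ) (s : ℝ) :
    Matrix.diagonal (fun i : Fin n ↦ (vreal d i)) * M * Matrix.diagonal (fun i : Fin n ↦ (vreal d i)⁻¹)
        + s • (1 : Matrix (Fin n) (Fin n) ℝ)
      = Matrix.diagonal (fun i : Fin n ↦ (vreal d i)) * (M + s • (1 : Matrix (Fin n) (Fin n) ℝ))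
        * Matrix.diagonal (fun i : Fin n ↦ (vreal d i)⁻¹) := by
  have hdpos : ∀ i : Fin n, (0 : ℝ) < vreal d i := fun i ↦ by
    have := of_rall hd i.isLt; rw [decide_eq_true_eq] at this
    unfold vreal; exact_mod_cast this
  have hDD : Matrix.diagonal (fun i : Fin n ↦ (vreal d i)) * Matrix.diagonal (fun i : Fin n ↦ (vreal d i)⁻¹)
      = 1 := by
    rw [Matrix.diagonal_mul_diagonal, ← Matrix.diagonal_one]
    congr 1; funext i; exact mul_inv_cancel₀ (hdpos i).ne'
  rw [Matrix.mul_add, Matrix.add_mul, Matrix.mul_smul, Matrix.smul_mul, Matrix.mul_one, hDD]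

/-- The characteristic polynomial of the balanced + shifted family member is that of `J(x) + s·1`.
[folklore] -/
private theorem charpoly_conj_shifted_family₆ {n K : ℕ} {d : List ℚ} (hd : posListQ n d = true)
    (J0 : List (List ℚ)) (Js : List (List (List ℚ))) (s : ℚ) (x : ℕ → ℝ) :
    ((finMat n (addDiagTab n s (conjDiagTab n d J0))
        + paramMatrix (fun k : Fin K ↦ finMat n ((vtab K fun k ↦ conjDiagTab n d (Js.getD k [])).getD k []))
          (fun k : Fin K ↦ x k)).map (algebraMap ℝ ℂ)).charpoly
      = ((finMat n J0 + paramMatrix (fun k : Fin K ↦ finMat n (Js.getD k [])) (fun k : Fin K ↦ x k)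
          + (s : ℝ) • (1 : Matrix (Fin n) (Fin n) ℝ)).map (algebraMap ℝ ℂ)).charpoly := by
  rw [finMat_addDiagTab₆, add_right_comm, affine_conjDiagTab_eq₆, conjDiag_add_smul_one₆ hd,
    charpoly_conjDiag₆ hd]

/-- **Balanced + shifted inertia certificate, exact form (END-TO-END) ⇒ counts about the line
`Re = −s` for the ORIGINAL family.** If all scaling factors are positive and the kd-tree of inertia
leaves checks for the tables `(D J₀ D⁻¹ + s·1, D J^{(k)} D⁻¹)` with claim `q`, then for every `x` in the
box the characteristic polynomial of `J(x) + s·1` over `ℂ` has exactly `q` roots with `Re > 0`, exactly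
`n − q` with `Re < 0` and none with `Re = 0` — `J(x)` has exactly `q` eigenvalues (with multiplicity) to
the right of the line `Re = −s`, `n − q` to the left, none on it.
[cite: CarlsonSchneider1962, § 1; GolubVanLoan2013, §8.1.1 Thm 8.1.2 (Courant–Fischer Minimax Theorem)] -/
theorem countP_re_of_kdCheck_lyapInertia_conj_shifted {n K : ℕ} {J0 : List (List ℚ)}
    {Js : List (List (List ℚ))} {d : List ℚ} {s : ℚ} {q : ℕ} {B : Box} {t : KdCert LyapInertiaLeaf}
    (hd : posListQ n d = true)
    (h : t.check (lyapInertiaLeafOK n K (addDiagTab n s (conjDiagTab n d J0))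
      (vtab K fun k ↦ conjDiagTab n d (Js.getD k [])) q) B = true)
    (x : ℕ → ℝ) (hx : B.mem x) :
    ((finMat n J0 + paramMatrix (fun k : Fin K ↦ finMat n (Js.getD k [])) (fun k : Fin K ↦ x k)
        + (s : ℝ) • (1 : Matrix (Fin n) (Fin n) ℝ)).map (algebraMap ℝ ℂ)).charpoly.roots.countP
        (fun μ ↦ 0 < μ.re) = q ∧
      ((finMat n J0 + paramMatrix (fun k : Fin K ↦ finMat n (Js.getD k [])) (fun k : Fin K ↦ x k)
        + (s : ℝ) • (1 : Matrix (Fin n) (Fin n) ℝ)).map (algebraMap ℝ ℂ)).charpoly.roots.countP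
        (fun μ ↦ μ.re < 0) = n - q ∧
      ((finMat n J0 + paramMatrix (fun k : Fin K ↦ finMat n (Js.getD k [])) (fun k : Fin K ↦ x k)
        + (s : ℝ) • (1 : Matrix (Fin n) (Fin n) ℝ)).map (algebraMap ℝ ℂ)).charpoly.roots.countP
        (fun μ ↦ μ.re = 0) = 0 := by
  rw [← charpoly_conj_shifted_family₆ hd J0 Js s x]
  exact countP_re_of_kdCheck_lyapInertia h x hx

/-- **Balanced + shifted inertia certificate, lower-bound form (END-TO-END)**: with `V`-only leaves
for the tables `(D J₀ D⁻¹ + s·1, D J^{(k)} D⁻¹)` and claim `q`, for every `x` in the box `J(x) + s·1`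
has at least `q` characteristic roots with `Re > 0` and none with `Re = 0`.
[cite: CarlsonSchneider1962, § 1; GolubVanLoan2013, §8.1.1 Thm 8.1.2 (Courant–Fischer Minimax Theorem)] -/
theorem le_countP_re_pos_of_kdCheck_lyapInertiaLB_conj_shifted {n K : ℕ} {J0 : List (List ℚ)}
    {Js : List (List (List ℚ))} {d : List ℚ} {s : ℚ} {q : ℕ} {B : Box} {t : KdCert LyapInertiaLeaf}
    (hd : posListQ n d = true)
    (h : t.check (lyapInertiaLeafLB n K (addDiagTab n s (conjDiagTab n d J0))
      (vtab K fun k ↦ conjDiagTab n d (Js.getD k [])) q) B = true)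
    (x : ℕ → ℝ) (hx : B.mem x) :
    q ≤ ((finMat n J0 + paramMatrix (fun k : Fin K ↦ finMat n (Js.getD k [])) (fun k : Fin K ↦ x k)
        + (s : ℝ) • (1 : Matrix (Fin n) (Fin n) ℝ)).map (algebraMap ℝ ℂ)).charpoly.roots.countP
        (fun μ ↦ 0 < μ.re) ∧
      ((finMat n J0 + paramMatrix (fun k : Fin K ↦ finMat n (Js.getD k [])) (fun k : Fin K ↦ x k)
        + (s : ℝ) • (1 : Matrix (Fin n) (Fin n) ℝ)).map (algebraMap ℝ ℂ)).charpoly.roots.countP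
        (fun μ ↦ μ.re = 0) = 0 := by
  rw [← charpoly_conj_shifted_family₆ hd J0 Js s x]
  exact le_countP_re_pos_of_kdCheck_lyapInertiaLB h x hx

/-- **The UPPER side of the spectral abscissa (END-TO-END)**: a passing `V`-only balanced + shifted
inertia tree with `0 < q` gives, at every point `x` of the box, an eigenvalue `μ` of the ORIGINAL `J(x)`
with `Re μ > −s`. Combined with a rate certificate `Re μ ≤ −r` of the files above this is a two-sided
enclosure `−s < max Re σ(J(x)) ≤ −r` on the whole box. [cite: CarlsonSchneider1962, § 1] -/
theorem exists_re_gt_neg_of_kdCheck_lyapInertiaLB_conj_shifted {n K : ℕ} {J0 : List (List ℚ)}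
    {Js : List (List (List ℚ))} {d : List ℚ} {s : ℚ} {q : ℕ} (hq : 0 < q) {B : Box}
    {t : KdCert LyapInertiaLeaf} (hd : posListQ n d = true)
    (h : t.check (lyapInertiaLeafLB n K (addDiagTab n s (conjDiagTab n d J0))
      (vtab K fun k ↦ conjDiagTab n d (Js.getD k [])) q) B = true)
    (x : ℕ → ℝ) (hx : B.mem x) :
    ∃ μ ∈ spectrum ℂ ((finMat n J0 + paramMatrix (fun k : Fin K ↦ finMat n (Js.getD k []))
      (fun k : Fin K ↦ x k)).map (algebraMap ℝ ℂ)), -(s : ℝ) < μ.re :=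
  exists_re_gt_neg_of_countP_shift₆ hq (le_countP_re_pos_of_kdCheck_lyapInertiaLB_conj_shifted hd h x hx).1

/-! #### Part L. Kernel example (inertia leaves) -/

/-- `J(p) = [[1, p], [0, −1]]`, `p ∈ [−1, 1]` (eigenvalues `1` and `−1` for every `p`), ONE order-0 leaf
with the INDEFINITE `P = diag(−1, 1)`: the checker regroups `Q_0 = 2·1`, `Q_1 = [[0, 1], [1, 0]]`, so
Gershgorin certifies `Q(δ) ⪰ 1·1` on the leaf; the test tables `V = e₁`, `U = e₂` give `VᵀPV = −1`,
`UᵀPU = 1`; claim `q = 1`: exactly one characteristic root with `Re > 0` and one with `Re < 0`. -/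
example : KdCert.check (lyapInertiaLeafOK 2 1 [[1, 0], [0, -1]] [[[0, 1], [0, 0]]] 1) [((-1 : ℚ), 1)]
    (KdCert.leaf ⟨[[0]], [[[-1, 0], [0, 1]]], [[0], [1]], ⟨1, 0, [], []⟩, [[1], [0]], ⟨1, 0, [], []⟩,
      [[0], [1]], ⟨1, 0, [], []⟩⟩) = true := by
  decide +kernel

/-! ### Appended 2026-08-27 (session 6, second part): the CENTRE-ONLY inertia check and its public core facts

With `Q(δ) ≻ O` on the whole leaf (certificate `cQ`), `G(δ) = −P(δ)` is NONSINGULAR on the leaf (Main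
Inertia Theorem: `ν₀(G) = 0`), and the leaf box is convex; by the constancy of the inertia of a continuous
nonsingular Hermitian family on a preconnected set (tree file
`Literature/LinearAlgebra/Matrix/HermitianFamilyInertia.lean`, `card_pos_eigenvalues_eq_of_isPreconnected`)
the counts `ν₊(G(δ))`, `ν₋(G(δ))` are those AT THE CENTRE `δ = 0`, where `P(0) = Σ_{α_i = 0} P_i` is exact
rational data. So the test tables need certificates with ZERO radius only: `−VᵀP(0)V ≻ 0`, `UᵀP(0)U ≻ 0`
— the interval test on the positive block, which forced small leaves in `lyapInertiaLeafOK`, disappears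
(this is the inertia analogue of `posDef_on_of_lyapunov_pos`). This part defines the check
`lyapInertiaLeafOKC` and proves its ANALYTIC core facts with the plumbing of this file (public theorem
`lyapInertiaLeafOKC_core`); the topological conclusion and the box-level count theorems are in
`ParametricLyapunovInertiaConnected.lean`, which imports the constancy theorem (and re-derives the
similarity / shift bookkeeping it needs).
[cite: CarlsonSchneider1962, § 1; GolubVanLoan2013, §8.1.1 Thm 8.1.2 (Courant–Fischer Minimax Theorem); Hladik2017, §3]
-/

/-! #### Part M. The centre-only check -/

/-- **Inertia leaf check, CENTRE-ONLY form** for the claim «exactly `q` characteristic roots of `J(x)`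
with `Re > 0`, `n − q` with `Re < 0`, none with `Re = 0`, at every `x` of the leaf»: all `P_i`
symmetric; coverage; `0 < cQ.lam` and `checkLower` of the centred interval family of the regrouped `Q_j`
(fast tables) ON THE LEAF; and, with `P(0) = Σ_{α_i = 0} P_i` EXACT: `0 < cV.lam`,
`checkLower q (−VᵀP(0)V) 0 cV`; `0 < cU.lam`, `checkLower (n − q) (UᵀP(0)U) 0 cU`.
[cite: CarlsonSchneider1962, § 1; Hladik2017, §3] -/
def lyapInertiaLeafOKC (n K : ℕ) (J0 : List (List ℚ)) (Js : List (List (List ℚ))) (q : ℕ) (B : Box)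
    (l : LyapInertiaLeaf) : Bool :=
  let L := l.Ps.length
  let M := l.betas.length
  let w := boxHalfList K B
  let Qs := lyapTayQTabsF n K L M (affineAtQ n K J0 Js (boxCentreList K B)) Js l.Ps l.alphas l.betas
  let P0 := centreTab n L K l.alphas l.Ps
  rall L (fun i ↦ symmQ n (l.Ps.getD i [])) && coverIdx K L M l.alphas l.betas &&
    decide (0 < l.cQ.lam) &&
    checkLower n (centreTab n M K l.betas Qs) (radTab n M K l.betas Qs w) l.cQ &&
    decide (0 < l.cV.lam) && checkLower q (negTab q (congTab n q l.V P0)) (zeroTab q) l.cV &&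
    decide (0 < l.cU.lam) && checkLower (n - q) (congTab n (n - q) l.U P0) (zeroTab (n - q)) l.cU

/-! #### Part N. Public core facts of the centre-only check (for `ParametricLyapunovInertiaConnected.lean`) -/

/-- The affine family in CENTRED coordinates: `J(x) = J(c) + Σ_k (x_k − c_k) J^{(k)}` (Hladík's `A(p) = A(pᶜ) + Σ …`).
[cite: Hladik2017, §3 (centred form of a parametric matrix)] -/
theorem finMat_add_paramMatrix_eq_centre {n K : ℕ} (J0 : List (List ℚ)) (Js : List (List (List ℚ)))
    (B : Box) (x : ℕ → ℝ) :
    finMat n J0 + paramMatrix (fun k : Fin K ↦ finMat n (Js.getD k [])) (fun k : Fin K ↦ x k)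
      = finMat n (affineAtQ n K J0 Js (boxCentreList K B))
        + paramMatrix (fun k : Fin K ↦ finMat n (Js.getD k []))
            (fun k : Fin K ↦ x k - vreal (boxCentreList K B) k) := by
  have hxsplit : (fun k : Fin K ↦ x k)
      = fun k : Fin K ↦ vreal (boxCentreList K B) k + (x k - vreal (boxCentreList K B) k) :=
    funext fun k ↦ by ring
  rw [finMat_affineAtQ₆, add_assoc, ← paramMatrix_add_param₆, ← hxsplit]

/-- Points of a box are within the half-widths `p^Δ` of the centre `pᶜ` (Hladík's parametrisation
`p ∈ [pᶜ − p^Δ, pᶜ + p^Δ]`). [cite: Hladik2017, §3 (centred form of a parametric matrix)] -/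
theorem abs_sub_boxCentre_le {K : ℕ} {B : Box} {x : ℕ → ℝ} (hx : B.mem x) (k : Fin K) :
    |x k - vreal (boxCentreList K B) k| ≤ vreal (boxHalfList K B) k :=
  abs_sub_centre_le₆ hx k

/-- **The core facts of a passing centre-only leaf.** With `L = |Ps|`, `P(δ) = Σ δ^{α_i}P_i`,
`G(δ) = (−P(δ))ℂ`, `c`, `w` the centre / half-widths of `B`, `J_c = J(c)`: (1) every `G(δ)` is Hermitian;
(2) for every `δ` of the centred leaf box (`|δ_k| ≤ w_k`) the complexified Lyapunov form
`(J_c + Σ δ_kJ^{(k)})ℂᴴ G(δ) + G(δ) (J_c + Σ δ_kJ^{(k)})ℂ` is positive definite; (3) `G(0)` has at least `q`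
positive and (4) at least `n − q` negative eigenvalues.
[cite: CarlsonSchneider1962, § 1; GolubVanLoan2013, §8.1.1 Thm 8.1.2 (Courant–Fischer Minimax Theorem); Hladik2017, §3] -/
theorem lyapInertiaLeafOKC_core {n K : ℕ} {J0 : List (List ℚ)} {Js : List (List (List ℚ))} {q : ℕ}
    {B : Box} {l : LyapInertiaLeaf} (h : lyapInertiaLeafOKC n K J0 Js q B l = true) :
    ∃ hG : ∀ δ : Fin K → ℝ, ((-polyTabR n l.Ps.length K l.alphas l.Ps δ).map (algebraMap ℝ ℂ)).IsHermitian,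
      (∀ δ : Fin K → ℝ, (∀ k : Fin K, |δ k| ≤ vreal (boxHalfList K B) k) →
        (((finMat n (affineAtQ n K J0 Js (boxCentreList K B))
              + paramMatrix (fun k : Fin K ↦ finMat n (Js.getD k [])) δ).map (algebraMap ℝ ℂ))ᴴ
            * (-polyTabR n l.Ps.length K l.alphas l.Ps δ).map (algebraMap ℝ ℂ)
          + (-polyTabR n l.Ps.length K l.alphas l.Ps δ).map (algebraMap ℝ ℂ)
            * (finMat n (affineAtQ n K J0 Js (boxCentreList K B))
              + paramMatrix (fun k : Fin K ↦ finMat n (Js.getD k [])) δ).map (algebraMap ℝ ℂ)).PosDef) ∧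
      q ≤ #{i | 0 < (hG fun _ ↦ 0).eigenvalues i} ∧
      n - q ≤ #{i | (hG fun _ ↦ 0).eigenvalues i < 0} := by
  have h' := h
  unfold lyapInertiaLeafOKC coverIdx at h'
  simp only [Bool.and_eq_true, decide_eq_true_eq] at h'
  obtain ⟨⟨⟨⟨⟨⟨⟨hsym, hcovA, hcovB⟩, hm⟩, hcQ⟩, hκV⟩, hcV⟩, hκU⟩, hcU⟩ := h'
  set L : ℕ := l.Ps.length with hL
  set M : ℕ := l.betas.length with hM
  set cL : List ℚ := boxCentreList K B with hcL
  set wL : List ℚ := boxHalfList K B with hwL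
  set Jf : Fin K → Matrix (Fin n) (Fin n) ℝ := fun k ↦ finMat n (Js.getD k []) with hJf
  set Jc : Matrix (Fin n) (Fin n) ℝ := finMat n (affineAtQ n K J0 Js cL) with hJc
  let Pf : (Fin K → ℝ) → Matrix (Fin n) (Fin n) ℝ := polyTabR n L K l.alphas l.Ps
  have hPherm : ∀ δ, (Pf δ).IsHermitian := fun δ ↦ isHermitian_polyTabR hsym δ
  have hG : ∀ δ : Fin K → ℝ, ((-Pf δ).map (algebraMap ℝ ℂ)).IsHermitian :=
    fun δ ↦ isHermitian_map_ofReal₆ (hPherm δ).neg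
  refine ⟨hG, ?_, ?_, ?_⟩
  · -- (2) the Lyapunov form, uniformly on the centred leaf box
    intro δ hδ
    set Qs := lyapTayQTabs n K L M (affineAtQ n K J0 Js cL) Js l.Ps
      (fun i ↦ posOf K l.betas (l.alphas.getD i []))
      (fun k i ↦ posOf K l.betas (bumpIdx K (l.alphas.getD i []) k)) with hQs
    have hc := centreTab_congr₆ (n := n) (N := M) (K := K) l.betas
      (fun j hj a ha b hb ↦ mget_lyapTayQTabsF (K := K) (L := L) (M := M)
        (affineAtQ n K J0 Js cL) Js l.Ps l.alphas l.betas hj ha hb)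
    have hr := radTab_congr₆ (n := n) (N := M) (K := K) l.betas wL
      (fun j hj a ha b hb ↦ mget_lyapTayQTabsF (K := K) (L := L) (M := M)
        (affineAtQ n K J0 Js cL) Js l.Ps l.alphas l.betas hj ha hb)
    have hcQ' := hcQ
    rw [hc, hr] at hcQ'
    have hcovA' : ∀ i : Fin L, posOf K l.betas (l.alphas.getD i []) < M := fun i ↦ by
      have := of_rall hcovA i.isLt; rwa [decide_eq_true_eq] at this
    have hcovB' : ∀ (k : Fin K) (i : Fin L), posOf K l.betas (bumpIdx K (l.alphas.getD i []) k) < M :=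
      fun k i ↦ by
        have := of_rall (of_rall hcovB k.isLt) i.isLt; rwa [decide_eq_true_eq] at this
    set J : Matrix (Fin n) (Fin n) ℝ := Jc + paramMatrix Jf δ with hJ
    have hQeq : polyTabR n M K l.betas Qs δ = lyapRm₆ J (Pf δ) := by
      rw [hQs, hJ, hJc]
      exact polyTabR_Q_eq _ _ _ _ _ hcovA' hcovB' hM δ
    have hmpos : (0 : ℝ) < l.cQ.lam := by exact_mod_cast hm
    have hWform : ∀ y : Fin n → ℝ, y ≠ 0 → 0 < y ⬝ᵥ ((Jᵀ * (-Pf δ) + (-Pf δ) * J) *ᵥ y) := by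
      intro y hy
      have h1 := mul_dotProduct_le_of_checkLower hcQ' (A := polyTabR n M K l.betas Qs δ)
        (abs_polyTabR_sub_centre_le n M K l.betas Qs hδ) y
      rw [hQeq] at h1
      unfold lyapRm₆ at h1
      have h2 : Jᵀ * (-Pf δ) + (-Pf δ) * J = -(Jᵀ * Pf δ + Pf δ * J) := by
        rw [Matrix.mul_neg, Matrix.neg_mul, neg_add]
      rw [h2]
      exact lt_of_lt_of_le (mul_pos hmpos (dotProduct_self_pos_of_ne_zero₆ hy)) h1
    have hPT : (Pf δ)ᵀ = Pf δ := by
      have := (hPherm δ).eq; rwa [conjTranspose_eq_transpose_of_trivial] at this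
    have hWherm : (Jᵀ * (-Pf δ) + (-Pf δ) * J).IsHermitian := by
      show (Jᵀ * (-Pf δ) + (-Pf δ) * J)ᴴ = Jᵀ * (-Pf δ) + (-Pf δ) * J
      rw [conjTranspose_eq_transpose_of_trivial, transpose_add, transpose_mul, transpose_mul,
        transpose_transpose, transpose_neg, hPT, add_comm]
    rw [conjTranspose_map_ofReal₆, ← Matrix.map_mul, ← Matrix.map_mul,
      ← Matrix.map_add _ (map_add (algebraMap ℝ ℂ))]
    exact posDef_map_ofReal₆ hWherm hWform
  · -- (3) the negative test table at the centre, exact data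
    have hP0 : Pf (fun _ ↦ 0) = finMat n (centreTab n L K l.alphas l.Ps) := polyTabR_zero n L K l.alphas l.Ps
    have hκpos : (0 : ℝ) < l.cV.lam := by exact_mod_cast hκV
    have hV : ∀ z : Fin q → ℝ, z ≠ 0 →
        z ⬝ᵥ (((finMatRect n q l.V)ᵀ * Pf (fun _ ↦ 0) * finMatRect n q l.V) *ᵥ z) < 0 := fun z hz ↦ by
      have hencl : ∀ a b : Fin q,
          |(-finMat q (congTab n q l.V (centreTab n L K l.alphas l.Ps))) a b
            - mreal (negTab q (congTab n q l.V (centreTab n L K l.alphas l.Ps))) a b| ≤ mreal (zeroTab q) a b :=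
        fun a b ↦ by
          rw [Matrix.neg_apply, mreal_negTab₆, finMat_apply₆, sub_self, abs_zero]
          unfold zeroTab mreal; rw [mget_mtab _ a.isLt b.isLt]; push_cast; exact le_rfl
      have h1 := mul_dotProduct_le_of_checkLower hcV hencl z
      rw [Matrix.neg_mulVec, dotProduct_neg, finMat_congTab₆, ← hP0] at h1
      have h2 := mul_pos hκpos (dotProduct_self_pos_of_ne_zero₆ hz)
      linarith
    exact le_card_eigenvalues_pos_of_test₆ (hG fun _ ↦ 0) hV
  · -- (4) the positive test table at the centre, exact data
    have hP0 : Pf (fun _ ↦ 0) = finMat n (centreTab n L K l.alphas l.Ps) := polyTabR_zero n L K l.alphas l.Ps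
    have hκpos : (0 : ℝ) < l.cU.lam := by exact_mod_cast hκU
    have hU : ∀ z : Fin (n - q) → ℝ, z ≠ 0 →
        0 < z ⬝ᵥ (((finMatRect n (n - q) l.U)ᵀ * Pf (fun _ ↦ 0) * finMatRect n (n - q) l.U) *ᵥ z) :=
      fun z hz ↦ by
        have h1 := mul_dotProduct_le_of_checkLower hcU
          (A := finMat (n - q) (congTab n (n - q) l.U (centreTab n L K l.alphas l.Ps)))
          (abs_sub_self_le_zeroTab₆ _) z
        rw [finMat_congTab₆, ← hP0] at h1
        exact lt_of_lt_of_le (mul_pos hκpos (dotProduct_self_pos_of_ne_zero₆ hz)) h1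
    exact le_card_eigenvalues_neg_of_test₆ (hG fun _ ↦ 0) hU

/-! #### Part O. Kernel example (centre-only check) -/

/-- The kernel example of Part L with the centre-only check: the test certificates now carry ZERO radius
tables (`VᵀP(0)V = −1`, `UᵀP(0)U = 1` exactly). -/
example : KdCert.check (lyapInertiaLeafOKC 2 1 [[1, 0], [0, -1]] [[[0, 1], [0, 0]]] 1) [((-1 : ℚ), 1)]
    (KdCert.leaf ⟨[[0]], [[[-1, 0], [0, 1]]], [[0], [1]], ⟨1, 0, [], []⟩, [[1], [0]], ⟨1, 0, [], []⟩,
      [[0], [1]], ⟨1, 0, [], []⟩⟩) = true := by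
  decide +kernel

/-! ## APPEND #7 (2026-08-27, session 7): INTERVAL `J` for the order-`d` Taylor–Lyapunov leaves

The 0.4.0 release note says «interval-J not with taylor»: the ENCLOSED-family statement (every real `J′`
with `|J′ − J(x)| ≤ R` entrywise — client data with rounded / irrational entries, and, new, the
FIRST-ORDER MODELS of `RExpr` families in `ParametricLyapunovRexprCertificate.lean`) existed only for
the affine-`P` leaves (`lyapAffLeafOKI`). This section adds it for the Taylor leaves, with the same one
line of mathematics as the affine case: writing `J′ = J(x) + E`, `|E| ≤ R`, the Lyapunov form of `J′`
is that of `J(x)` minus `EᵀP(δ) + P(δ)E`, bounded entrywise by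
`(Δ_J)_{ab} = Σ_l (R_{la} P̄_{lb} + P̄_{al} R_{lb})` where now `P̄ = |P₀| + Σ_{α_i ≠ 0} w^{α_i} |P_i| ≥ |P(δ)|`
on the leaf (`tayAbsBoundTab` = `|centreTab| + radTab`); the checker `lyapTayLeafOKI` is `lyapTayLeafOK`
with `R ≥ 0` checked and the `Q`-certificate run on the radius `R_Q + Δ_J`. `P(δ) ≻ 0` on the leaf
still comes from the connectedness theorem applied to the EXACT family (the member `E = 0`).
Box level, shift and balancing (balanced radii `D R D⁻¹`) as in the affine file.
[cite: GahinetApkarianChilali1996, §III; Hladik2017, §3; CarlsonSchneider1962, § 1] -/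

/-- Entrywise bound `P̄ = |P₀| + Σ_{α_i ≠ 0} w^{α_i} |P_i|` of `|P(δ)|` on the centred leaf box.
[cite: Hladik2017, §3 (interval coefficients)] -/
def tayAbsBoundTab (n L K : ℕ) (alphas : List (List ℕ)) (Ps : List (List (List ℚ))) (w : List ℚ) :
    List (List ℚ) :=
  mtab n n fun a b ↦ |mget (centreTab n L K alphas Ps) a b| + mget (radTab n L K alphas Ps w) a b

/-- **The Taylor–Lyapunov leaf check for an INTERVAL `J` family** (radii table `R ≥ 0`): as
`lyapTayLeafOK`, with the `Q`-certificate run on the radius `R_Q + Δ_J`,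
`Δ_J = lyapRadJTab n R P̄`. [cite: GahinetApkarianChilali1996, §III; Hladik2017, §3] -/
def lyapTayLeafOKI (n K : ℕ) (J0 : List (List ℚ)) (Js : List (List (List ℚ))) (R : List (List ℚ)) (r : ℚ)
    (B : Box) (l : LyapTayLeaf) : Bool :=
  let L := l.Ps.length
  let M := l.betas.length
  let w := boxHalfList K B
  let Qs := lyapTayQTabs n K L M (affineAtQ n K J0 Js (boxCentreList K B)) Js l.Ps
    (fun i ↦ posOf K l.betas (l.alphas.getD i []))
    (fun k i ↦ posOf K l.betas (bumpIdx K (l.alphas.getD i []) k))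
  let P0 := centreTab n L K l.alphas l.Ps
  nonnegQ n R && rall L (fun i ↦ symmQ n (l.Ps.getD i [])) && coverIdx K L M l.alphas l.betas &&
    decide (0 < l.cP.lam) && checkLower n P0 (zeroTab n) l.cP &&
    decide (0 < l.π) && decide (-l.π ≤ l.cN.lam) &&
    checkLower n (negTab n P0) (radTab n L K l.alphas l.Ps w) l.cN &&
    decide (0 < l.cQ.lam) && decide (2 * l.π * r ≤ l.cQ.lam) &&
    checkLower n (centreTab n M K l.betas Qs)
      (addTab n (radTab n M K l.betas Qs w) (lyapRadJTab n R (tayAbsBoundTab n L K l.alphas l.Ps w))) l.cQ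

/-- Entries of `addTab` as reals (plumbing). [folklore] -/
private theorem mreal_addTab₇ {n : ℕ} (A B : List (List ℚ)) (i j : Fin n) :
    mreal (addTab n A B) i j = mreal A i j + mreal B i j := by
  unfold addTab mreal; rw [mget_mtab _ i.isLt j.isLt]; push_cast; rfl

/-- Entries of `tayAbsBoundTab` as reals (plumbing). [folklore] -/
private theorem mreal_tayAbsBoundTab₇ {n L K : ℕ} (alphas : List (List ℕ)) (Ps : List (List (List ℚ)))
    (w : List ℚ) (a b : Fin n) :
    mreal (tayAbsBoundTab n L K alphas Ps w) a b
      = |mreal (centreTab n L K alphas Ps) a b| + mreal (radTab n L K alphas Ps w) a b := by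
  unfold tayAbsBoundTab mreal; rw [mget_mtab _ a.isLt b.isLt]; push_cast; rfl

/-- Entries of `lyapRadJTab` as reals (plumbing). [folklore] -/
private theorem mreal_lyapRadJTab₇ {n : ℕ} (R Pb : List (List ℚ)) (i j : Fin n) :
    mreal (lyapRadJTab n R Pb) i j
      = ∑ l : Fin n, (mreal R l i * mreal Pb l j + mreal Pb i l * mreal R l j) := by
  unfold lyapRadJTab mreal
  rw [mget_mtab _ i.isLt j.isLt, rsum_eq_sum]
  push_cast
  rw [← Fin.sum_univ_eq_sum_range (fun l ↦ ((mget R l i : ℚ) : ℝ) * ((mget Pb l j : ℚ) : ℝ)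
    + ((mget Pb i l : ℚ) : ℝ) * ((mget R l j : ℚ) : ℝ)) n]

/-- Entries of a nonnegative table are nonnegative reals (plumbing). [folklore] -/
private theorem mreal_nonneg_of_nonnegQ₇ {n : ℕ} {R : List (List ℚ)} (h : nonnegQ n R = true) (a b : Fin n) :
    0 ≤ mreal R a b := by
  have := of_rall (of_rall h a.isLt) b.isLt
  rw [decide_eq_true_eq] at this
  unfold mreal; exact_mod_cast this

/-- `|P(δ)_{ab}| ≤ P̄_{ab}` on the centred leaf box. [cite: Hladik2017, §3] -/
private theorem abs_polyTabR_le_tayAbsBoundTab₇ {n L K : ℕ} (alphas : List (List ℕ))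
    (Ps : List (List (List ℚ))) {δ : Fin K → ℝ} {w : List ℚ} (hδ : ∀ k : Fin K, |δ k| ≤ vreal w k)
    (a b : Fin n) :
    |polyTabR n L K alphas Ps δ a b| ≤ mreal (tayAbsBoundTab n L K alphas Ps w) a b := by
  rw [mreal_tayAbsBoundTab₇]
  have h := abs_polyTabR_sub_centre_le n L K alphas Ps hδ a b
  have e : polyTabR n L K alphas Ps δ a b
      = mreal (centreTab n L K alphas Ps) a b + (polyTabR n L K alphas Ps δ a b - mreal (centreTab n L K alphas Ps) a b) := by
    ring
  rw [e]
  exact (abs_add_le _ _).trans (add_le_add le_rfl h)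

/-- **The `J`-enclosure remainder bound**: `|(−(EᵀP + PE))_{ij}| ≤ (Δ_J)_{ij}` for `|E| ≤ R`, `|P| ≤ P̄`.
[cite: Hladik2017, §3 (interval coefficients)] -/
private theorem abs_lyapRm_le_lyapRadJTab₇ {n : ℕ} {E P : Matrix (Fin n) (Fin n) ℝ} {R Pb : List (List ℚ)}
    (hE : ∀ a b : Fin n, |E a b| ≤ mreal R a b) (hP : ∀ a b : Fin n, |P a b| ≤ mreal Pb a b) (i j : Fin n) :
    |lyapRm₆ E P i j| ≤ mreal (lyapRadJTab n R Pb) i j := by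
  rw [mreal_lyapRadJTab₇]
  unfold lyapRm₆
  rw [Matrix.neg_apply, abs_neg, Matrix.add_apply, Matrix.mul_apply, Matrix.mul_apply,
    ← Finset.sum_add_distrib]
  refine (Finset.abs_sum_le_sum_abs _ _).trans (Finset.sum_le_sum fun l _ ↦ ?_)
  rw [Matrix.transpose_apply]
  refine (abs_add_le _ _).trans (add_le_add ?_ ?_)
  · rw [abs_mul]; exact mul_le_mul (hE l i) (hP l j) (abs_nonneg _) ((abs_nonneg _).trans (hE l i))
  · rw [abs_mul]; exact mul_le_mul (hP i l) (hE l j) (abs_nonneg _) ((abs_nonneg _).trans (hP i l))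

/-- `lyapRm₆` is additive in `J` (plumbing). [folklore] -/
private theorem lyapRm₆_add_left₇ {n : ℕ} (J E P : Matrix (Fin n) (Fin n) ℝ) :
    lyapRm₆ (J + E) P = lyapRm₆ J P + lyapRm₆ E P := by
  unfold lyapRm₆
  rw [Matrix.transpose_add, Matrix.add_mul, Matrix.mul_add]
  abel

/-- **Per leaf, interval `J`**: an accepted Taylor–Lyapunov leaf (interval form) proves `Re μ ≤ −r` for
every eigenvalue of every real `J′` with `|J′ − J(x)| ≤ R` entrywise, at every point `x` of the leaf box.
[cite: GahinetApkarianChilali1996, §III; CarlsonSchneider1962, § 1; Hladik2017, §3] -/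
theorem re_le_neg_of_lyapTayLeafOKI {n K : ℕ} {J0 : List (List ℚ)} {Js : List (List (List ℚ))}
    {R : List (List ℚ)} {r : ℚ} {B : Box} {l : LyapTayLeaf}
    (h : lyapTayLeafOKI n K J0 Js R r B l = true) (x : ℕ → ℝ) (hx : B.mem x)
    {J' : Matrix (Fin n) (Fin n) ℝ}
    (hJ' : ∀ i j : Fin n, |J' i j - (finMat n J0
      + paramMatrix (fun k : Fin K ↦ finMat n (Js.getD k [])) (fun k : Fin K ↦ x k)) i j| ≤ mreal R i j)
    {μ : ℂ} (hμ : μ ∈ spectrum ℂ (J'.map (algebraMap ℝ ℂ))) : μ.re ≤ -(r : ℝ) := by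
  unfold lyapTayLeafOKI coverIdx at h
  simp only [Bool.and_eq_true, decide_eq_true_eq] at h
  obtain ⟨⟨⟨⟨⟨⟨⟨⟨⟨⟨hR0, hsym⟩, hcovA, hcovB⟩, hκ⟩, hcP⟩, hπ⟩, hNπ⟩, hcN⟩, hm⟩, hrate⟩, hcQ⟩ := h
  -- abbreviations
  set L : ℕ := l.Ps.length with hL
  set M : ℕ := l.betas.length with hM
  set cL : List ℚ := boxCentreList K B with hcL
  set wL : List ℚ := boxHalfList K B with hwL
  -- centred coordinates
  let δ : Fin K → ℝ := fun k ↦ x k - vreal cL k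
  have hc : ∀ k : Fin K, vreal cL k = ((((B.ivl k).1 + (B.ivl k).2) / 2 : ℚ) : ℝ) :=
    fun k ↦ vreal_vtab₆ _ k.isLt
  have hw : ∀ k : Fin K, vreal wL k = ((((B.ivl k).2 - (B.ivl k).1) / 2 : ℚ) : ℝ) :=
    fun k ↦ vreal_vtab₆ _ k.isLt
  have hδabs : ∀ k : Fin K, |δ k| ≤ vreal wL k := fun k ↦ by
    show |x k - vreal cL k| ≤ vreal wL k
    rw [hw k, hc k]; push_cast
    have := (hx k).1; have := (hx k).2
    exact abs_le.2 ⟨by linarith, by linarith⟩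
  have hw0 : ∀ k : Fin K, 0 ≤ vreal wL k := fun k ↦ (abs_nonneg _).trans (hδabs k)
  have hxsplit : (fun k : Fin K ↦ x k) = fun k : Fin K ↦ vreal cL k + δ k :=
    funext fun k ↦ by show x k = vreal cL k + (x k - vreal cL k); ring
  -- the objects
  set Jf : Fin K → Matrix (Fin n) (Fin n) ℝ := fun k ↦ finMat n (Js.getD k []) with hJf
  set J : Matrix (Fin n) (Fin n) ℝ := finMat n J0 + paramMatrix Jf (fun k : Fin K ↦ x k) with hJ
  set E : Matrix (Fin n) (Fin n) ℝ := J' - J with hE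
  have hJ'split : J' = J + E := by rw [hE]; abel
  have hEabs : ∀ a b : Fin n, |E a b| ≤ mreal R a b := fun a b ↦ by
    rw [hE, Matrix.sub_apply]; exact hJ' a b
  set Jc : Matrix (Fin n) (Fin n) ℝ := finMat n (affineAtQ n K J0 Js cL) with hJc
  have hJsplit : J = Jc + paramMatrix Jf δ := by
    rw [hJ, hJc, finMat_affineAtQ₆, add_assoc, ← paramMatrix_add_param₆, ← hxsplit]
  let Pf : (Fin K → ℝ) → Matrix (Fin n) (Fin n) ℝ := polyTabR n L K l.alphas l.Ps
  set Qs := lyapTayQTabs n K L M (affineAtQ n K J0 Js cL) Js l.Ps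
    (fun i ↦ posOf K l.betas (l.alphas.getD i []))
    (fun k i ↦ posOf K l.betas (bumpIdx K (l.alphas.getD i []) k)) with hQs
  -- coverage
  have hcovA' : ∀ i : Fin L, posOf K l.betas (l.alphas.getD i []) < M := fun i ↦ by
    have := of_rall hcovA i.isLt; rwa [decide_eq_true_eq] at this
  have hcovB' : ∀ (k : Fin K) (i : Fin L), posOf K l.betas (bumpIdx K (l.alphas.getD i []) k) < M :=
    fun k i ↦ by
      have := of_rall (of_rall hcovB k.isLt) i.isLt; rwa [decide_eq_true_eq] at this
  have hQeq : ∀ δ' : Fin K → ℝ,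
      polyTabR n M K l.betas Qs δ' = lyapRm₆ (Jc + paramMatrix Jf δ') (Pf δ') := fun δ' ↦ by
    rw [hQs, hJc]
    exact polyTabR_Q_eq _ _ _ _ _ hcovA' hcovB' hM δ'
  -- |P(δ')| ≤ P̄ on the centred leaf box
  have hPabs : ∀ δ' : Fin K → ℝ, (∀ k : Fin K, |δ' k| ≤ vreal wL k) → ∀ a b : Fin n,
      |Pf δ' a b| ≤ mreal (tayAbsBoundTab n L K l.alphas l.Ps wL) a b :=
    fun δ' hδ' a b ↦ abs_polyTabR_le_tayAbsBoundTab₇ l.alphas l.Ps hδ' a b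
  -- the Lyapunov form margin for EVERY member J(δ') + E', |E'| ≤ R, uniformly on the centred leaf box
  have hQformE : ∀ δ' : Fin K → ℝ, (∀ k : Fin K, |δ' k| ≤ vreal wL k) →
      ∀ E' : Matrix (Fin n) (Fin n) ℝ, (∀ a b : Fin n, |E' a b| ≤ mreal R a b) → ∀ y : Fin n → ℝ,
      (l.cQ.lam : ℝ) * (y ⬝ᵥ y)
        ≤ -(y ⬝ᵥ (((Jc + paramMatrix Jf δ' + E')ᵀ * Pf δ' + Pf δ' * (Jc + paramMatrix Jf δ' + E')) *ᵥ y)) := by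
    intro δ' hδ' E' hE' y
    have hmem : ∀ i j : Fin n,
        |lyapRm₆ (Jc + paramMatrix Jf δ' + E') (Pf δ') i j - mreal (centreTab n M K l.betas Qs) i j|
          ≤ mreal (addTab n (radTab n M K l.betas Qs wL)
              (lyapRadJTab n R (tayAbsBoundTab n L K l.alphas l.Ps wL))) i j := by
      intro i j
      rw [lyapRm₆_add_left₇, ← hQeq δ', Matrix.add_apply, mreal_addTab₇]
      have e : polyTabR n M K l.betas Qs δ' i j + lyapRm₆ E' (Pf δ') i j - mreal (centreTab n M K l.betas Qs) i j
          = (polyTabR n M K l.betas Qs δ' i j - mreal (centreTab n M K l.betas Qs) i j) + lyapRm₆ E' (Pf δ') i j := by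
        ring
      rw [e]
      refine (abs_add_le _ _).trans (add_le_add ?_ ?_)
      · exact abs_polyTabR_sub_centre_le n M K l.betas Qs hδ' i j
      · exact abs_lyapRm_le_lyapRadJTab₇ hE' (hPabs δ' hδ') i j
    have h1 := mul_dotProduct_le_of_checkLower hcQ hmem y
    unfold lyapRm₆ at h1
    rw [Matrix.neg_mulVec, dotProduct_neg] at h1
    exact h1
  -- the exact family is the member E' = 0
  have hzeroE : ∀ a b : Fin n, |(0 : Matrix (Fin n) (Fin n) ℝ) a b| ≤ mreal R a b := fun a b ↦ by
    rw [Matrix.zero_apply, abs_zero]; exact mreal_nonneg_of_nonnegQ₇ hR0 a b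
  have hQform : ∀ δ' : Fin K → ℝ, (∀ k : Fin K, |δ' k| ≤ vreal wL k) → ∀ y : Fin n → ℝ,
      (l.cQ.lam : ℝ) * (y ⬝ᵥ y)
        ≤ -(y ⬝ᵥ (((Jc + paramMatrix Jf δ')ᵀ * Pf δ' + Pf δ' * (Jc + paramMatrix Jf δ')) *ᵥ y)) := by
    intro δ' hδ' y
    have h1 := hQformE δ' hδ' 0 hzeroE y
    rw [add_zero] at h1
    exact h1
  -- P is Hermitian everywhere and positive definite at the centre
  have hPherm : ∀ δ' : Fin K → ℝ, (Pf δ').IsHermitian := fun δ' ↦ isHermitian_polyTabR hsym δ'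
  have hP0 : (Pf fun _ ↦ 0).PosDef := by
    have hH : (finMat n (centreTab n L K l.alphas l.Ps)).IsHermitian := by
      rw [← polyTabR_zero]; exact hPherm _
    show (polyTabR n L K l.alphas l.Ps fun _ ↦ 0).PosDef
    rw [polyTabR_zero]
    exact posDef_of_checkLower hcP hκ hH (abs_sub_self_le_zeroTab₆ _)
  -- connectedness on the centred leaf box ⇒ P(δ) ≻ 0
  let S : Set (Fin K → ℝ) := Set.Icc (fun k ↦ -vreal wL k) (fun k ↦ vreal wL k)
  have hS : IsPreconnected S := (convex_Icc _ _).isPreconnected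
  have hmemS : ∀ δ' ∈ S, ∀ k : Fin K, |δ' k| ≤ vreal wL k := fun δ' hδ' k ↦
    abs_le.2 ⟨hδ'.1 k, hδ'.2 k⟩
  have hδS : δ ∈ S := ⟨fun k ↦ (abs_le.1 (hδabs k)).1, fun k ↦ (abs_le.1 (hδabs k)).2⟩
  have h0S : (fun _ : Fin K ↦ (0 : ℝ)) ∈ S := ⟨fun k ↦ by simpa using hw0 k, fun k ↦ hw0 k⟩
  have hmpos : (0 : ℝ) < l.cQ.lam := by exact_mod_cast hm
  have hPD : (Pf δ).PosDef :=
    posDef_on_of_lyapunov_pos hS (continuous_polyTabR n L K l.alphas l.Ps) hPherm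
      (J := fun δ' ↦ Jc + paramMatrix Jf δ')
      (fun δ' hδ' y hy ↦ lt_of_lt_of_le (mul_pos hmpos (dotProduct_self_pos_of_ne_zero₆ hy))
        (hQform δ' (hmemS δ' hδ') y)) h0S hP0 δ hδS
  -- yᵀP(δ)y ≤ π·yᵀy from the centred interval family of −P
  have hPπ : ∀ y : Fin n → ℝ, y ⬝ᵥ (Pf δ *ᵥ y) ≤ (l.π : ℝ) * (y ⬝ᵥ y) := by
    intro y
    have hencl : ∀ a b : Fin n, |(-Pf δ) a b - mreal (negTab n (centreTab n L K l.alphas l.Ps)) a b|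
        ≤ mreal (radTab n L K l.alphas l.Ps wL) a b := fun a b ↦ by
      rw [Matrix.neg_apply, mreal_negTab₆, ← abs_neg]
      have := abs_polyTabR_sub_centre_le n L K l.alphas l.Ps hδabs a b
      convert this using 2; ring
    have h1 := mul_dotProduct_le_of_checkLower hcN hencl y
    rw [Matrix.neg_mulVec, dotProduct_neg] at h1
    have hyy : 0 ≤ y ⬝ᵥ y := dotProduct_self_nonneg₆ y
    have h2 : (-(l.π : ℝ)) * (y ⬝ᵥ y) ≤ (l.cN.lam : ℝ) * (y ⬝ᵥ y) :=
      mul_le_mul_of_nonneg_right (by exact_mod_cast hNπ) hyy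
    linarith
  -- the form margin at δ for the member J' = J + E itself
  have hQ : ∀ y : Fin n → ℝ, (l.cQ.lam : ℝ) * (y ⬝ᵥ y) ≤ -(y ⬝ᵥ ((J'ᵀ * Pf δ + Pf δ * J') *ᵥ y)) := by
    rw [hJ'split, hJsplit]; exact hQformE δ hδabs E hEabs
  have hrate' : (r : ℝ) ≤ (l.cQ.lam : ℝ) / (2 * (l.π : ℝ)) := by
    rw [le_div_iff₀ (by positivity)]
    have : ((2 * l.π * r : ℚ) : ℝ) ≤ (l.cQ.lam : ℝ) := by exact_mod_cast hrate
    push_cast at this; linarith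
  have hmain := Literature.LinearAlgebra.Matrix.re_le_neg_div_of_real_lyapunov_form_bounds
    (J := J') (P := Pf δ) hmpos.le (by exact_mod_cast hπ) hPD hPπ hQ hμ
  rw [neg_div] at hmain
  linarith

/-- **Interval-`J` Taylor–Lyapunov certificate, box level (END-TO-END).** If the kd-tree checks with
`lyapTayLeafOKI n K J0 Js R r` on `B`, then for every `x` of `B` and every real matrix `J′` with
`|J′ − J(x)| ≤ R` entrywise, every complex eigenvalue of `J′` has `Re μ ≤ −r`.
[cite: GahinetApkarianChilali1996, §III; CarlsonSchneider1962, § 1; Hladik2017, §3] -/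
theorem re_le_neg_of_kdCheck_lyapTayI {n K : ℕ} {J0 : List (List ℚ)} {Js : List (List (List ℚ))}
    {R : List (List ℚ)} {r : ℚ} {B : Box} {t : KdCert LyapTayLeaf}
    (h : t.check (lyapTayLeafOKI n K J0 Js R r) B = true) (x : ℕ → ℝ) (hx : B.mem x)
    {J' : Matrix (Fin n) (Fin n) ℝ}
    (hJ' : ∀ i j : Fin n, |J' i j - (finMat n J0
      + paramMatrix (fun k : Fin K ↦ finMat n (Js.getD k [])) (fun k : Fin K ↦ x k)) i j| ≤ mreal R i j)
    {μ : ℂ} (hμ : μ ∈ spectrum ℂ (J'.map (algebraMap ℝ ℂ))) : μ.re ≤ -(r : ℝ) :=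
  KdCert.sound (P := fun x ↦ ∀ J' : Matrix (Fin n) (Fin n) ℝ, (∀ i j : Fin n, |J' i j - (finMat n J0
      + paramMatrix (fun k : Fin K ↦ finMat n (Js.getD k [])) (fun k : Fin K ↦ x k)) i j| ≤ mreal R i j) →
      ∀ μ : ℂ, μ ∈ spectrum ℂ (J'.map (algebraMap ℝ ℂ)) → μ.re ≤ -(r : ℝ))
    (fun _ _ hl x hx _ hJ' _ hμ ↦ re_le_neg_of_lyapTayLeafOKI hl x hx hJ' hμ) t B h x hx J' hJ' μ hμ

/-- **Shifted interval-`J` Taylor certificate**: tables `(J₀ + s·1, J^{(k)})`, radii `R`, rate `r` ⇒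
every member `J′` at `x` has `Re μ ≤ −(s + r)`. [cite: GahinetApkarianChilali1996, §III; CarlsonSchneider1962, § 1] -/
theorem re_le_neg_of_kdCheck_lyapTayI_shifted {n K : ℕ} {J0 : List (List ℚ)}
    {Js : List (List (List ℚ))} {R : List (List ℚ)} {s r : ℚ} {B : Box} {t : KdCert LyapTayLeaf}
    (h : t.check (lyapTayLeafOKI n K (addDiagTab n s J0) Js R r) B = true) (x : ℕ → ℝ) (hx : B.mem x)
    {J' : Matrix (Fin n) (Fin n) ℝ}
    (hJ' : ∀ i j : Fin n, |J' i j - (finMat n J0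
      + paramMatrix (fun k : Fin K ↦ finMat n (Js.getD k [])) (fun k : Fin K ↦ x k)) i j| ≤ mreal R i j)
    {μ : ℂ} (hμ : μ ∈ spectrum ℂ (J'.map (algebraMap ℝ ℂ))) : μ.re ≤ -((s + r : ℚ) : ℝ) := by
  refine re_le_neg_of_forall_shift₆ (fun ν hν ↦ re_le_neg_of_kdCheck_lyapTayI h x hx
    (J' := J' + (s : ℝ) • (1 : Matrix (Fin n) (Fin n) ℝ)) (fun i j ↦ ?_) hν) hμ
  rw [finMat_addDiagTab₆]
  have e : (J' + (s : ℝ) • (1 : Matrix (Fin n) (Fin n) ℝ)) i j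
      - (finMat n J0 + (s : ℝ) • (1 : Matrix (Fin n) (Fin n) ℝ)
        + paramMatrix (fun k : Fin K ↦ finMat n (Js.getD k [])) (fun k : Fin K ↦ x k)) i j
      = J' i j - (finMat n J0 + paramMatrix (fun k : Fin K ↦ finMat n (Js.getD k [])) (fun k : Fin K ↦ x k)) i j := by
    simp only [Matrix.add_apply, Matrix.smul_apply]; ring
  rw [e]; exact hJ' i j

/-- Radii of the balanced family: `|d_i E_{ij} / d_j| ≤ d_i R_{ij} / d_j`. [folklore] -/
private theorem abs_conj_le₇ {n : ℕ} {d : List ℚ} (hd : posListQ n d = true) {E : Matrix (Fin n) (Fin n) ℝ}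
    {R : List (List ℚ)} (hE : ∀ a b : Fin n, |E a b| ≤ mreal R a b) (i j : Fin n) :
    |(Matrix.diagonal (fun i : Fin n ↦ (vreal d i)) * E * Matrix.diagonal (fun i : Fin n ↦ (vreal d i)⁻¹)) i j|
      ≤ mreal (conjDiagTab n d R) i j := by
  have hdpos : ∀ i : Fin n, (0 : ℝ) < vreal d i := fun i ↦ by
    have := of_rall hd i.isLt; rw [decide_eq_true_eq] at this
    unfold vreal; exact_mod_cast this
  rw [Matrix.mul_diagonal, Matrix.diagonal_mul, abs_mul, abs_mul, abs_of_pos (hdpos i),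
    abs_of_pos (inv_pos.2 (hdpos j))]
  unfold conjDiagTab mreal
  rw [mget_mtab _ i.isLt j.isLt]; push_cast
  rw [div_eq_mul_inv]
  have e : ((vget d i : ℚ) : ℝ) = vreal d i := rfl
  have e' : ((vget d j : ℚ) : ℝ) = vreal d j := rfl
  rw [e, e']
  exact mul_le_mul_of_nonneg_right (mul_le_mul_of_nonneg_left (hE i j) (hdpos i).le)
    (inv_pos.2 (hdpos j)).le

/-- **Balanced + shifted interval-`J` Taylor certificate ⇒ rate bound for every member of the ORIGINAL
interval family**: scaling positive and the kd-tree checks for `(D J₀ D⁻¹ + s·1, D J^{(k)} D⁻¹)` with the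
balanced radii `D R D⁻¹` and rate `r` ⇒ every `J′` with `|J′ − J(x)| ≤ R`, `x` in the box, has
`Re μ ≤ −(s + r)`. [cite: GahinetApkarianChilali1996, §III; CarlsonSchneider1962, § 1] -/
theorem re_le_neg_of_kdCheck_lyapTayI_conj_shifted {n K : ℕ} {J0 : List (List ℚ)}
    {Js : List (List (List ℚ))} {R : List (List ℚ)} {d : List ℚ} {s r : ℚ} {B : Box}
    {t : KdCert LyapTayLeaf} (hd : posListQ n d = true)
    (h : t.check (lyapTayLeafOKI n K (addDiagTab n s (conjDiagTab n d J0))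
      (vtab K fun k ↦ conjDiagTab n d (Js.getD k [])) (conjDiagTab n d R) r) B = true)
    (x : ℕ → ℝ) (hx : B.mem x) {J' : Matrix (Fin n) (Fin n) ℝ}
    (hJ' : ∀ i j : Fin n, |J' i j - (finMat n J0
      + paramMatrix (fun k : Fin K ↦ finMat n (Js.getD k [])) (fun k : Fin K ↦ x k)) i j| ≤ mreal R i j)
    {μ : ℂ} (hμ : μ ∈ spectrum ℂ (J'.map (algebraMap ℝ ℂ))) : μ.re ≤ -((s + r : ℚ) : ℝ) := by
  set Mx : Matrix (Fin n) (Fin n) ℝ :=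
    finMat n J0 + paramMatrix (fun k : Fin K ↦ finMat n (Js.getD k [])) (fun k : Fin K ↦ x k) with hMx
  have hμ' := mem_spectrum_conjDiag₆ hd hμ
  refine re_le_neg_of_kdCheck_lyapTayI_shifted h x hx (fun i j ↦ ?_) hμ'
  rw [affine_conjDiagTab_eq₆ d J0 Js x, ← hMx, ← Matrix.sub_apply, ← Matrix.sub_mul, ← Matrix.mul_sub]
  exact abs_conj_le₇ hd (E := J' - Mx) (fun a b ↦ by rw [Matrix.sub_apply]; exact hJ' a b) i j

/-! ### Kernel example (interval `J`, Taylor leaf) -/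

/-- The file's first kernel example (`J(p) = [[−1, p], [0, −1]]` on `p ∈ [−1, 1]`, one order-0 leaf
`P = I`, `π = 1`): with radii `R = [[1/10, 0], [0, 1/10]]`, `P̄ = I`, `Δ_J = (1/5)·I`, the `Q` data
`[[2, 0], [0, 2]]` with radius `[[1/5, 1], [1, 1/5]]` still certify `m = 1/2 = 2·π·r` for `r = 1/4`
by the Gershgorin-type LDLᵀ bound. -/
example : KdCert.check (lyapTayLeafOKI 2 1 [[-1, 0], [0, -1]] [[[0, 1], [0, 0]]] [[1/10, 0], [0, 1/10]] (1/4))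
    [((-1 : ℚ), 1)]
    (KdCert.leaf ⟨[[0]], [[[1, 0], [0, 1]]], [[0], [1]], 1,
      ⟨1, 0, [], []⟩, ⟨-1, 0, [], []⟩, ⟨1/2, 0, [], []⟩⟩) = true := by
  decide +kernel

/-! ## APPEND #8 (2026-08-27, session 7): the FAST interval-`J` Taylor leaf check

`lyapTayLeafOKFI` = `lyapTayLeafOKI` (APPEND #7) with the regrouped tables computed by `lyapTayQTabsF`
(positions tabulated once, mask-selected whole-table sums — APPEND of session 5) instead of `lyapTayQTabs`.
Same tables on the block (`mget_lyapTayQTabsF`), hence `lyapTayLeafOKFI ⇒ lyapTayLeafOKI` and every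
soundness theorem of APPEND #7 transfers verbatim; the producer emits this form for the interval and
`RExpr` Taylor leaves (the plain form measured 520–554 s per file for the 84- and 34-leaf certificates on the farm).
[cite: GahinetApkarianChilali1996, §III; Hladik2017, §3] -/

/-- **The FAST Taylor–Lyapunov leaf check for an INTERVAL `J` family**: `lyapTayLeafOKI` with
`lyapTayQTabsF` in place of `lyapTayQTabs` (everything else identical).
[cite: GahinetApkarianChilali1996, §III; Hladik2017, §3] -/
def lyapTayLeafOKFI (n K : ℕ) (J0 : List (List ℚ)) (Js : List (List (List ℚ))) (R : List (List ℚ))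
    (r : ℚ) (B : Box) (l : LyapTayLeaf) : Bool :=
  let L := l.Ps.length
  let M := l.betas.length
  let w := boxHalfList K B
  let Qs := lyapTayQTabsF n K L M (affineAtQ n K J0 Js (boxCentreList K B)) Js l.Ps l.alphas l.betas
  let P0 := centreTab n L K l.alphas l.Ps
  nonnegQ n R && rall L (fun i ↦ symmQ n (l.Ps.getD i [])) && coverIdx K L M l.alphas l.betas &&
    decide (0 < l.cP.lam) && checkLower n P0 (zeroTab n) l.cP &&
    decide (0 < l.π) && decide (-l.π ≤ l.cN.lam) &&
    checkLower n (negTab n P0) (radTab n L K l.alphas l.Ps w) l.cN &&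
    decide (0 < l.cQ.lam) && decide (2 * l.π * r ≤ l.cQ.lam) &&
    checkLower n (centreTab n M K l.betas Qs)
      (addTab n (radTab n M K l.betas Qs w) (lyapRadJTab n R (tayAbsBoundTab n L K l.alphas l.Ps w))) l.cQ

/-- **Fast interval check ⇒ plain interval check** (same certificates, same tables).
[cite: GahinetApkarianChilali1996, §III; Hladik2017, §3] -/
theorem lyapTayLeafOKI_of_FI {n K : ℕ} {J0 : List (List ℚ)} {Js : List (List (List ℚ))}
    {R : List (List ℚ)} {r : ℚ} {B : Box} {l : LyapTayLeaf}
    (h : lyapTayLeafOKFI n K J0 Js R r B l = true) : lyapTayLeafOKI n K J0 Js R r B l = true := by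
  unfold lyapTayLeafOKFI at h
  unfold lyapTayLeafOKI
  simp only [Bool.and_eq_true] at h ⊢
  obtain ⟨hrest, hQ⟩ := h
  refine ⟨hrest, ?_⟩
  have hc := centreTab_congr₆ (n := n) (N := l.betas.length) (K := K) l.betas
    (fun j hj a ha b hb ↦ mget_lyapTayQTabsF (K := K) (L := l.Ps.length) (M := l.betas.length)
      (affineAtQ n K J0 Js (boxCentreList K B)) Js l.Ps l.alphas l.betas hj ha hb)
  have hr := radTab_congr₆ (n := n) (N := l.betas.length) (K := K) l.betas (boxHalfList K B)
    (fun j hj a ha b hb ↦ mget_lyapTayQTabsF (K := K) (L := l.Ps.length) (M := l.betas.length)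
      (affineAtQ n K J0 Js (boxCentreList K B)) Js l.Ps l.alphas l.betas hj ha hb)
  rw [hc, hr] at hQ
  exact hQ

/-- **Fast interval-`J` Taylor certificate, box level (END-TO-END)**: every member `J′` with
`|J′ − J(x)| ≤ R` at `x` in the box has `Re μ ≤ −r`.
[cite: GahinetApkarianChilali1996, §III; CarlsonSchneider1962, § 1; Hladik2017, §3] -/
theorem re_le_neg_of_kdCheck_lyapTayFI {n K : ℕ} {J0 : List (List ℚ)} {Js : List (List (List ℚ))}
    {R : List (List ℚ)} {r : ℚ} {B : Box} {t : KdCert LyapTayLeaf}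
    (h : t.check (lyapTayLeafOKFI n K J0 Js R r) B = true) (x : ℕ → ℝ) (hx : B.mem x)
    {J' : Matrix (Fin n) (Fin n) ℝ}
    (hJ' : ∀ i j : Fin n, |J' i j - (finMat n J0
      + paramMatrix (fun k : Fin K ↦ finMat n (Js.getD k [])) (fun k : Fin K ↦ x k)) i j| ≤ mreal R i j)
    {μ : ℂ} (hμ : μ ∈ spectrum ℂ (J'.map (algebraMap ℝ ℂ))) : μ.re ≤ -(r : ℝ) :=
  KdCert.sound (P := fun x ↦ ∀ J' : Matrix (Fin n) (Fin n) ℝ, (∀ i j : Fin n, |J' i j - (finMat n J0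
      + paramMatrix (fun k : Fin K ↦ finMat n (Js.getD k [])) (fun k : Fin K ↦ x k)) i j| ≤ mreal R i j) →
      ∀ μ : ℂ, μ ∈ spectrum ℂ (J'.map (algebraMap ℝ ℂ)) → μ.re ≤ -(r : ℝ))
    (fun _ _ hl x hx _ hJ' _ hμ ↦ re_le_neg_of_lyapTayLeafOKI (lyapTayLeafOKI_of_FI hl) x hx hJ' hμ)
    t B h x hx J' hJ' μ hμ

/-- **Shifted fast interval certificate** ⇒ `Re μ ≤ −(s + r)` for every member of the unshifted family.
[cite: GahinetApkarianChilali1996, §III; CarlsonSchneider1962, § 1] -/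
theorem re_le_neg_of_kdCheck_lyapTayFI_shifted {n K : ℕ} {J0 : List (List ℚ)}
    {Js : List (List (List ℚ))} {R : List (List ℚ)} {s r : ℚ} {B : Box} {t : KdCert LyapTayLeaf}
    (h : t.check (lyapTayLeafOKFI n K (addDiagTab n s J0) Js R r) B = true) (x : ℕ → ℝ) (hx : B.mem x)
    {J' : Matrix (Fin n) (Fin n) ℝ}
    (hJ' : ∀ i j : Fin n, |J' i j - (finMat n J0
      + paramMatrix (fun k : Fin K ↦ finMat n (Js.getD k [])) (fun k : Fin K ↦ x k)) i j| ≤ mreal R i j)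
    {μ : ℂ} (hμ : μ ∈ spectrum ℂ (J'.map (algebraMap ℝ ℂ))) : μ.re ≤ -((s + r : ℚ) : ℝ) := by
  refine re_le_neg_of_forall_shift₆ (fun ν hν ↦ re_le_neg_of_kdCheck_lyapTayFI h x hx
    (J' := J' + (s : ℝ) • (1 : Matrix (Fin n) (Fin n) ℝ)) (fun i j ↦ ?_) hν) hμ
  rw [finMat_addDiagTab₆]
  have e : (J' + (s : ℝ) • (1 : Matrix (Fin n) (Fin n) ℝ)) i j
      - (finMat n J0 + (s : ℝ) • (1 : Matrix (Fin n) (Fin n) ℝ)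
        + paramMatrix (fun k : Fin K ↦ finMat n (Js.getD k [])) (fun k : Fin K ↦ x k)) i j
      = J' i j - (finMat n J0 + paramMatrix (fun k : Fin K ↦ finMat n (Js.getD k [])) (fun k : Fin K ↦ x k)) i j := by
    simp only [Matrix.add_apply, Matrix.smul_apply]; ring
  rw [e]; exact hJ' i j

/-- **Balanced + shifted fast interval certificate ⇒ rate bound for every member of the ORIGINAL interval
family.** [cite: GahinetApkarianChilali1996, §III; CarlsonSchneider1962, § 1] -/
theorem re_le_neg_of_kdCheck_lyapTayFI_conj_shifted {n K : ℕ} {J0 : List (List ℚ)}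
    {Js : List (List (List ℚ))} {R : List (List ℚ)} {d : List ℚ} {s r : ℚ} {B : Box}
    {t : KdCert LyapTayLeaf} (hd : posListQ n d = true)
    (h : t.check (lyapTayLeafOKFI n K (addDiagTab n s (conjDiagTab n d J0))
      (vtab K fun k ↦ conjDiagTab n d (Js.getD k [])) (conjDiagTab n d R) r) B = true)
    (x : ℕ → ℝ) (hx : B.mem x) {J' : Matrix (Fin n) (Fin n) ℝ}
    (hJ' : ∀ i j : Fin n, |J' i j - (finMat n J0
      + paramMatrix (fun k : Fin K ↦ finMat n (Js.getD k [])) (fun k : Fin K ↦ x k)) i j| ≤ mreal R i j)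
    {μ : ℂ} (hμ : μ ∈ spectrum ℂ (J'.map (algebraMap ℝ ℂ))) : μ.re ≤ -((s + r : ℚ) : ℝ) := by
  set Mx : Matrix (Fin n) (Fin n) ℝ :=
    finMat n J0 + paramMatrix (fun k : Fin K ↦ finMat n (Js.getD k [])) (fun k : Fin K ↦ x k) with hMx
  have hμ' := mem_spectrum_conjDiag₆ hd hμ
  refine re_le_neg_of_kdCheck_lyapTayFI_shifted h x hx (fun i j ↦ ?_) hμ'
  rw [affine_conjDiagTab_eq₆ d J0 Js x, ← hMx, ← Matrix.sub_apply, ← Matrix.sub_mul, ← Matrix.mul_sub]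
  exact abs_conj_le₇ hd (E := J' - Mx) (fun a b ↦ by rw [Matrix.sub_apply]; exact hJ' a b) i j

/-- The interval kernel example of APPEND #7, through the fast check. -/
example : KdCert.check (lyapTayLeafOKFI 2 1 [[-1, 0], [0, -1]] [[[0, 1], [0, 0]]] [[1/10, 0], [0, 1/10]] (1/4))
    [((-1 : ℚ), 1)]
    (KdCert.leaf ⟨[[0]], [[[1, 0], [0, 1]]], [[0], [1]], 1,
      ⟨1, 0, [], []⟩, ⟨-1, 0, [], []⟩, ⟨1/2, 0, [], []⟩⟩) = true := by
  decide +kernel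

end Literature.Analysis.ValidatedNumerics
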